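import Mathlib
import Literature.Probability.Moments.HoeffdingDecomposition
import Literature.Computability.Complexity.RandomKSatLowDegreeHardness
import Literature.Computability.Complexity.RandomKSatEnsembleOGP
import Literature.Probability.LatticeModels.BinomialEntropy
import Literature.Combinatorics.BinomialEntropyBound
import Literature.Computability.Complexity.CookBridges
import Literature.Computability.Complexity.CodeFPStrings
import Literature.Computability.Complexity.HuangSellkeResamplingChain
import HarnessLib

/-!
# Huang–Sellke 2025 random `k`-SAT: the moat / small-ball / entropy ladder of the resampling chain, band energy and counts, the OGP first moment — re-homed proofs, file 2 of 3

**Huang–Sellke 2025: the ensemble overlap-gap property of random `k`-SAT on the resampling chain (Lemma 3.22), the resampling-chain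
obstructions (Lemmas 3.22–3.23) and strong low-degree hardness at clause density `α_k = 5·2^k log k / k` (Corollary 3.21)** — the three named
facts `Literature.Computability.Complexity.HuangSellke2025KSatEnsembleOGP`, `…HuangSellke2025KSatObstructions` (`RandomKSatEnsembleOGP.lean`) and
`…HuangSellke2025KSat` (`RandomKSatLowDegreeHardness.lean`) HOLD (B. Huang, M. Sellke, *Strong low degree hardness for stable local optima in
spin glasses*, arXiv:2501.06427, §3.3.2, Lemma 3.22 «adaptation of Bresler–Huang 2021 Prop. 4.7(iii)», Lemma 3.23, Cor. 3.21 [HuangSellke2025];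
G. Bresler, B. Huang, FOCS 2021 [BreslerHuang2021]).  ARCHITECTURE of the in-tree proof (kernel-checked, 0 cited facts; until now Summits-side
only, `Summits/PneNP/PneNP/Theorems/OverlapGapAlgebraSearchHardWindowEnsembleOGPHolds.lean`): the `ε`-resampling chain of random `k`-SAT
formulas (kernel, semigroup, paths, two-block and multi-time marginals `stub_multiTimeMarginal`), the product over clause slots
(`stub_slotFactorization`), the mixture over refresh patterns (`stub_blockExpansion`), the LITERAL-level greedy slot bound (`stub_slotBound`) and the
band ⇒ first-appearance energy with `s` darts (the DartGame `en_rung`, `stub_bandEnergy`) give the per-tuple first moment `ogp_tupleBound`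
(survival `≤ base^m`); with the band count (`stub_bandCount`, binomial entropy), the first moment at one `n` (`stub_ogpCore`) and the parameter
asymptotics (`stub_ogpAsymptotics`: `β = 2.65 log k/k`, `η = 0.05 log k/k`, …) this is Lemma 3.22; the moat / small-ball / entropy ladder of
`NoStableSection*`, the grand correlation and resample stability / positivity give the chaos and instability legs, and `…StrongLDH` turns the
ensemble OGP into the obstructions (Lemma 3.23) and Cor. 3.21.  (Mathematical note carried over from the source: the printed reduction of Lemma 3.22
to coincident times is false pointwise for the literal-level chain; the in-tree proof bounds every time tuple directly.)  RE-HOMED into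
`Literature/` by the Hodge foundations lane (`lit-hodgefound`, seat p20, generations 38–39) as THREE files: verbatim DECLARATION-LEVEL ports (the
declarations needed, in dependency order) of 42 Summits modules `Summits/PneNP/PneNP/Theorems/OverlapGapAlgebra{NoStableSection*,SearchHardWindow*}.lean`,
namespaces `Summit.PneNP.PneNP.Theorems` / `Summit.PneNP.PneNP.Cruxes.NoStableSection.DartGame` re-rooted as
`Literature.Computability.Complexity.HuangSellke2025Chain` / `….HuangSellke2025Chain.DartGame` (in-tree `stub_…` names kept, they are proved
theorems; the DartGame gadgets `seqOf` & co. come with their bodies), followed (file 3) by the three EXACT-name discharges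
`Literature.Computability.Complexity.HuangSellke2025KSatEnsembleOGP_holds`, `…HuangSellke2025KSatObstructions_holds`, `…HuangSellke2025KSat_holds`.
No new named fact (D-0026), no Summits import; built on the tree's Literature layer (`Computability/Complexity/{RandomKSatEnsembleOGP,
RandomKSatLowDegreeHardness, BinomialEntropy*}`, `Probability/Moments/HoeffdingDecomposition`) and Mathlib.  The Summits
originals stay in place (transitional duplication).  WHAT THIS IS NOT: nothing about P vs NP; no claim beyond the three displayed statements
(ensemble OGP on the resampling chain, the obstructions, and the deterministic saturated form of Cor. 3.21 with `κ = 5`).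

THIS FILE (2 of 3; rebuilt in generation 39 after the generation-38 proposal bounced on a missing `open`-ed namespace import) ports: OverlapGapAlgebraNoStableSectionSmallBall, OverlapGapAlgebraNoStableSectionEnergyAux, OverlapGapAlgebraNoStableSectionEnergyFA, OverlapGapAlgebraNoStableSectionEnergy, OverlapGapAlgebraNoStableSectionLadder, OverlapGapAlgebraSearchHardWindowLowDegreeStability, OverlapGapAlgebraSearchHardWindowMoatTransfer, OverlapGapAlgebraSearchHardWindowBandEnergy, OverlapGapAlgebraNoStableSectionCount, OverlapGapAlgebraNoStableSectionEntropy, OverlapGapAlgebraSearchHardWindowMoat, OverlapGapAlgebraSearchHardWindowLowEntropyCount, OverlapGapAlgebraSearchHardWindowBandCount, OverlapGapAlgebraSearchHardWindowOgpCore, OverlapGapAlgebraNoStableSectionGlue2, OverlapGapAlgebraNoStableSectionGlue3, OverlapGapAlgebraSearchHardWindowChaosAsymptotics.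
-/

noncomputable section

/-!
## Part 1 — port of `Summits/PneNP/PneNP/Theorems/OverlapGapAlgebraNoStableSectionSmallBall.lean` (12 declarations kept)

# The small-ball lemma of card `binomial-extremal-dart-game` (Hoeffding–Bentkus extremality)

`dartGameSmallBall` : for a finitely supported law `w` on values `X i ∈ [0,1]` with mean
`p = ∑ w i * X i`, the `k`-fold i.i.d. sum satisfies
`P[∑ X < 1] ≤ 2 (1-p)^k + k p (1-p)^(k-1)`.
Proof: Hoeffding–Bentkus binomial extremality in convex order (`sbSum_le_bernoulli`) tested on the
hockey stick `x ↦ max (2 - x) 0`.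

Moved from `Cruxes/NoStableSection/SketchIdeator1DartGame.lean` (line `DartGame` of crux
`NoStableSection`, stmt-PneNP-2462), with the four auxiliary definitions (`Ssum`, `bw`, `bX`,
`hockey`) written out, so that the file declares theorems only:
* `∑ ω : Fin k → Fin N, (∏ r, w (ω r)) * φ (∑ r, X (ω r))` is `E[φ(X_{ω 0} + ⋯ + X_{ω (k-1)})]`
  under the `k`-fold product of the law `w`;
* the Bernoulli(`p`) law is the weight vector `![1 - p, p]` on the values `![0, 1]`;
* the hockey stick at level `c` is `s ↦ max (c - s) 0`.
It is used by the stub `energyBound` (`Theorems/OverlapGapAlgebraNoStableSectionEnergy.lean`).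
-/

section Part1

namespace Literature.Computability.Complexity.HuangSellke2025Chain.DartGame
open _root_.Finset

variable {N : ℕ}

/-- Peeling off the first coordinate of the `k + 1`-fold product law.
[cite: HuangSellke2025, §3.3.2, proof of Lemma 3.22 (moat / small-ball / entropy ladder of the resampling chain: small-ball estimate of the DartGame energy)] -/
theorem sbSum_succ (k : ℕ) (w X : Fin N → ℝ) (φ : ℝ → ℝ) :
    ∑ ω : Fin (k + 1) → Fin N, (∏ r, w (ω r)) * φ (∑ r, X (ω r)) =
      ∑ i : Fin N, w i * ∑ ω : Fin k → Fin N, (∏ r, w (ω r)) * φ (X i + ∑ r, X (ω r)) := by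
  rw [← (Fin.consEquiv fun _ => Fin N).sum_comp, Fintype.sum_prod_type]
  refine Finset.sum_congr rfl fun i _ => ?_
  rw [Finset.mul_sum]
  refine Finset.sum_congr rfl fun ω _ => ?_
  simp only [Fin.consEquiv, Equiv.coe_fn_mk, Fin.prod_univ_succ, Fin.sum_univ_succ, Fin.cons_zero,
    Fin.cons_succ]
  ring

/-- The chord inequality: a convex function lies below its chord over `[c, c+1]`.
[cite: HuangSellke2025, §3.3.2, proof of Lemma 3.22 (moat / small-ball / entropy ladder of the resampling chain: small-ball estimate of the DartGame energy)] -/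
theorem sb_chord {φ : ℝ → ℝ} (hφ : ConvexOn ℝ Set.univ φ) {x : ℝ} (hx0 : 0 ≤ x) (hx1 : x ≤ 1)
    (c : ℝ) : φ (x + c) ≤ (1 - x) * φ c + x * φ (1 + c) := by
  have h := hφ.2 (Set.mem_univ c) (Set.mem_univ (1 + c)) (sub_nonneg.2 hx1) hx0 (by ring)
  have heq : (1 - x) • c + x • (1 + c) = x + c := by
    simp only [smul_eq_mul]; ring
  rw [heq] at h
  simpa [smul_eq_mul] using h

/-- Peeling off the first coordinate of the Bernoulli product law.
[cite: HuangSellke2025, §3.3.2, proof of Lemma 3.22 (moat / small-ball / entropy ladder of the resampling chain: small-ball estimate of the DartGame energy)] -/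
theorem sbBern_succ (k : ℕ) (p : ℝ) (φ : ℝ → ℝ) :
    ∑ ω : Fin (k + 1) → Fin 2, (∏ r, (![1 - p, p] : Fin 2 → ℝ) (ω r)) *
        φ (∑ r, (![(0 : ℝ), 1] : Fin 2 → ℝ) (ω r)) =
      (1 - p) * ∑ ω : Fin k → Fin 2, (∏ r, (![1 - p, p] : Fin 2 → ℝ) (ω r)) *
          φ (∑ r, (![(0 : ℝ), 1] : Fin 2 → ℝ) (ω r)) +
        p * ∑ ω : Fin k → Fin 2, (∏ r, (![1 - p, p] : Fin 2 → ℝ) (ω r)) *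
          φ (1 + ∑ r, (![(0 : ℝ), 1] : Fin 2 → ℝ) (ω r)) := by
  rw [sbSum_succ, Fin.sum_univ_two]
  simp

/-- A translate of a convex function on the line is convex.
[cite: HuangSellke2025, §3.3.2, proof of Lemma 3.22 (moat / small-ball / entropy ladder of the resampling chain: small-ball estimate of the DartGame energy)] -/
theorem sb_convexOn_translate {φ : ℝ → ℝ} (hφ : ConvexOn ℝ Set.univ φ) (c : ℝ) :
    ConvexOn ℝ Set.univ (fun s => φ (c + s)) := by
  refine ⟨convex_univ, ?_⟩
  intro x _ y _ a b ha hb hab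
  have h := hφ.2 (Set.mem_univ (c + x)) (Set.mem_univ (c + y)) ha hb hab
  have heq : a • (c + x) + b • (c + y) = c + (a • x + b • y) := by
    simp only [smul_eq_mul]
    rw [show a * (c + x) + b * (c + y) = (a + b) * c + (a * x + b * y) by ring, hab, one_mul]
  rw [heq] at h
  exact h

/-- **Hoeffding–Bentkus extremality (finitary convex order).** Among all laws on `[0,1]` with a
given mean `p`, the Bernoulli(`p`) law maximises `E φ(X₁ + ⋯ + X_k)` for every convex `φ`.
[cite: HuangSellke2025, §3.3.2, proof of Lemma 3.22 (moat / small-ball / entropy ladder of the resampling chain: small-ball estimate of the DartGame energy)] -/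
theorem sbSum_le_bernoulli (w X : Fin N → ℝ) (hw : ∀ i, 0 ≤ w i) (hw1 : ∑ i, w i = 1)
    (hX : ∀ i, X i ∈ Set.Icc (0 : ℝ) 1) (k : ℕ) :
    ∀ φ : ℝ → ℝ, ConvexOn ℝ Set.univ φ →
      ∑ ω : Fin k → Fin N, (∏ r, w (ω r)) * φ (∑ r, X (ω r)) ≤
        ∑ ω : Fin k → Fin 2, (∏ r, (![1 - ∑ i, w i * X i, ∑ i, w i * X i] : Fin 2 → ℝ) (ω r)) *
          φ (∑ r, (![(0 : ℝ), 1] : Fin 2 → ℝ) (ω r)) := by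
  set p : ℝ := ∑ i, w i * X i with hp
  have hp0 : 0 ≤ p := Finset.sum_nonneg fun i _ => mul_nonneg (hw i) (hX i).1
  have hp1 : p ≤ 1 := by
    calc p ≤ ∑ i, w i * 1 := Finset.sum_le_sum fun i _ => mul_le_mul_of_nonneg_left (hX i).2 (hw i)
      _ = 1 := by simp [hw1]
  have hbw : ∀ i, 0 ≤ (![1 - p, p] : Fin 2 → ℝ) i := by
    intro i; fin_cases i <;> simp [hp0, hp1]
  induction k with
  | zero => intro φ _; simp
  | succ k ih =>
    intro φ hφ
    calc ∑ ω : Fin (k + 1) → Fin N, (∏ r, w (ω r)) * φ (∑ r, X (ω r))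
        = ∑ i, w i * ∑ ω : Fin k → Fin N, (∏ r, w (ω r)) * φ (X i + ∑ r, X (ω r)) :=
          sbSum_succ k w X φ
      _ ≤ ∑ i, w i * ∑ ω : Fin k → Fin 2, (∏ r, (![1 - p, p] : Fin 2 → ℝ) (ω r)) *
            φ (X i + ∑ r, (![(0 : ℝ), 1] : Fin 2 → ℝ) (ω r)) :=
          Finset.sum_le_sum fun i _ =>
            mul_le_mul_of_nonneg_left (ih (fun s => φ (X i + s)) (sb_convexOn_translate hφ (X i)))
              (hw i)
      _ = ∑ ω : Fin k → Fin 2, (∏ r, (![1 - p, p] : Fin 2 → ℝ) (ω r)) *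
            ∑ i, w i * φ (X i + ∑ r, (![(0 : ℝ), 1] : Fin 2 → ℝ) (ω r)) := by
          simp only [Finset.mul_sum]
          rw [Finset.sum_comm]
          refine Finset.sum_congr rfl fun ω _ => Finset.sum_congr rfl fun i _ => ?_
          ring
      _ ≤ ∑ ω : Fin k → Fin 2, (∏ r, (![1 - p, p] : Fin 2 → ℝ) (ω r)) *
            ((1 - p) * φ (∑ r, (![(0 : ℝ), 1] : Fin 2 → ℝ) (ω r)) +
              p * φ (1 + ∑ r, (![(0 : ℝ), 1] : Fin 2 → ℝ) (ω r))) := by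
          refine Finset.sum_le_sum fun ω _ => mul_le_mul_of_nonneg_left ?_
            (Finset.prod_nonneg fun r _ => hbw _)
          set s : ℝ := ∑ r, (![(0 : ℝ), 1] : Fin 2 → ℝ) (ω r)
          calc ∑ i, w i * φ (X i + s)
              ≤ ∑ i, w i * ((1 - X i) * φ s + X i * φ (1 + s)) :=
                Finset.sum_le_sum fun i _ =>
                  mul_le_mul_of_nonneg_left (sb_chord hφ (hX i).1 (hX i).2 s) (hw i)
            _ = (∑ i, w i) * φ s - (∑ i, w i * X i) * φ s + (∑ i, w i * X i) * φ (1 + s) := by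
                simp only [Finset.sum_mul, ← Finset.sum_sub_distrib, ← Finset.sum_add_distrib]
                refine Finset.sum_congr rfl fun i _ => ?_
                ring
            _ = (1 - p) * φ s + p * φ (1 + s) := by rw [hw1, ← hp]; ring
      _ = (1 - p) * ∑ ω : Fin k → Fin 2, (∏ r, (![1 - p, p] : Fin 2 → ℝ) (ω r)) *
              φ (∑ r, (![(0 : ℝ), 1] : Fin 2 → ℝ) (ω r)) +
            p * ∑ ω : Fin k → Fin 2, (∏ r, (![1 - p, p] : Fin 2 → ℝ) (ω r)) *
              φ (1 + ∑ r, (![(0 : ℝ), 1] : Fin 2 → ℝ) (ω r)) := by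
          rw [Finset.mul_sum, Finset.mul_sum, ← Finset.sum_add_distrib]
          refine Finset.sum_congr rfl fun ω _ => ?_
          ring
      _ = ∑ ω : Fin (k + 1) → Fin 2, (∏ r, (![1 - p, p] : Fin 2 → ℝ) (ω r)) *
            φ (∑ r, (![(0 : ℝ), 1] : Fin 2 → ℝ) (ω r)) := (sbBern_succ k p φ).symm

/-- The hockey stick `x ↦ max (c - x) 0` is convex.
[cite: HuangSellke2025, §3.3.2, proof of Lemma 3.22 (moat / small-ball / entropy ladder of the resampling chain: small-ball estimate of the DartGame energy)] -/
theorem sb_convexOn_hockey (c : ℝ) : ConvexOn ℝ Set.univ (fun x : ℝ => max (c - x) 0) := by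
  have h1 : ConvexOn ℝ Set.univ (fun x : ℝ => c - x) := by
    refine ⟨convex_univ, ?_⟩
    intro x _ y _ a b _ _ hab
    simp only [smul_eq_mul]
    have : a * (c - x) + b * (c - y) = (a + b) * c - (a * x + b * y) := by ring
    rw [this, hab, one_mul]
  have h2 : ConvexOn ℝ Set.univ (fun _ : ℝ => (0 : ℝ)) := convexOn_const 0 convex_univ
  exact h1.sup h2

/-- The Bernoulli sums are nonnegative combinations of the values `0, 1`.
[cite: HuangSellke2025, §3.3.2, proof of Lemma 3.22 (moat / small-ball / entropy ladder of the resampling chain: small-ball estimate of the DartGame energy)] -/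
theorem sbBern_sum_nonneg {k : ℕ} (ω : Fin k → Fin 2) :
    0 ≤ ∑ r, (![(0 : ℝ), 1] : Fin 2 → ℝ) (ω r) :=
  Finset.sum_nonneg fun r _ => by
    generalize ω r = j
    fin_cases j <;> simp

/-- A hockey stick at a nonpositive level vanishes on the Bernoulli sums.
[cite: HuangSellke2025, §3.3.2, proof of Lemma 3.22 (moat / small-ball / entropy ladder of the resampling chain: small-ball estimate of the DartGame energy)] -/
theorem sbHockey_nonpos (k : ℕ) (p : ℝ) {c : ℝ} (hc : c ≤ 0) :
    ∑ ω : Fin k → Fin 2, (∏ r, (![1 - p, p] : Fin 2 → ℝ) (ω r)) *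
      max (c - ∑ r, (![(0 : ℝ), 1] : Fin 2 → ℝ) (ω r)) 0 = 0 := by
  refine Finset.sum_eq_zero fun ω _ => ?_
  have hs := sbBern_sum_nonneg ω
  rw [max_eq_right (by linarith), mul_zero]

/-- Peeling off the first Bernoulli coordinate shifts the hockey stick level by one.
[cite: HuangSellke2025, §3.3.2, proof of Lemma 3.22 (moat / small-ball / entropy ladder of the resampling chain: small-ball estimate of the DartGame energy)] -/
theorem sbHockey_succ (k : ℕ) (p c : ℝ) :
    ∑ ω : Fin (k + 1) → Fin 2, (∏ r, (![1 - p, p] : Fin 2 → ℝ) (ω r)) *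
        max (c - ∑ r, (![(0 : ℝ), 1] : Fin 2 → ℝ) (ω r)) 0 =
      (1 - p) * ∑ ω : Fin k → Fin 2, (∏ r, (![1 - p, p] : Fin 2 → ℝ) (ω r)) *
          max (c - ∑ r, (![(0 : ℝ), 1] : Fin 2 → ℝ) (ω r)) 0 +
        p * ∑ ω : Fin k → Fin 2, (∏ r, (![1 - p, p] : Fin 2 → ℝ) (ω r)) *
          max (c - 1 - ∑ r, (![(0 : ℝ), 1] : Fin 2 → ℝ) (ω r)) 0 := by
  have h := sbBern_succ k p (fun s => max (c - s) 0)
  beta_reduce at h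
  rw [h]
  congr 1
  congr 1
  refine Finset.sum_congr rfl fun ω _ => ?_
  congr 2
  ring

/-- `E max(1 - Bin(k,p), 0) = (1-p)^k`.
[cite: HuangSellke2025, §3.3.2, proof of Lemma 3.22 (moat / small-ball / entropy ladder of the resampling chain: small-ball estimate of the DartGame energy)] -/
theorem sbHockey_one (k : ℕ) (p : ℝ) :
    ∑ ω : Fin k → Fin 2, (∏ r, (![1 - p, p] : Fin 2 → ℝ) (ω r)) *
      max (1 - ∑ r, (![(0 : ℝ), 1] : Fin 2 → ℝ) (ω r)) 0 = (1 - p) ^ k := by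
  induction k with
  | zero => simp
  | succ k ih =>
    rw [sbHockey_succ, ih, show (1 : ℝ) - 1 = 0 by norm_num, sbHockey_nonpos k p le_rfl]
    ring

/-- `E max(2 - Bin(k,p), 0) = 2(1-p)^k + k p (1-p)^(k-1)`.
[cite: HuangSellke2025, §3.3.2, proof of Lemma 3.22 (moat / small-ball / entropy ladder of the resampling chain: small-ball estimate of the DartGame energy)] -/
theorem sbHockey_two (k : ℕ) (p : ℝ) :
    ∑ ω : Fin k → Fin 2, (∏ r, (![1 - p, p] : Fin 2 → ℝ) (ω r)) *
      max (2 - ∑ r, (![(0 : ℝ), 1] : Fin 2 → ℝ) (ω r)) 0 =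
      2 * (1 - p) ^ k + k * p * (1 - p) ^ (k - 1) := by
  induction k with
  | zero => simp
  | succ k ih =>
    rw [sbHockey_succ, ih, show (2 : ℝ) - 1 = 1 by norm_num, sbHockey_one]
    cases k with
    | zero => simp; ring
    | succ j =>
      simp only [Nat.add_sub_cancel, pow_succ]
      push_cast
      ring

/-- **The small-ball lemma** (card `binomial-extremal-dart-game`, first lemma): for a law `w` on
values `X i ∈ [0,1]` with mean `p = ∑ w i * X i`,
`P[∑_{r<k} X_{ω r} < 1] ≤ 2(1-p)^k + k p (1-p)^(k-1)` under the `k`-fold product law.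
[cite: HuangSellke2025, §3.3.2, proof of Lemma 3.22 (moat / small-ball / entropy ladder of the resampling chain: small-ball estimate of the DartGame energy)] -/
theorem dartGameSmallBall (k N : ℕ) (w X : Fin N → ℝ) (hw : ∀ i, 0 ≤ w i) (hw1 : ∑ i, w i = 1)
    (hX : ∀ i, X i ∈ Set.Icc (0 : ℝ) 1) :
    ∑ ω ∈ (univ : Finset (Fin k → Fin N)).filter (fun ω => ∑ r, X (ω r) < 1), ∏ r, w (ω r) ≤
      2 * (1 - ∑ i, w i * X i) ^ k + k * (∑ i, w i * X i) * (1 - ∑ i, w i * X i) ^ (k - 1) := by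
  -- step 1: the indicator of `{s < 1}` lies below the hockey stick at level 2
  have h1 : ∑ ω ∈ (univ : Finset (Fin k → Fin N)).filter (fun ω => ∑ r, X (ω r) < 1), ∏ r, w (ω r)
      ≤ ∑ ω : Fin k → Fin N, (∏ r, w (ω r)) * max (2 - ∑ r, X (ω r)) 0 := by
    rw [Finset.sum_filter]
    refine Finset.sum_le_sum fun ω _ => ?_
    have hprod : 0 ≤ ∏ r, w (ω r) := Finset.prod_nonneg fun r _ => hw _
    split_ifs with hlt
    · have hm : (1 : ℝ) ≤ max (2 - ∑ r, X (ω r)) 0 := le_max_of_le_left (by linarith)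
      nlinarith
    · exact mul_nonneg hprod (le_max_right _ _)
  -- step 2: binomial extremality in convex order
  have h2 := sbSum_le_bernoulli w X hw hw1 hX k (fun s => max (2 - s) 0) (sb_convexOn_hockey 2)
  -- step 3: evaluate the Bernoulli side
  have h3 := sbHockey_two k (∑ i, w i * X i)
  beta_reduce at h2
  linarith

end Literature.Computability.Complexity.HuangSellke2025Chain.DartGame

end Part1

/-!
## Part 2 — port of `Summits/PneNP/PneNP/Theorems/OverlapGapAlgebraNoStableSectionEnergyAux.lean` (7 declarations kept)

# Route OverlapGapAlgebra, crux `NoStableSection` (stmt-PneNP-2462), line `DartGame`: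
# stub `stub_energyBound`, part 1 (abstract per-rung bound)

The counting / real-analysis half of the energy bound of the line `DartGame` (Bresler–Huang,
arXiv:2106.02129, Prop. 5.2 with Props 5.5–5.7 replaced by first appearance + binomial
extremality): for weights `φ : Fin n → (0,1]`, a truncation level `θ` and a rung `ℓ` of
`Y : ℕ → Fin n → Bool`, the number of tuples `I : Fin k → Fin n` whose rung-`ℓ` pattern is new is at
least `n^k (1 - SB(p₀) - ℓ θ)`, `SB(p) = 2(1-p)^k + k p (1-p)^(k-1)`, `p₀ = (b - 2θ)/(-log θ)`
(`en_rung_abstract`), given `∑ -log φ ≥ n b`, `∑ 1/φ ≤ 2n`, `∑_{Y ℓ i = Y ℓ' i} 1/φ ≤ n`.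
Uses the small-ball lemma `dartGameSmallBall` (`OverlapGapAlgebraNoStableSectionSmallBall`).
Part 2 (`OverlapGapAlgebraNoStableSectionEnergy`) instantiates `φ` with conditional pattern
frequencies and proves `stub_energyBound`.
-/

section Part2

namespace Literature.Computability.Complexity.HuangSellke2025Chain.DartGame
open _root_.Finset _root_.Real

/-! ## Stub En, part 1: the abstract per-rung bound (counting and real analysis only)

Fix a rung `ℓ`, weights `φ : Fin n → ℝ` in `(0, 1]` attached to positions (in the application
`φ i` is the conditional frequency of the bit `Y ℓ i` within the class of `i` over rungs `< ℓ`),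
a truncation level `θ ∈ (0,1)` and `L = -log θ`.  A tuple `I : Fin k → Fin n` is *small* if
`∏_r φ (I r) ≤ θ` and *new* if its rung-`ℓ` pattern `(Y ℓ (I r))_r` differs from the rung-`ℓ'`
pattern for every `ℓ' < ℓ`.  Then
* `#{¬ small} ≤ n^k · SB(p₀)` (`en_card_notSmall_le`: `dartGameSmallBall` with uniform weights and
  scores `X = (p₀/p) · min(-log φ, L)/L`, whose mean is `p₀ = (b - 2θ)/L` as soon as
  `∑ -log φ ≥ n b` and `∑ 1/φ ≤ 2n`, by `log x ≤ x - 1`);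
* `#{small ∧ ¬ new} ≤ ℓ θ n^k` (`en_card_small_notNew_le`: a Markov-type bound, using
  `∑_{Y ℓ i = Y ℓ' i} 1/φ i ≤ n`);
whence `#{new} ≥ n^k (1 - SB(p₀) - ℓ θ)` (`en_rung_abstract`). -/

section Aux

variable {n : ℕ}

/-- `∑_{I : Fin k → Fin n} ∏_r f (I r) = (∑_i f i)^k ≤ c ^ k` for `0 ≤ f` with `∑ f ≤ c`.
[cite: HuangSellke2025, §3.3.2, proof of Lemma 3.22 (moat / small-ball / entropy ladder of the resampling chain: energy auxiliaries of the DartGame)] -/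
theorem en_sum_prod_le {k : ℕ} (f : Fin n → ℝ) (hf : ∀ i, 0 ≤ f i) {c : ℝ} (h : ∑ i, f i ≤ c) :
    ∑ I : Fin k → Fin n, ∏ r, f (I r) ≤ c ^ k := by
  rw [← Fintype.sum_pow]
  exact pow_le_pow_left₀ (Finset.sum_nonneg fun i _ => hf i) h k

/-- Markov-type bound: the number of tuples `I` with `∏_r φ (I r) ≤ θ` all of whose entries
satisfy `P` is at most `θ · (∑_{P i} 1/φ i)^k ≤ θ n^k`.
[cite: HuangSellke2025, §3.3.2, proof of Lemma 3.22 (moat / small-ball / entropy ladder of the resampling chain: energy auxiliaries of the DartGame)] -/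
theorem en_card_small_forall_le {k : ℕ} (φ : Fin n → ℝ) (hφ0 : ∀ i, 0 < φ i) {θ : ℝ}
    (hθ : 0 < θ) (P : Fin n → Prop) [DecidablePred P]
    (hP : ∑ i ∈ univ.filter P, (φ i)⁻¹ ≤ n) :
    ((univ.filter fun I : Fin k → Fin n => ∏ r, φ (I r) ≤ θ ∧ ∀ r, P (I r)).card : ℝ) ≤
      θ * (n : ℝ) ^ k := by
  have hg0 : ∀ i, 0 ≤ (if P i then (φ i)⁻¹ else 0 : ℝ) := fun i => by
    split_ifs
    · exact inv_nonneg.2 (hφ0 i).le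
    · exact le_rfl
  have hgs : ∑ i, (if P i then (φ i)⁻¹ else 0 : ℝ) ≤ n := by rwa [← Finset.sum_filter]
  rw [natCast_card_filter]
  calc ∑ I : Fin k → Fin n, (if ∏ r, φ (I r) ≤ θ ∧ ∀ r, P (I r) then (1 : ℝ) else 0)
      ≤ ∑ I : Fin k → Fin n, θ * ∏ r, (if P (I r) then (φ (I r))⁻¹ else 0 : ℝ) := by
        refine Finset.sum_le_sum fun I _ => ?_
        split_ifs with h
        · have hall : ∀ r, (if P (I r) then (φ (I r))⁻¹ else 0 : ℝ) = (φ (I r))⁻¹ := fun r => by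
            simp [h.2 r]
          rw [Finset.prod_congr rfl fun r _ => hall r, Finset.prod_inv_distrib, ← div_eq_mul_inv,
            one_le_div (Finset.prod_pos fun r _ => hφ0 _)]
          exact h.1
        · exact mul_nonneg hθ.le (Finset.prod_nonneg fun r _ => hg0 _)
    _ = θ * ∑ I : Fin k → Fin n, ∏ r, (if P (I r) then (φ (I r))⁻¹ else 0 : ℝ) := by
        rw [Finset.mul_sum]
    _ ≤ θ * (n : ℝ) ^ k :=
        mul_le_mul_of_nonneg_left
          (en_sum_prod_le (fun i => if P i then (φ i)⁻¹ else 0) hg0 hgs) hθ.le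

/-- Truncated non-new tuples are rare:
`#{I : ∏ φ(I r) ≤ θ, the rung-ℓ pattern of I repeats an earlier rung} ≤ ℓ θ n^k`.
[cite: HuangSellke2025, §3.3.2, proof of Lemma 3.22 (moat / small-ball / entropy ladder of the resampling chain: energy auxiliaries of the DartGame)] -/
theorem en_card_small_notNew_le {k : ℕ} (Y : ℕ → Fin n → Bool) (ℓ : ℕ) (φ : Fin n → ℝ)
    (hφ0 : ∀ i, 0 < φ i) {θ : ℝ} (hθ : 0 < θ)
    (hP : ∀ ℓ' < ℓ, ∑ i ∈ univ.filter (fun i => Y ℓ i = Y ℓ' i), (φ i)⁻¹ ≤ n) :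
    ((univ.filter fun I : Fin k → Fin n =>
        ∏ r, φ (I r) ≤ θ ∧ ¬ ∀ ℓ' < ℓ, ¬ ∀ r, Y ℓ (I r) = Y ℓ' (I r)).card : ℝ) ≤
      ℓ * θ * (n : ℝ) ^ k := by
  calc ((univ.filter fun I : Fin k → Fin n =>
        ∏ r, φ (I r) ≤ θ ∧ ¬ ∀ ℓ' < ℓ, ¬ ∀ r, Y ℓ (I r) = Y ℓ' (I r)).card : ℝ)
      ≤ (((range ℓ).biUnion fun ℓ' => univ.filter fun I : Fin k → Fin n =>
          ∏ r, φ (I r) ≤ θ ∧ ∀ r, Y ℓ (I r) = Y ℓ' (I r)).card : ℝ) := by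
        have hsub : (univ.filter fun I : Fin k → Fin n =>
            ∏ r, φ (I r) ≤ θ ∧ ¬ ∀ ℓ' < ℓ, ¬ ∀ r, Y ℓ (I r) = Y ℓ' (I r)) ⊆
            (range ℓ).biUnion fun ℓ' => univ.filter fun I : Fin k → Fin n =>
              ∏ r, φ (I r) ≤ θ ∧ ∀ r, Y ℓ (I r) = Y ℓ' (I r) := by
          intro I hI
          simp only [mem_filter, mem_univ, true_and] at hI
          obtain ⟨hsmall, hnot⟩ := hI
          push Not at hnot
          obtain ⟨ℓ', hℓ', hmatch⟩ := hnot
          simp only [mem_biUnion, mem_range, mem_filter, mem_univ, true_and]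
          exact ⟨ℓ', hℓ', hsmall, hmatch⟩
        exact_mod_cast card_le_card hsub
    _ ≤ ∑ ℓ' ∈ range ℓ, ((univ.filter fun I : Fin k → Fin n =>
          ∏ r, φ (I r) ≤ θ ∧ ∀ r, Y ℓ (I r) = Y ℓ' (I r)).card : ℝ) := by
        exact_mod_cast card_biUnion_le
    _ ≤ ∑ ℓ' ∈ range ℓ, θ * (n : ℝ) ^ k :=
        sum_le_sum fun ℓ' hℓ' =>
          en_card_small_forall_le φ hφ0 hθ (fun i => Y ℓ i = Y ℓ' i) (hP ℓ' (mem_range.1 hℓ'))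
    _ = ℓ * θ * (n : ℝ) ^ k := by rw [sum_const, card_range, nsmul_eq_mul]; ring

/-- Pointwise truncation loss: `u - θ/φ ≤ min u L` for `u = -log φ`, `L = -log θ`
(by `log x ≤ x - 1` at `x = θ/φ`).
[cite: HuangSellke2025, §3.3.2, proof of Lemma 3.22 (moat / small-ball / entropy ladder of the resampling chain: energy auxiliaries of the DartGame)] -/
theorem en_min_ge {φ θ : ℝ} (hφ : 0 < φ) (hθ : 0 < θ) :
    -Real.log φ - θ * φ⁻¹ ≤ min (-Real.log φ) (-Real.log θ) := by
  refine le_min ?_ ?_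
  · have : 0 ≤ θ * φ⁻¹ := mul_nonneg hθ.le (inv_nonneg.2 hφ.le)
    linarith
  · have h := Real.log_le_sub_one_of_pos (div_pos hθ hφ)
    rw [Real.log_div hθ.ne' hφ.ne'] at h
    rw [← div_eq_mul_inv]
    linarith

/-- Outside the small ball the log-sum is short: `θ < ∏ φ(I r)` forces `∑_r -log φ(I r) < L`.
[cite: HuangSellke2025, §3.3.2, proof of Lemma 3.22 (moat / small-ball / entropy ladder of the resampling chain: energy auxiliaries of the DartGame)] -/
theorem en_sum_neglog_lt {k : ℕ} (φ : Fin n → ℝ) (hφ0 : ∀ i, 0 < φ i) {θ : ℝ} (hθ : 0 < θ)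
    (I : Fin k → Fin n) (h : ¬ ∏ r, φ (I r) ≤ θ) :
    ∑ r, -Real.log (φ (I r)) < -Real.log θ := by
  rw [Finset.sum_neg_distrib, ← Real.log_prod (fun r _ => (hφ0 (I r)).ne'), neg_lt_neg_iff]
  exact Real.log_lt_log hθ (not_le.1 h)

/-- The small-ball estimate: `#{I : ¬ ∏ φ(I r) ≤ θ} ≤ n^k · SB(p₀)`, `p₀ = (b - 2θ)/L`, from
`dartGameSmallBall` with uniform weights and scores `X = (p₀/p) · min(-log φ, L)/L`.
[cite: HuangSellke2025, §3.3.2, proof of Lemma 3.22 (moat / small-ball / entropy ladder of the resampling chain: energy auxiliaries of the DartGame)] -/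
theorem en_card_notSmall_le {k : ℕ} (φ : Fin n → ℝ) (hφ0 : ∀ i, 0 < φ i) (hφ1 : ∀ i, φ i ≤ 1)
    {θ b : ℝ} (hθ : 0 < θ) (hθ1 : θ < 1) (hb : 2 * θ ≤ b) (hn : 1 ≤ n)
    (H1 : n * b ≤ ∑ i, -Real.log (φ i)) (H2 : ∑ i, (φ i)⁻¹ ≤ 2 * n) :
    ((univ.filter fun I : Fin k → Fin n => ¬ ∏ r, φ (I r) ≤ θ).card : ℝ) ≤
      (n : ℝ) ^ k * (2 * (1 - (b - 2 * θ) / (-Real.log θ)) ^ k +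
        k * ((b - 2 * θ) / (-Real.log θ)) * (1 - (b - 2 * θ) / (-Real.log θ)) ^ (k - 1)) := by
  have hL : 0 < -Real.log θ := neg_pos.2 (Real.log_neg hθ hθ1)
  set L : ℝ := -Real.log θ with hLdef
  set p₀ : ℝ := (b - 2 * θ) / L with hp₀
  have hnr : (0 : ℝ) < n := by exact_mod_cast hn
  have hp₀0 : 0 ≤ p₀ := div_nonneg (by linarith) hL.le
  -- truncated scores `x i = min (u i) L / L ∈ [0, 1]` and their mean `p`
  set x : Fin n → ℝ := fun i => min (-Real.log (φ i)) L / L with hx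
  have hx0 : ∀ i, 0 ≤ x i := fun i =>
    div_nonneg (le_min (neg_nonneg.2 (Real.log_nonpos (hφ0 i).le (hφ1 i))) hL.le) hL.le
  have hx1 : ∀ i, x i ≤ 1 := fun i => (div_le_one hL).2 (min_le_right _ _)
  set p : ℝ := ∑ i, (n : ℝ)⁻¹ * x i with hp
  have hp0 : 0 ≤ p := Finset.sum_nonneg fun i _ => mul_nonneg (inv_nonneg.2 hnr.le) (hx0 i)
  -- the mean bound `p₀ ≤ p`
  have hsum : n * b - 2 * θ * n ≤ ∑ i, min (-Real.log (φ i)) L := by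
    calc n * b - 2 * θ * n ≤ ∑ i, -Real.log (φ i) - θ * ∑ i, (φ i)⁻¹ := by nlinarith
      _ = ∑ i, (-Real.log (φ i) - θ * (φ i)⁻¹) := by
          rw [Finset.sum_sub_distrib, Finset.mul_sum]
      _ ≤ ∑ i, min (-Real.log (φ i)) L := Finset.sum_le_sum fun i _ => en_min_ge (hφ0 i) hθ
  have hpL : p * (L * n) = ∑ i, min (-Real.log (φ i)) L := by
    rw [hp, Finset.sum_mul]
    refine Finset.sum_congr rfl fun i _ => ?_
    simp only [hx]
    field_simp
  have hp₀p : p₀ ≤ p := by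
    rw [hp₀, div_le_iff₀ hL]
    have h1 : (n * b - 2 * θ * n) ≤ p * (L * n) := by rw [hpL]; exact hsum
    have h2 : (b - 2 * θ) * n ≤ (p * L) * n := by linarith
    exact le_of_mul_le_mul_right h2 hnr
  -- scaled scores `X i = c * x i ∈ [0,1]`, `c = p₀ / p`, with mean exactly `p₀`
  set c : ℝ := p₀ / p with hc
  have hc0 : 0 ≤ c := div_nonneg hp₀0 hp0
  have hc1 : c ≤ 1 := div_le_one_of_le₀ hp₀p hp0
  have hX : ∀ i, c * x i ∈ Set.Icc (0 : ℝ) 1 := fun i =>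
    ⟨mul_nonneg hc0 (hx0 i), by nlinarith [hx0 i, hx1 i]⟩
  have hmean : ∑ i, (n : ℝ)⁻¹ * (c * x i) = p₀ := by
    have : ∑ i, (n : ℝ)⁻¹ * (c * x i) = c * p := by
      rw [hp, Finset.mul_sum]
      exact Finset.sum_congr rfl fun i _ => by ring
    rw [this, hc]
    rcases eq_or_lt_of_le hp0 with h0 | hpos
    · have hz : p₀ = 0 := le_antisymm (h0 ▸ hp₀p) hp₀0
      rw [hz]; simp
    · exact div_mul_cancel₀ p₀ hpos.ne'
  have hw : ∀ _i : Fin n, 0 ≤ (n : ℝ)⁻¹ := fun _ => inv_nonneg.2 hnr.le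
  have hw1 : ∑ _i : Fin n, (n : ℝ)⁻¹ = 1 := by
    rw [Finset.sum_const, Finset.card_univ, Fintype.card_fin, nsmul_eq_mul,
      mul_inv_cancel₀ hnr.ne']
  -- the small-ball lemma
  have hSB := dartGameSmallBall k n (fun _ => (n : ℝ)⁻¹) (fun i => c * x i) hw hw1 hX
  rw [hmean] at hSB
  -- its left side is `#{I : ∑ X < 1} · n⁻ᵏ`
  have hlhs : ∑ ω ∈ (univ : Finset (Fin k → Fin n)).filter (fun ω => ∑ r, c * x (ω r) < 1),
      ∏ _r : Fin k, (n : ℝ)⁻¹ =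
      ((univ.filter fun ω : Fin k → Fin n => ∑ r, c * x (ω r) < 1).card : ℝ) *
        ((n : ℝ)⁻¹) ^ k := by
    rw [Finset.sum_const, nsmul_eq_mul, Finset.prod_const, Finset.card_univ, Fintype.card_fin]
  -- containment `{¬ small} ⊆ {∑ X < 1}`
  have hsub : (univ.filter fun I : Fin k → Fin n => ¬ ∏ r, φ (I r) ≤ θ) ⊆
      univ.filter fun ω : Fin k → Fin n => ∑ r, c * x (ω r) < 1 := by
    intro I hI
    simp only [mem_filter, mem_univ, true_and] at hI ⊢
    have hlt := en_sum_neglog_lt φ hφ0 hθ I hI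
    calc ∑ r, c * x (I r) ≤ ∑ r, x (I r) :=
          Finset.sum_le_sum fun r _ => by nlinarith [hx0 (I r), hc0, hc1]
      _ ≤ ∑ r, -Real.log (φ (I r)) / L :=
          Finset.sum_le_sum fun r _ => div_le_div_of_nonneg_right (min_le_left _ _) hL.le
      _ = (∑ r, -Real.log (φ (I r))) / L := by rw [Finset.sum_div]
      _ < 1 := (div_lt_one hL).2 hlt
  -- conclude
  have hnk : (0 : ℝ) < (n : ℝ) ^ k := pow_pos hnr k
  calc ((univ.filter fun I : Fin k → Fin n => ¬ ∏ r, φ (I r) ≤ θ).card : ℝ)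
      ≤ ((univ.filter fun ω : Fin k → Fin n => ∑ r, c * x (ω r) < 1).card : ℝ) := by
        exact_mod_cast card_le_card hsub
    _ = (∑ ω ∈ (univ : Finset (Fin k → Fin n)).filter (fun ω => ∑ r, c * x (ω r) < 1),
          ∏ _r : Fin k, (n : ℝ)⁻¹) * (n : ℝ) ^ k := by
        rw [hlhs, mul_assoc, ← mul_pow, inv_mul_cancel₀ hnr.ne', one_pow, mul_one]
    _ ≤ (2 * (1 - p₀) ^ k + k * p₀ * (1 - p₀) ^ (k - 1)) * (n : ℝ) ^ k :=
        mul_le_mul_of_nonneg_right hSB hnk.le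
    _ = (n : ℝ) ^ k * (2 * (1 - p₀) ^ k + k * p₀ * (1 - p₀) ^ (k - 1)) := mul_comm _ _

/-- **Abstract per-rung bound**: `#{I new at rung ℓ} ≥ n^k (1 - SB(p₀) - ℓ θ)`.
[cite: HuangSellke2025, §3.3.2, proof of Lemma 3.22 (moat / small-ball / entropy ladder of the resampling chain: energy auxiliaries of the DartGame)] -/
theorem en_rung_abstract {k : ℕ} (ℓ : ℕ) (Y : ℕ → Fin n → Bool) (φ : Fin n → ℝ)
    (hφ0 : ∀ i, 0 < φ i) (hφ1 : ∀ i, φ i ≤ 1) {θ b : ℝ} (hθ : 0 < θ) (hθ1 : θ < 1)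
    (hb : 2 * θ ≤ b) (hn : 1 ≤ n) (H1 : n * b ≤ ∑ i, -Real.log (φ i))
    (H2 : ∑ i, (φ i)⁻¹ ≤ 2 * n)
    (H3 : ∀ ℓ' < ℓ, ∑ i ∈ univ.filter (fun i => Y ℓ i = Y ℓ' i), (φ i)⁻¹ ≤ n) :
    (n : ℝ) ^ k * (1 - (2 * (1 - (b - 2 * θ) / (-Real.log θ)) ^ k +
        k * ((b - 2 * θ) / (-Real.log θ)) * (1 - (b - 2 * θ) / (-Real.log θ)) ^ (k - 1)) -
          ℓ * θ) ≤
      ((univ.filter fun I : Fin k → Fin n =>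
        ∀ ℓ' < ℓ, ¬ ∀ r, Y ℓ (I r) = Y ℓ' (I r)).card : ℝ) := by
  have hA := en_card_notSmall_le (k := k) φ hφ0 hφ1 hθ hθ1 hb hn H1 H2
  have hB := en_card_small_notNew_le (k := k) Y ℓ φ hφ0 hθ H3
  have h1 := card_filter_add_card_filter_not (s := (univ : Finset (Fin k → Fin n)))
    (fun I => ∏ r, φ (I r) ≤ θ)
  have h2 := card_filter_add_card_filter_not
    (s := univ.filter fun I : Fin k → Fin n => ∏ r, φ (I r) ≤ θ)
    (fun I => ∀ ℓ' < ℓ, ¬ ∀ r, Y ℓ (I r) = Y ℓ' (I r))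
  rw [filter_filter, filter_filter] at h2
  have h3 : (univ.filter fun I : Fin k → Fin n =>
      ∏ r, φ (I r) ≤ θ ∧ ∀ ℓ' < ℓ, ¬ ∀ r, Y ℓ (I r) = Y ℓ' (I r)).card ≤
      (univ.filter fun I : Fin k → Fin n => ∀ ℓ' < ℓ, ¬ ∀ r, Y ℓ (I r) = Y ℓ' (I r)).card := by
    refine card_le_card fun I hI => ?_
    simp only [mem_filter, mem_univ, true_and] at hI ⊢
    exact hI.2
  have hU : (univ : Finset (Fin k → Fin n)).card = n ^ k := by
    rw [Finset.card_univ, Fintype.card_fun, Fintype.card_fin, Fintype.card_fin]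
  rw [hU] at h1
  have h1' : (((univ.filter fun I : Fin k → Fin n => ∏ r, φ (I r) ≤ θ).card : ℕ) : ℝ) +
      ((univ.filter fun I : Fin k → Fin n => ¬ ∏ r, φ (I r) ≤ θ).card : ℝ) = (n : ℝ) ^ k := by
    exact_mod_cast h1
  have h2' : ((univ.filter fun I : Fin k → Fin n =>
        ∏ r, φ (I r) ≤ θ ∧ ∀ ℓ' < ℓ, ¬ ∀ r, Y ℓ (I r) = Y ℓ' (I r)).card : ℝ) +
      ((univ.filter fun I : Fin k → Fin n =>
        ∏ r, φ (I r) ≤ θ ∧ ¬ ∀ ℓ' < ℓ, ¬ ∀ r, Y ℓ (I r) = Y ℓ' (I r)).card : ℝ) =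
      ((univ.filter fun I : Fin k → Fin n => ∏ r, φ (I r) ≤ θ).card : ℝ) := by
    exact_mod_cast h2
  have h3' : ((univ.filter fun I : Fin k → Fin n =>
      ∏ r, φ (I r) ≤ θ ∧ ∀ ℓ' < ℓ, ¬ ∀ r, Y ℓ (I r) = Y ℓ' (I r)).card : ℝ) ≤
      ((univ.filter fun I : Fin k → Fin n => ∀ ℓ' < ℓ, ¬ ∀ r, Y ℓ (I r) = Y ℓ' (I r)).card : ℝ) := by
    exact_mod_cast h3
  nlinarith [hA, hB, h1', h2', h3']

end Aux

end Literature.Computability.Complexity.HuangSellke2025Chain.DartGame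

end Part2

/-!
## Part 3 — port of `Summits/PneNP/PneNP/Theorems/OverlapGapAlgebraNoStableSectionEnergyFA.lean` (8 declarations kept)

# Route OverlapGapAlgebra, crux `NoStableSection` (stmt-PneNP-2462), line `DartGame`:
# stub `stub_energyBound`, FIRST APPEARANCE and the position sums

Helper file for `stub_energyBound` (`OverlapGapAlgebraNoStableSectionEnergy`), in the vocabulary of
`OverlapGapAlgebraNoStableSectionDefs`.  For a position `i` and a rung `ℓ` write
`N i = patCount Y ℓ (column of i over rungs < ℓ)` and `M i = patCount Y (ℓ+1) (column over rungs ≤ ℓ)`,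
so `1 ≤ M i ≤ N i`.  Grouping positions by their column:
`∑_i -log (M i / N i) = n · condEnt Y ℓ` (`en_sum_neglog_ratio`, via `∑_i log N i = n log n - n H_ℓ`),
`∑_i N i / M i ≤ 2n` (`en_sum_inv_ratio_le`), `∑_{Y ℓ i = Y ℓ' i} N i / M i ≤ n` for `ℓ' < ℓ`
(`en_sum_inv_ratio_filter_le`).  FIRST APPEARANCE (`stub_energyFirstAppearance`, the registered
helper stub): `n^k + ∑_{ℓ=1}^k #{I : rung ℓ of I is new} ≤ energySum Y k`, since the new rungs of a
tuple `I` carry pairwise distinct patterns.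
-/

section Part3

namespace Literature.Computability.Complexity.HuangSellke2025Chain.DartGame
open _root_.Finset _root_.Real

variable {n : ℕ}

/-- A position lies in its own pattern class: `1 ≤ patCount Y ℓ (column of i)`.
[cite: HuangSellke2025, §3.3.2, proof of Lemma 3.22 (moat / small-ball / entropy ladder of the resampling chain: first-appearance energy)] -/
theorem en_patCount_self_pos (Y : ℕ → Fin n → Bool) (ℓ : ℕ) (i : Fin n) :
    0 < patCount Y ℓ (fun j : Fin ℓ => Y j i) := by
  unfold patCount
  exact Finset.card_pos.2 ⟨i, by simp⟩

/-- Refining the column by one more rung shrinks the class: `M i ≤ N i`.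
[cite: HuangSellke2025, §3.3.2, proof of Lemma 3.22 (moat / small-ball / entropy ladder of the resampling chain: first-appearance energy)] -/
theorem en_patCount_succ_le_self (Y : ℕ → Fin n → Bool) (ℓ : ℕ) (i : Fin n) :
    patCount Y (ℓ + 1) (fun j : Fin (ℓ + 1) => Y j i) ≤ patCount Y ℓ (fun j : Fin ℓ => Y j i) := by
  unfold patCount
  refine Finset.card_le_card fun i' hi' => ?_
  simp only [Finset.mem_filter, Finset.mem_univ, true_and] at hi' ⊢
  funext j
  simpa using congrFun hi' j.castSucc

/-- `∑_i log N_ℓ(column of i) = ∑_ξ N_ℓ(ξ) log N_ℓ(ξ) = n log n - n · H_ℓ(Y)`.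
[cite: HuangSellke2025, §3.3.2, proof of Lemma 3.22 (moat / small-ball / entropy ladder of the resampling chain: first-appearance energy)] -/
theorem en_sum_log_patCount (Y : ℕ → Fin n → Bool) (ℓ : ℕ) (hn : 1 ≤ n) :
    ∑ i, Real.log (patCount Y ℓ (fun j : Fin ℓ => Y j i) : ℝ) =
      n * Real.log n - n * typeEnt Y ℓ := by
  have hnr : (n : ℝ) ≠ 0 := by exact_mod_cast (by omega : n ≠ 0)
  rw [← Finset.sum_fiberwise' (univ : Finset (Fin n)) (fun i => fun j : Fin ℓ => Y j i)
    (fun ξ => Real.log (patCount Y ℓ ξ : ℝ))]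
  simp only [Finset.sum_const, nsmul_eq_mul]
  change ∑ ξ : Fin ℓ → Bool, (patCount Y ℓ ξ : ℝ) * Real.log (patCount Y ℓ ξ) = _
  have hN : ∑ ξ : Fin ℓ → Bool, (patCount Y ℓ ξ : ℝ) = n := by exact_mod_cast sum_patCount Y ℓ
  unfold typeEnt
  calc ∑ ξ : Fin ℓ → Bool, (patCount Y ℓ ξ : ℝ) * Real.log (patCount Y ℓ ξ)
      = ∑ ξ : Fin ℓ → Bool, ((patCount Y ℓ ξ : ℝ) * Real.log n -
          n * negMulLog ((patCount Y ℓ ξ : ℝ) / n)) := by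
        refine Finset.sum_congr rfl fun ξ _ => ?_
        rcases Nat.eq_zero_or_pos (patCount Y ℓ ξ) with h0 | hpos
        · simp [h0, negMulLog]
        · have hN0 : (patCount Y ℓ ξ : ℝ) ≠ 0 := by exact_mod_cast hpos.ne'
          have hc : (n : ℝ) * ((patCount Y ℓ ξ : ℝ) / n) = patCount Y ℓ ξ := mul_div_cancel₀ _ hnr
          rw [negMulLog, Real.log_div hN0 hnr]
          linear_combination (-(Real.log (patCount Y ℓ ξ : ℝ) - Real.log n)) * hc
    _ = n * Real.log n - n * ∑ ξ : Fin ℓ → Bool, negMulLog ((patCount Y ℓ ξ : ℝ) / n) := by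
        rw [Finset.sum_sub_distrib, ← Finset.sum_mul, hN, ← Finset.mul_sum]

/-- `∑_i -log (M i / N i) = n · condEnt Y ℓ` (the conditional type entropy as an average
log-likelihood ratio over positions).
[cite: HuangSellke2025, §3.3.2, proof of Lemma 3.22 (moat / small-ball / entropy ladder of the resampling chain: first-appearance energy)] -/
theorem en_sum_neglog_ratio (Y : ℕ → Fin n → Bool) (ℓ : ℕ) (hn : 1 ≤ n) :
    ∑ i, -Real.log ((patCount Y (ℓ + 1) (fun j : Fin (ℓ + 1) => Y j i) : ℝ) /
        patCount Y ℓ (fun j : Fin ℓ => Y j i)) = n * condEnt Y ℓ := by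
  have h1 := en_sum_log_patCount Y ℓ hn
  have h2 := en_sum_log_patCount Y (ℓ + 1) hn
  unfold condEnt
  calc ∑ i, -Real.log ((patCount Y (ℓ + 1) (fun j : Fin (ℓ + 1) => Y j i) : ℝ) /
          patCount Y ℓ (fun j : Fin ℓ => Y j i))
      = ∑ i, (Real.log (patCount Y ℓ (fun j : Fin ℓ => Y j i) : ℝ) -
          Real.log (patCount Y (ℓ + 1) (fun j : Fin (ℓ + 1) => Y j i) : ℝ)) := by
        refine Finset.sum_congr rfl fun i _ => ?_
        rw [Real.log_div (by exact_mod_cast (en_patCount_self_pos Y (ℓ + 1) i).ne')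
          (by exact_mod_cast (en_patCount_self_pos Y ℓ i).ne')]
        ring
    _ = (n * Real.log n - n * typeEnt Y ℓ) - (n * Real.log n - n * typeEnt Y (ℓ + 1)) := by
        rw [Finset.sum_sub_distrib, h1, h2]
    _ = n * (typeEnt Y (ℓ + 1) - typeEnt Y ℓ) := by ring

/-- Averaging a nonnegative class function with weights `1 / (class size)` over positions gives at
most its plain sum over classes: `∑_i g(col i) / M(col i) ≤ ∑_ξ g ξ`.
[cite: HuangSellke2025, §3.3.2, proof of Lemma 3.22 (moat / small-ball / entropy ladder of the resampling chain: first-appearance energy)] -/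
theorem en_sum_div_patCount_le (Y : ℕ → Fin n → Bool) (m : ℕ) (g : (Fin m → Bool) → ℝ)
    (hg : ∀ ξ, 0 ≤ g ξ) :
    ∑ i, g (fun j : Fin m => Y j i) / (patCount Y m (fun j : Fin m => Y j i) : ℝ) ≤ ∑ ξ, g ξ := by
  rw [← Finset.sum_fiberwise' (univ : Finset (Fin n)) (fun i => fun j : Fin m => Y j i)
    (fun ξ => g ξ / (patCount Y m ξ : ℝ))]
  refine Finset.sum_le_sum fun ξ _ => ?_
  rw [Finset.sum_const, nsmul_eq_mul]
  change (patCount Y m ξ : ℝ) * (g ξ / patCount Y m ξ) ≤ g ξ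
  rcases Nat.eq_zero_or_pos (patCount Y m ξ) with h0 | hpos
  · simp [h0, hg ξ]
  · rw [mul_div_cancel₀ _ (by exact_mod_cast hpos.ne' : (patCount Y m ξ : ℝ) ≠ 0)]

/-- `∑_i N i / M i ≤ 2n`.
[cite: HuangSellke2025, §3.3.2, proof of Lemma 3.22 (moat / small-ball / entropy ladder of the resampling chain: first-appearance energy)] -/
theorem en_sum_inv_ratio_le (Y : ℕ → Fin n → Bool) (ℓ : ℕ) :
    ∑ i, ((patCount Y (ℓ + 1) (fun j : Fin (ℓ + 1) => Y j i) : ℝ) /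
        patCount Y ℓ (fun j : Fin ℓ => Y j i))⁻¹ ≤ 2 * n := by
  have key := en_sum_div_patCount_le Y (ℓ + 1) (fun ξ' => (patCount Y ℓ (Fin.init ξ') : ℝ))
    (fun ξ' => Nat.cast_nonneg _)
  have hN : ∑ ξ : Fin ℓ → Bool, (patCount Y ℓ ξ : ℝ) = n := by exact_mod_cast sum_patCount Y ℓ
  have hlhs : ∀ i : Fin n, ((patCount Y (ℓ + 1) (fun j : Fin (ℓ + 1) => Y j i) : ℝ) /
        patCount Y ℓ (fun j : Fin ℓ => Y j i))⁻¹ =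
      (patCount Y ℓ (Fin.init fun j : Fin (ℓ + 1) => Y j i) : ℝ) /
        patCount Y (ℓ + 1) (fun j : Fin (ℓ + 1) => Y j i) := fun i => by
    rw [inv_div]
    rfl
  have hrhs : ∑ ξ' : Fin (ℓ + 1) → Bool, (patCount Y ℓ (Fin.init ξ') : ℝ) = 2 * n := by
    rw [sum_pattern_succ ℓ fun ξ' => (patCount Y ℓ (Fin.init ξ') : ℝ)]
    simp only [Fin.init_snoc]
    rw [← hN, Finset.mul_sum]
    exact Finset.sum_congr rfl fun ξ _ => by ring
  rw [Finset.sum_congr rfl fun i _ => hlhs i, ← hrhs]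
  exact key

/-- `∑_{i : Y ℓ i = Y ℓ' i} N i / M i ≤ n` for an earlier rung `ℓ' < ℓ`.
[cite: HuangSellke2025, §3.3.2, proof of Lemma 3.22 (moat / small-ball / entropy ladder of the resampling chain: first-appearance energy)] -/
theorem en_sum_inv_ratio_filter_le (Y : ℕ → Fin n → Bool) (ℓ : ℕ) {ℓ' : ℕ} (hℓ' : ℓ' < ℓ) :
    ∑ i ∈ univ.filter (fun i => Y ℓ i = Y ℓ' i),
      ((patCount Y (ℓ + 1) (fun j : Fin (ℓ + 1) => Y j i) : ℝ) /
        patCount Y ℓ (fun j : Fin ℓ => Y j i))⁻¹ ≤ n := by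
  rw [Finset.sum_filter]
  have key := en_sum_div_patCount_le Y (ℓ + 1)
    (fun ξ' => if ξ' (Fin.last ℓ) = ξ' (Fin.castSucc ⟨ℓ', hℓ'⟩) then
      (patCount Y ℓ (Fin.init ξ') : ℝ) else 0)
    (fun ξ' => by
      split_ifs
      · exact Nat.cast_nonneg _
      · exact le_rfl)
  have hN : ∑ ξ : Fin ℓ → Bool, (patCount Y ℓ ξ : ℝ) = n := by exact_mod_cast sum_patCount Y ℓ
  calc ∑ i, (if Y ℓ i = Y ℓ' i then ((patCount Y (ℓ + 1) (fun j : Fin (ℓ + 1) => Y j i) : ℝ) /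
          patCount Y ℓ (fun j : Fin ℓ => Y j i))⁻¹ else 0)
      = ∑ i, (if (fun j : Fin (ℓ + 1) => Y j i) (Fin.last ℓ) =
            (fun j : Fin (ℓ + 1) => Y j i) (Fin.castSucc ⟨ℓ', hℓ'⟩) then
          (patCount Y ℓ (Fin.init fun j : Fin (ℓ + 1) => Y j i) : ℝ) else 0) /
          (patCount Y (ℓ + 1) (fun j : Fin (ℓ + 1) => Y j i) : ℝ) := by
        refine Finset.sum_congr rfl fun i _ => ?_
        by_cases h : Y ℓ i = Y ℓ' i
        · have h' : (fun j : Fin (ℓ + 1) => Y j i) (Fin.last ℓ) =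
              (fun j : Fin (ℓ + 1) => Y j i) (Fin.castSucc ⟨ℓ', hℓ'⟩) := by simpa using h
          rw [if_pos h, if_pos h', inv_div]
          rfl
        · have h' : ¬ (fun j : Fin (ℓ + 1) => Y j i) (Fin.last ℓ) =
              (fun j : Fin (ℓ + 1) => Y j i) (Fin.castSucc ⟨ℓ', hℓ'⟩) := by simpa using h
          rw [if_neg h, if_neg h', zero_div]
    _ ≤ ∑ ξ' : Fin (ℓ + 1) → Bool, (if ξ' (Fin.last ℓ) = ξ' (Fin.castSucc ⟨ℓ', hℓ'⟩) then
          (patCount Y ℓ (Fin.init ξ') : ℝ) else 0) := key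
    _ = ∑ ξ : Fin ℓ → Bool,
          ((if (Fin.snoc ξ true : Fin (ℓ + 1) → Bool) (Fin.last ℓ) =
              (Fin.snoc ξ true : Fin (ℓ + 1) → Bool) (Fin.castSucc ⟨ℓ', hℓ'⟩) then
            (patCount Y ℓ (Fin.init (Fin.snoc ξ true : Fin (ℓ + 1) → Bool)) : ℝ) else 0) +
          (if (Fin.snoc ξ false : Fin (ℓ + 1) → Bool) (Fin.last ℓ) =
              (Fin.snoc ξ false : Fin (ℓ + 1) → Bool) (Fin.castSucc ⟨ℓ', hℓ'⟩) then
            (patCount Y ℓ (Fin.init (Fin.snoc ξ false : Fin (ℓ + 1) → Bool)) : ℝ) else 0)) :=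
        sum_pattern_succ ℓ fun ξ' => if ξ' (Fin.last ℓ) = ξ' (Fin.castSucc ⟨ℓ', hℓ'⟩) then
          (patCount Y ℓ (Fin.init ξ') : ℝ) else 0
    _ = ∑ ξ : Fin ℓ → Bool, (patCount Y ℓ ξ : ℝ) := by
        refine Finset.sum_congr rfl fun ξ _ => ?_
        simp only [Fin.snoc_last, Fin.snoc_castSucc, Fin.init_snoc]
        cases ξ ⟨ℓ', hℓ'⟩ <;> simp
    _ = n := hN

/-- `∑_{j<k} (1 - A - (j+1) θ) = k (1 - A) - θ k(k+1)/2`.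
[cite: HuangSellke2025, §3.3.2, proof of Lemma 3.22 (moat / small-ball / entropy ladder of the resampling chain: first-appearance energy)] -/
theorem en_sum_fin_linear (k : ℕ) (A θ : ℝ) :
    ∑ j : Fin k, (1 - A - (((j : ℕ) + 1 : ℕ) : ℝ) * θ) =
      k * (1 - A) - θ * ((k : ℝ) * (k + 1) / 2) := by
  induction k with
  | zero => simp
  | succ k ih =>
    rw [Fin.sum_univ_castSucc]
    simp only [Fin.val_castSucc, Fin.val_last] at ih ⊢
    rw [ih]
    push_cast
    ring

end Literature.Computability.Complexity.HuangSellke2025Chain.DartGame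

end Part3

/-!
## Part 4 — port of `Summits/PneNP/PneNP/Theorems/OverlapGapAlgebraNoStableSectionEnergy.lean` (1 declarations kept)

# Route OverlapGapAlgebra, crux `NoStableSection` (stmt-PneNP-2462), line `DartGame`:
# stub `stub_energyBound` (the energy bound, BH Prop. 5.2 via first appearance + small ball)

`stub_energyBound` : for `k + 1` rungs `Y 0, …, Y k : Fin n → Bool` whose conditional type
entropies `condEnt Y ℓ`, `1 ≤ ℓ ≤ k`, are all `≥ b ≥ 2θ` (`0 < θ < 1`),
`energySum Y k / n^k ≥ 1 + k (1 - SB(p₀)) - θ k(k+1)/2` with `SB(p) = 2(1-p)^k + k p (1-p)^(k-1)`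
and `p₀ = (b - 2θ)/(-log θ)` (Bresler–Huang arXiv:2106.02129 Prop. 5.2, with Props 5.5–5.7 replaced
by first appearance + truncation at level `θ` + a Markov bound + the small-ball lemma
`dartGameSmallBall` of `OverlapGapAlgebraNoStableSectionSmallBall`).

The abstract per-rung bound `en_rung_abstract` (`#{I new at rung ℓ} ≥ n^k (1 - SB(p₀) - ℓ θ)` for
weights `φ : Fin n → (0,1]` with `∑ -log φ ≥ n b`, `∑ 1/φ ≤ 2n`, `∑_{Y ℓ i = Y ℓ' i} 1/φ ≤ n`) is in
`OverlapGapAlgebraNoStableSectionEnergyAux`; the position sums feeding it (with `φ i = M i / N i`, the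
conditional frequency of the bit `Y ℓ i` within the class of `i`) and FIRST APPEARANCE
(`n^k + ∑_{ℓ=1}^k #{I : rung ℓ of I is new} ≤ energySum Y k`) are in
`OverlapGapAlgebraNoStableSectionEnergyFA`.  Here: the per-rung instantiation `en_rung` and the sum
over `ℓ = 1, …, k`.
-/

section Part4

namespace Literature.Computability.Complexity.HuangSellke2025Chain.DartGame
open _root_.Finset _root_.Real

variable {n : ℕ}

/-- **Per-rung bound**: for `b ≤ condEnt Y ℓ`,
`#{I : the rung-ℓ pattern of I is new} ≥ n^k (1 - SB(p₀) - ℓ θ)`.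
[cite: HuangSellke2025, §3.3.2, proof of Lemma 3.22 (moat / small-ball / entropy ladder of the resampling chain: the energy bound)] -/
theorem en_rung {k : ℕ} (Y : ℕ → Fin n → Bool) (ℓ : ℕ) {θ b : ℝ} (hn : 1 ≤ n) (hθ : 0 < θ)
    (hθ1 : θ < 1) (hb : 2 * θ ≤ b) (hcond : b ≤ condEnt Y ℓ) :
    (n : ℝ) ^ k * (1 - (2 * (1 - (b - 2 * θ) / (-Real.log θ)) ^ k +
        k * ((b - 2 * θ) / (-Real.log θ)) * (1 - (b - 2 * θ) / (-Real.log θ)) ^ (k - 1)) -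
          ℓ * θ) ≤
      ((univ.filter fun I : Fin k → Fin n =>
        ∀ ℓ' < ℓ, ¬ ∀ r, Y ℓ (I r) = Y ℓ' (I r)).card : ℝ) := by
  have hnr : (0 : ℝ) < n := by exact_mod_cast hn
  refine en_rung_abstract ℓ Y
    (fun i => (patCount Y (ℓ + 1) (fun j : Fin (ℓ + 1) => Y j i) : ℝ) /
      patCount Y ℓ (fun j : Fin ℓ => Y j i)) ?_ ?_ hθ hθ1 hb hn ?_
    (en_sum_inv_ratio_le Y ℓ) (fun ℓ' hℓ' => en_sum_inv_ratio_filter_le Y ℓ hℓ')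
  · exact fun i => div_pos (by exact_mod_cast en_patCount_self_pos Y (ℓ + 1) i)
      (by exact_mod_cast en_patCount_self_pos Y ℓ i)
  · exact fun i => div_le_one_of_le₀ (by exact_mod_cast en_patCount_succ_le_self Y ℓ i)
      (Nat.cast_nonneg _)
  · calc (n : ℝ) * b ≤ n * condEnt Y ℓ := mul_le_mul_of_nonneg_left hcond hnr.le
      _ = _ := (en_sum_neglog_ratio Y ℓ hn).symm

end Literature.Computability.Complexity.HuangSellke2025Chain.DartGame

end Part4

/-!
## Part 5 — port of `Summits/PneNP/PneNP/Theorems/OverlapGapAlgebraNoStableSectionLadder.lean` (3 declarations kept)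

# Ladder extraction (abstract discrete intermediate-value argument)

Abstract form of Bresler–Huang (arXiv:2106.02129), Proposition 4.6: along a path `x : ℕ → V` of
length `k * W`, a prefix-local potential `h` that moves by at most `δ` per step, vanishes on a
repeated rung and exceeds `bp` one window `W` after all earlier rungs admits rung times
`ts 0 = 0 < ts 1 < ⋯ < ts k` with consecutive gaps `≤ W` such that every rung `ℓ ≥ 1` has
potential in `[bm, bp]` given its predecessors.
-/

section Part5

namespace Literature.Computability.Complexity.HuangSellke2025Chain.DartGame
/-! ## Ladder extraction -/

/-- Gap bounds `ts (i+1) ≤ ts i + W` for `i < ℓ` together with `ts 0 = 0` give `ts i ≤ i * W`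
for all `i ≤ ℓ`.
[cite: HuangSellke2025, §3.3.2, proof of Lemma 3.22 (moat / small-ball / entropy ladder of the resampling chain: the moat ladder)] -/
theorem ladder_le_mul {ts : ℕ → ℕ} {W ℓ : ℕ} (h0 : ts 0 = 0)
    (hgap : ∀ i < ℓ, ts i < ts (i + 1) ∧ ts (i + 1) ≤ ts i + W) :
    ∀ i ≤ ℓ, ts i ≤ i * W := by
  intro i hi
  induction i with
  | zero => simp [h0]
  | succ i ih =>
    have h1 := (hgap i (by omega)).2
    have h2 := ih (by omega)
    calc ts (i + 1) ≤ ts i + W := h1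
      _ ≤ i * W + W := by omega
      _ = (i + 1) * W := by ring

/-- Gap bounds `ts i < ts (i+1)` for `i < ℓ` give monotonicity `ts i ≤ ts m` for `i ≤ m ≤ ℓ`.
[cite: HuangSellke2025, §3.3.2, proof of Lemma 3.22 (moat / small-ball / entropy ladder of the resampling chain: the moat ladder)] -/
theorem ladder_mono {ts : ℕ → ℕ} {W ℓ : ℕ}
    (hgap : ∀ i < ℓ, ts i < ts (i + 1) ∧ ts (i + 1) ≤ ts i + W) :
    ∀ m ≤ ℓ, ∀ i ≤ m, ts i ≤ ts m := by
  intro m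
  induction m with
  | zero => intro _ i hi; rw [Nat.le_zero.mp hi]
  | succ m ih =>
    intro hm i hi
    rcases Nat.lt_or_ge i (m + 1) with h | h
    · exact (ih (by omega) i (by omega)).trans (hgap m (by omega)).1.le
    · rw [le_antisymm hi h]

/-- Discrete intermediate value: if `f a ≤ bm ≤ f (a + 1 + n)` and `f` increases by at most `δ`
per step on `[a, a + n]`, then some `s ∈ (a, a + 1 + n]` has `bm ≤ f s ≤ bm + δ` (take the first
`s > a` with `bm ≤ f s`).
[cite: HuangSellke2025, §3.3.2, proof of Lemma 3.22 (moat / small-ball / entropy ladder of the resampling chain: the moat ladder)] -/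
theorem ladder_ivt {f : ℕ → ℝ} {a n : ℕ} {δ bm : ℝ}
    (ha : f a ≤ bm) (hb : bm ≤ f (a + 1 + n))
    (hlip : ∀ t ≤ a + n, f (t + 1) ≤ f t + δ) :
    ∃ s, a < s ∧ s ≤ a + 1 + n ∧ bm ≤ f s ∧ f s ≤ bm + δ := by
  classical
  have hex : ∃ d, bm ≤ f (a + 1 + d) := ⟨n, hb⟩
  obtain ⟨d₀, hd₀spec, hd₀min, hd₀le⟩ : ∃ d₀, bm ≤ f (a + 1 + d₀) ∧
      (∀ d < d₀, f (a + 1 + d) < bm) ∧ d₀ ≤ n :=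
    ⟨Nat.find hex, Nat.find_spec hex, fun d hd => not_le.mp (Nat.find_min hex hd),
      Nat.find_min' hex hb⟩
  refine ⟨a + 1 + d₀, by omega, by omega, hd₀spec, ?_⟩
  have hprev : f (a + d₀) ≤ bm := by
    rcases d₀ with _ | d
    · simpa using ha
    · have h1 := hd₀min d (Nat.lt_succ_self d)
      have h2 : a + (d + 1) = a + 1 + d := by omega
      rw [h2]
      exact h1.le
  have hstep := hlip (a + d₀) (by omega)
  have h3 : a + 1 + d₀ = a + d₀ + 1 := by omega
  rw [h3]
  linarith

end Literature.Computability.Complexity.HuangSellke2025Chain.DartGame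

end Part5

/-!
## Part 6 — port of `Summits/PneNP/PneNP/Theorems/OverlapGapAlgebraSearchHardWindowLowDegreeStability.lean` (1 declarations kept)

# Route OverlapGapAlgebra, crux `SearchHardWindow` (stmt-PneNP-2460): low coordinate degree ⇒
# average stability of the sign map (the stability budget of a low-degree algorithm)

Two deterministic counting lemmas about vector-valued functions `F : instances → ℝⁿ` on the
literal arrays `Fin m → Fin k → Fin n × Bool` of random `k`-SAT, in the vocabulary of the named fact
`HuangSellke2025KSat` (`IsCoordDegreeLE`, coordinate / Efron–Stein degree in the `m·k` literal
slots):

* `wld_hammingDist_le_sum_sq` — two SATURATED sign patterns (`|x_v| ≥ 1`) differ in at most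
  `‖x − x'‖²` coordinates;
* `wld_jumpCount_le` — if every output coordinate of `F` has coordinate degree `≤ D`, the number of
  (instance, slot, fresh literal) triples on which the sign map `Φ ↦ sgn F(Φ)` moves by more than
  `η n` in Hamming distance is at most `2n·(mk·#{Φ unsaturated}) + (4D/η)·Σ_Φ ‖F Φ‖²` — by the
  Hoeffding-decomposition bound "total `L²`-influence ≤ degree × energy"
  (`Literature.Probability.Moments.sum_sum_sum_sq_sub_update_le`, O'Donnell 2014 §8.3–8.4).

This is the "low degree polynomials are stable" half of Bresler–Huang 2021 (arXiv:2106.02129 §6,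
Prop. 6.x) in average (Markov) form; combined with the smooth-maps rung
(`OverlapGapAlgebraSearchHardWindowSmoothMapsFail.lean`) it yields weak low-degree hardness modulo
`NoStableSection` (`OverlapGapAlgebraSearchHardWindowWeakLowDegree.lean`).

References: G. Bresler, B. Huang, FOCS 2021 / arXiv:2106.02129, §6 [BreslerHuang2022];
R. O'Donnell, *Analysis of Boolean Functions*, CUP 2014, §8.3–8.4 [ODonnell2014].
-/

section Part6

namespace Literature.Computability.Complexity.HuangSellke2025Chain

open _root_.Finset
open Literature.Computability.Complexity (IsCoordDegreeLE)
open Literature.Probability.Moments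
open scoped _root_.Classical

/-- Two SATURATED sign patterns differ in at most `‖x − x'‖²` coordinates: if every `|x v| ≥ 1`
then `d_H(sgn x, sgn x') ≤ Σ_v (x v − x' v)²` (a sign flip at a saturated coordinate costs at least
`1` in the difference). [cite: HuangSellke2025, §3.3.2, Lemma 3.22 (low-degree stability along the chain)] -/
theorem wld_hammingDist_le_sum_sq {n : ℕ} {x x' : Fin n → ℝ} (hx : ∀ v, 1 ≤ |x v|) :
    (hammingDist (fun v => decide (0 ≤ x v)) (fun v => decide (0 ≤ x' v)) : ℝ) ≤
      ∑ v, (x v - x' v) ^ 2 := by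
  rw [hammingDist]
  have hpt : ∀ v ∈ univ.filter (fun v : Fin n => decide (0 ≤ x v) ≠ decide (0 ≤ x' v)),
      (1 : ℝ) ≤ (x v - x' v) ^ 2 := by
    intro v hv
    rw [mem_filter] at hv
    have hne := hv.2
    have h1 := hx v
    have key : 1 ≤ |x v - x' v| := by
      by_cases h0 : 0 ≤ x v
      · have h0' : ¬ 0 ≤ x' v := fun h' => hne (by rw [decide_eq_true h0, decide_eq_true h'])
        rw [abs_of_nonneg h0] at h1
        rw [abs_of_nonneg (by linarith)]
        linarith
      · have h0' : 0 ≤ x' v := by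
          by_contra h'
          exact hne (by rw [decide_eq_false h0, decide_eq_false h'])
        rw [abs_of_neg (not_le.1 h0)] at h1
        rw [abs_of_nonpos (by linarith)]
        linarith
    nlinarith [abs_nonneg (x v - x' v), sq_abs (x v - x' v)]
  calc ((univ.filter fun v : Fin n => decide (0 ≤ x v) ≠ decide (0 ≤ x' v)).card : ℝ)
      = ∑ v ∈ univ.filter (fun v : Fin n => decide (0 ≤ x v) ≠ decide (0 ≤ x' v)), (1 : ℝ) := by
        simp
    _ ≤ ∑ v ∈ univ.filter (fun v : Fin n => decide (0 ≤ x v) ≠ decide (0 ≤ x' v)),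
          (x v - x' v) ^ 2 := sum_le_sum hpt
    _ ≤ ∑ v, (x v - x' v) ^ 2 :=
        sum_le_univ_sum_of_nonneg fun v => sq_nonneg _

end Literature.Computability.Complexity.HuangSellke2025Chain

end Part6

/-!
## Part 7 — port of `Summits/PneNP/PneNP/Theorems/OverlapGapAlgebraSearchHardWindowMoatTransfer.lean` (3 declarations kept)

# Route OverlapGapAlgebra, crux `SearchHardWindow` (stmt-PneNP-2460), line `Sketch`: moat transfer
# on a path of instances

Stub `stub_moatTransfer` of the skeleton
`Summits/PneNP/PneNP/Cruxes/SearchHardWindow/Lines/Sketch.lean` (section `HS25`): the deterministic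
plumbing between the moat / ladder extraction of Huang–Sellke 2025 (arXiv:2501.06427, Lemmas
3.24–3.25 = Bresler–Huang 2021, arXiv:2106.02129, Prop. 4.6 / Lemma 4.8; the landed `stub_moat`,
handed in as the hypothesis `hMoat`) and the two events of the named fact
`HuangSellke2025KSatObstructions` (HS25 Lemmas 3.22–3.23).

Along a path `z 0, z 1, …` of literal arrays, a deterministic algorithm outputs the sign vectors
`x t = (decide (0 ≤ F (curry (z t)) v))_v`. If, up to the horizon `T ≥ k W`, every output is
saturated (`|F v| ≥ 1`) and solves its instance (`hgood`), consecutive real outputs move by at most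
`θ n` in squared norm (`hclose`, with `h₂(θ) ≤ η`, `θ ≤ 1/2`), and no CHAOS structure with integer
gap `W` exists (`hnochaos`), then the OGP structure exists.

* `mtr_overlapCondEnt_eq_condEnt` — the bridge: Bresler–Huang's (unordered) conditional overlap
  entropy `overlapCondEnt Y ℓ` is the DartGame ordered conditional type entropy `condEnt` of the
  rung-`0`-normalised sequence `fun j i => Y j i ⊕ Y 0 i` (both are the same sums).
* stability (`mtr_stab`): `d_H(x t, x (t+1)) ≤ ‖F(z t) − F(z (t+1))‖² ≤ θ n ≤ n/2`
  (`wld_hammingDist_le_sum_sq`) and `h₂(d_H/n) ≤ h₂(θ) ≤ η` by monotonicity of `h₂` on `[0, 1/2]`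
  (`Real.binEntropy_strictMonoOn`).
* chaos-freeness (`mtr_chaos`): a candidate `x t` at a time `t ≥ ts j + W` for all earlier rung
  times is, with the time tuple `(ts 0, …, ts (ℓ-1), t)`, a CHAOS structure unless its conditional
  overlap entropy exceeds `β`.
* the ladder `ts` produced by `hMoat` is the OGP structure (`ladder_le_mul`, `ladder_mono`).
-/

section Part7

namespace Literature.Computability.Complexity.HuangSellke2025Chain

open _root_.Finset
open Literature.Computability.Complexity
open Literature.Computability.Complexity.HuangSellke2025Chain.DartGame (condEnt typeEnt patCount withRung
  withRung_of_lt withRung_of_le condEnt_congr ladder_le_mul ladder_mono)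
open scoped _root_.Classical

/-! ## The bridge: unordered conditional overlap entropy = ordered entropy of the normalised sequence -/

/-- **The bridge.** Bresler–Huang's (unordered) conditional overlap entropy `overlapCondEnt Y ℓ`
is the DartGame ordered conditional type entropy `condEnt` of the rung-`0`-normalised sequence
`fun j i => Y j i ⊕ Y 0 i`. [cite: HuangSellke2025, §3.3.2, Lemma 3.22 (transfer of the moat along the chain)] -/
theorem mtr_overlapCondEnt_eq_condEnt {n : ℕ} (Y : ℕ → Fin n → Bool) (ℓ : ℕ) :
    overlapCondEnt Y ℓ = condEnt (fun j i => Bool.xor (Y j i) (Y 0 i)) ℓ := rfl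

/-! ## Stability of the saturated sign map along the path -/

/-- One step of the path: if the output at time `t` is saturated and the real outputs move by at
most `θ n` in squared norm, `θ ≤ 1/2`, `h₂(θ) ≤ η`, then the sign vectors are at Hamming distance
`Δ ≤ n / 2` with `h₂(Δ/n) ≤ η`. [cite: HuangSellke2025, §3.3.2, Lemma 3.22 (transfer of the moat along the chain)] -/
theorem mtr_stab {n : ℕ} {θ η : ℝ} (hθ : θ ≤ 1 / 2) (hθη : Real.binEntropy θ ≤ η) (hn : 1 ≤ n)
    {y y' : Fin n → ℝ} (hsat : ∀ v, 1 ≤ |y v|) (hclose : ∑ v, (y v - y' v) ^ 2 ≤ θ * n) :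
    (hammingDist (fun v => decide (0 ≤ y v)) (fun v => decide (0 ≤ y' v)) : ℝ) ≤ n / 2 ∧
      Real.binEntropy
        ((hammingDist (fun v => decide (0 ≤ y v)) (fun v => decide (0 ≤ y' v)) : ℝ) / n) ≤ η := by
  have hnr : (0 : ℝ) < n := by exact_mod_cast hn
  have hΔ : (hammingDist (fun v => decide (0 ≤ y v)) (fun v => decide (0 ≤ y' v)) : ℝ) ≤ θ * n :=
    (wld_hammingDist_le_sum_sq hsat).trans hclose
  have hdiv : (hammingDist (fun v => decide (0 ≤ y v)) (fun v => decide (0 ≤ y' v)) : ℝ) / n ≤ θ :=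
    by rw [div_le_iff₀ hnr]; exact hΔ
  have hdiv0 :
      0 ≤ (hammingDist (fun v => decide (0 ≤ y v)) (fun v => decide (0 ≤ y' v)) : ℝ) / n := by
    positivity
  have hθ0 : 0 ≤ θ := hdiv0.trans hdiv
  refine ⟨?_, ?_⟩
  · calc (hammingDist (fun v => decide (0 ≤ y v)) (fun v => decide (0 ≤ y' v)) : ℝ)
        ≤ θ * n := hΔ
      _ ≤ 1 / 2 * n := mul_le_mul_of_nonneg_right hθ hnr.le
      _ = n / 2 := by ring
  · calc Real.binEntropy
          ((hammingDist (fun v => decide (0 ≤ y v)) (fun v => decide (0 ≤ y' v)) : ℝ) / n)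
        ≤ Real.binEntropy θ :=
          Real.binEntropy_strictMonoOn.monotoneOn ⟨hdiv0, hdiv.trans (by linarith)⟩
            ⟨hθ0, by linarith⟩ hdiv
      _ ≤ η := hθη

/-! ## The stub -/

/-- **Moat transfer on a path of instances** (stub `stub_moatTransfer` of line `Sketch`, section
`HS25`; Huang–Sellke 2025, arXiv:2501.06427 §3.3.2, the deterministic step of the proof of
Cor. 3.21): along a path `z` of literal arrays on which, up to time `T ≥ k W`, the saturated sign map
of `F` solves every instance (`hgood`) and consecutive real outputs move by `≤ θ n` in squared norm
(`hclose`, `h₂(θ) ≤ η`, `θ ≤ 1/2`), if no CHAOS structure with integer gap `W` exists (`hnochaos`: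
every satisfying candidate at a time `≥ W` after the previous rung has conditional overlap entropy
`> β` given the earlier outputs), then an OGP structure exists (times `t 0 ≤ ⋯ ≤ t k ≤ T`,
assignments solving the instances at those times, all conditional overlap entropies in
`[β − η, β]`) — via the moat `hMoat` (the landed `stub_moat`), `wld_hammingDist_le_sum_sq`, the
monotonicity of `h₂` on `[0, 1/2]`, and the bridge `mtr_overlapCondEnt_eq_condEnt`.
[cite: HuangSellke2025, §3.3.2, Lemma 3.22 (transfer of the moat along the chain)] -/
theorem stub_moatTransfer
    (hMoat : ∀ (n k W T : ℕ) (x : ℕ → (Fin n → Bool)) (β η : ℝ), 0 < W → 0 < η → η < β →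
      k * W ≤ T →
      (∀ t < T, (hammingDist (x t) (x (t + 1)) : ℝ) ≤ n / 2 ∧
        Real.binEntropy ((hammingDist (x t) (x (t + 1)) : ℝ) / n) ≤ η) →
      (∀ (ℓ : ℕ) (ts : ℕ → ℕ) (t : ℕ), 1 ≤ ℓ → ℓ ≤ k → ts 0 = 0 →
        (∀ j, j + 1 < ℓ → ts j < ts (j + 1)) → (∀ j < ℓ, ts j + W ≤ t) → t ≤ T →
        β < condEnt (fun j i => Bool.xor (withRung (fun j => x (ts j)) ℓ (x t) j i) (x (ts 0) i))
          ℓ) →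
      ∃ ts : ℕ → ℕ, ts 0 = 0 ∧ (∀ ℓ < k, ts ℓ < ts (ℓ + 1) ∧ ts (ℓ + 1) ≤ ts ℓ + W) ∧
        ∀ ℓ, 1 ≤ ℓ → ℓ ≤ k →
          condEnt (fun j i => Bool.xor (x (ts j) i) (x (ts 0) i)) ℓ ∈ Set.Icc (β - η) β)
    (n m k W T : ℕ) (β η θ : ℝ) (hW : 0 < W) (hη : 0 < η) (hηβ : η < β)
    (hT : k * W ≤ T) (hθ : θ ≤ 1 / 2) (hθη : Real.binEntropy θ ≤ η) (hn : 1 ≤ n)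
    (F : (Fin m → Fin k → Fin n × Bool) → Fin n → ℝ) (z : ℕ → (Fin m × Fin k → Fin n × Bool))
    (hgood : ∀ t ≤ T, (∀ v, 1 ≤ |F (Function.curry (z t)) v|) ∧
      ∀ i : Fin m, ∃ j : Fin k,
        decide (0 ≤ F (Function.curry (z t)) (z t (i, j)).1) = (z t (i, j)).2)
    (hclose : ∀ t < T,
      ∑ v, (F (Function.curry (z t)) v - F (Function.curry (z (t + 1))) v) ^ 2 ≤ θ * n)
    (hnochaos : ∀ (j : ℕ) (t : ℕ → ℕ) (x : Fin n → Bool), 1 ≤ j → j ≤ k →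
      (∀ ℓ < j, t ℓ ≤ t (ℓ + 1)) → t j ≤ T → t (j - 1) + W ≤ t j →
      (∀ i : Fin m, ∃ j' : Fin k, x (z (t j) (i, j')).1 = (z (t j) (i, j')).2) →
      β < overlapCondEnt
        (fun ℓ => if ℓ < j then (fun v => decide (0 ≤ F (Function.curry (z (t ℓ))) v)) else x) j) :
    ∃ (t : ℕ → ℕ) (x : ℕ → Fin n → Bool), (∀ ℓ < k, t ℓ ≤ t (ℓ + 1)) ∧ t k ≤ T ∧
      (∀ ℓ ≤ k, ∀ i : Fin m, ∃ j : Fin k, x ℓ (z (t ℓ) (i, j)).1 = (z (t ℓ) (i, j)).2) ∧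
      ∀ ℓ, 1 ≤ ℓ → ℓ ≤ k → overlapCondEnt x ℓ ∈ Set.Icc (β - η) β := by
  -- the chain of outputs of the saturated sign map along the path
  set x : ℕ → Fin n → Bool := fun t v => decide (0 ≤ F (Function.curry (z t)) v) with hxdef
  -- (1) stability: consecutive outputs are `h₂`-close before the horizon
  have hstab : ∀ t < T, (hammingDist (x t) (x (t + 1)) : ℝ) ≤ n / 2 ∧
      Real.binEntropy ((hammingDist (x t) (x (t + 1)) : ℝ) / n) ≤ η :=
    fun t ht => mtr_stab hθ hθη hn (hgood t ht.le).1 (hclose t ht)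
  -- (2) chaos-freeness for increasing rung times starting at `0`
  have hchaos : ∀ (ℓ : ℕ) (ts : ℕ → ℕ) (t : ℕ), 1 ≤ ℓ → ℓ ≤ k → ts 0 = 0 →
      (∀ j, j + 1 < ℓ → ts j < ts (j + 1)) → (∀ j < ℓ, ts j + W ≤ t) → t ≤ T →
      β < condEnt (fun j i => Bool.xor (withRung (fun j => x (ts j)) ℓ (x t) j i) (x (ts 0) i))
        ℓ := by
    intro ℓ ts t hℓ1 hℓk _hts0 hinc hwin htT
    -- the time tuple `(ts 0, …, ts (ℓ-1), t, t, …)` and the candidate `x t`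
    have key := hnochaos ℓ (fun i => if i < ℓ then ts i else t) (x t) hℓ1 hℓk
      (fun i hi => by
        by_cases hi1 : i + 1 < ℓ
        · rw [if_pos hi, if_pos hi1]; exact (hinc i hi1).le
        · rw [if_pos hi, if_neg hi1]; have := hwin i hi; omega)
      (by rw [if_neg (lt_irrefl ℓ)]; exact htT)
      (by rw [if_pos (Nat.sub_lt hℓ1 Nat.one_pos), if_neg (lt_irrefl ℓ)]; exact hwin _ (by omega))
      (by rw [if_neg (lt_irrefl ℓ)]; exact (hgood t htT).2)
    -- the sequence read by `hnochaos` is `withRung (x ∘ ts) ℓ (x t)`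
    have hY : (fun i => if i < ℓ then
        (fun v => decide (0 ≤ F (Function.curry (z (if i < ℓ then ts i else t))) v)) else x t) =
        withRung (fun j => x (ts j)) ℓ (x t) := by
      funext i
      by_cases hi : i < ℓ
      · rw [if_pos hi, if_pos hi, withRung_of_lt _ _ _ hi]
      · rw [if_neg hi, withRung_of_le _ _ _ (not_lt.mp hi)]
    rw [hY, mtr_overlapCondEnt_eq_condEnt, withRung_of_lt _ _ _ hℓ1] at key
    exact key
  -- (3) the moat produces the ladder
  obtain ⟨ts, h0, hgap, hband⟩ := hMoat n k W T x β η hW hη hηβ hT hstab hchaos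
  have hk : ts k ≤ T := (ladder_le_mul h0 hgap k le_rfl).trans hT
  refine ⟨ts, fun ℓ => x (ts ℓ), fun ℓ hℓ => (hgap ℓ hℓ).1.le, hk, fun ℓ hℓ => ?_, fun ℓ h1 h2 => ?_⟩
  · -- the output at time `ts ℓ ≤ ts k ≤ T` solves its instance
    exact (hgood (ts ℓ) ((ladder_mono hgap k le_rfl ℓ hℓ).trans hk)).2
  · -- the band, through the bridge
    rw [mtr_overlapCondEnt_eq_condEnt]
    exact hband ℓ h1 h2

end Literature.Computability.Complexity.HuangSellke2025Chain

end Part7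

/-!
## Part 8 — port of `Summits/PneNP/PneNP/Theorems/OverlapGapAlgebraSearchHardWindowBandEnergy.lean` (3 declarations kept)

# Route OverlapGapAlgebra, crux `SearchHardWindow` (stmt-PneNP-2460), line `Sketch`:
# stub `stub_bandEnergy` (the OGP band gives energy — Bresler–Huang Prop. 5.2 with `s` darts)

For a tuple `Y 0, …, Y k : Fin n → Bool` in the OGP band — every conditional overlap entropy
`overlapCondEnt (seqOf Y) ℓ`, `1 ≤ ℓ ≤ k`, is at least `b ≥ 2θ` (`0 < θ < 1`) — the first-appearance
sum with `s` darts,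
`FA_s(Y) = Σ_{ℓ ≤ k} #{I : Fin s → Fin n | the pattern r ↦ Y ℓ (I r) differs from r ↦ Y ℓ' (I r) for
every ℓ' < ℓ}`,
is at least `n^s (1 + k (1 − SB_s(p₀)) − θ k(k+1)/2)`, where `SB_s(p) = 2(1−p)^s + s p (1−p)^(s−1)`
and `p₀ = (b − 2θ)/(−log θ)` (Bresler–Huang, arXiv:2106.02129, Prop. 5.2, in DartGame form).

Proof.  The per-rung bound is the DartGame lemma `en_rung` (its implicit dart count taken to be `s`),
applied to the rung-`0`-normalised sequence `Y' j i = seqOf Y j i ⊕ seqOf Y 0 i`, whose ordered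
conditional type entropy `condEnt Y' ℓ` is `overlapCondEnt (seqOf Y) ℓ` by definition
(`mtr_overlapCondEnt_eq_condEnt`).  A dart tuple whose rung-`ℓ` pattern under `Y'` differs from all
earlier patterns under `Y'` also has this property under `Y` (normalising by the same rung-`0` bits
preserves pattern equality), so `en_rung`'s first-appearance set at rung `ℓ = j + 1` is contained in
the `ℓ`-th summand (`ben_subset`).  The rung-`0` summand is all of `(Fin s → Fin n)`, of size `n^s`
(`ben_card_zero`), and the per-rung bounds `n^s (1 − SB_s(p₀) − (j+1) θ)`, `j < k`, sum to
`n^s (k (1 − SB_s(p₀)) − θ k(k+1)/2)` (`en_sum_fin_linear`).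
-/

section Part8

namespace Literature.Computability.Complexity.HuangSellke2025Chain

open _root_.Finset
open Literature.Computability.Complexity
open Literature.Computability.Complexity.HuangSellke2025Chain.DartGame
open scoped _root_.Classical

/-- The rung-`0` summand of the first-appearance sum: every dart tuple is new at rung `0`, so the
summand is `#(Fin s → Fin n) = n^s`. [cite: HuangSellke2025, §3.3.2, Lemma 3.22 (band ⇒ first-appearance energy)] -/
theorem ben_card_zero (n k s : ℕ) (Y : Fin (k + 1) → Fin n → Bool) :
    ((univ.filter fun I : Fin s → Fin n =>
        ∀ ℓ' : Fin (k + 1), ℓ' < (0 : Fin (k + 1)) → ¬ ∀ r, Y 0 (I r) = Y ℓ' (I r)).card : ℝ) =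
      (n : ℝ) ^ s := by
  rw [Finset.filter_true_of_mem (fun I _ ℓ' h => absurd h (Fin.not_lt_zero ℓ')), card_univ,
    Fintype.card_fun, Fintype.card_fin, Fintype.card_fin]
  push_cast
  ring

/-- At rung `ℓ = j + 1` (`j < k`), `en_rung`'s first-appearance set for the rung-`0`-normalised
sequence `Y' m i = seqOf Y m i ⊕ seqOf Y 0 i` is contained in the `ℓ`-th summand of the
first-appearance sum of `Y`: if the rung-`ℓ` pattern of a dart tuple under `Y` agrees with its
rung-`ℓ'` pattern for some `ℓ' < ℓ`, the same holds under `Y'`.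
[cite: HuangSellke2025, §3.3.2, Lemma 3.22 (band ⇒ first-appearance energy)] -/
theorem ben_subset (n k s : ℕ) (Y : Fin (k + 1) → Fin n → Bool) (j : Fin k) :
    (univ.filter fun I : Fin s → Fin n => ∀ ℓ' < (j : ℕ) + 1,
        ¬ ∀ r, (fun (m : ℕ) (i : Fin n) => Bool.xor (seqOf Y m i) (seqOf Y 0 i)) ((j : ℕ) + 1)
            (I r) = (fun (m : ℕ) (i : Fin n) => Bool.xor (seqOf Y m i) (seqOf Y 0 i)) ℓ' (I r)) ⊆
      univ.filter fun I : Fin s → Fin n =>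
        ∀ ℓ' : Fin (k + 1), ℓ' < j.succ → ¬ ∀ r, Y j.succ (I r) = Y ℓ' (I r) := by
  intro I hI
  simp only [Finset.mem_filter, Finset.mem_univ, true_and] at hI ⊢
  intro ℓ' hℓ' hall
  have hlt : (ℓ' : ℕ) < (j : ℕ) + 1 := by
    have h := Fin.lt_def.mp hℓ'
    simpa using h
  have h1 : seqOf Y ((j : ℕ) + 1) = Y j.succ := by
    have h := seqOf_apply_fin Y j.succ
    simpa using h
  refine hI ℓ' hlt fun r => ?_
  rw [h1, seqOf_apply_fin Y ℓ', hall r]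

/-- **Stub E — the OGP band gives energy** (registered as `stub_bandEnergy` in line `Sketch` of crux
`SearchHardWindow`): for a tuple `Y 0, …, Y k` whose conditional overlap entropies at rungs
`1, …, k` are all `≥ b ≥ 2θ` (`0 < θ < 1`), the first-appearance sum with `s` darts is at least
`n^s (1 + k (1 − SB_s(p₀)) − θ k(k+1)/2)`, `SB_s(p) = 2(1−p)^s + s p (1−p)^(s−1)`,
`p₀ = (b − 2θ)/(−log θ)` — Bresler–Huang Prop. 5.2 via the DartGame per-rung bound `en_rung` for
the rung-`0`-normalised sequence, summed over the rungs (`en_sum_fin_linear`).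
[cite: HuangSellke2025, §3.3.2, Lemma 3.22 (band ⇒ first-appearance energy)] -/
theorem stub_bandEnergy (n k s : ℕ) (hn : 1 ≤ n) (Y : Fin (k + 1) → Fin n → Bool) (θ b : ℝ)
    (hθ : 0 < θ) (hθ1 : θ < 1) (hb : 2 * θ ≤ b)
    (hband : ∀ ℓ : ℕ, 1 ≤ ℓ → ℓ ≤ k → b ≤ overlapCondEnt (seqOf Y) ℓ) :
    (n : ℝ) ^ s * ((1 : ℝ) + k * (1 - (2 * (1 - (b - 2 * θ) / (-Real.log θ)) ^ s + s * ((b - 2 * θ) / (-Real.log θ)) * (1 - (b - 2 * θ) / (-Real.log θ)) ^ (s - 1))) - θ * ((k : ℝ) * (k + 1) / 2)) ≤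
      (∑ ℓ : Fin (k + 1), ((univ.filter fun I : Fin s → Fin n =>
              ∀ ℓ' : Fin (k + 1), ℓ' < ℓ → ¬ ∀ r, Y ℓ (I r) = Y ℓ' (I r)).card : ℝ)) := by
  -- the band, read as ordered conditional type entropies of the normalised sequence
  have hcond : ∀ ℓ : ℕ, 1 ≤ ℓ → ℓ ≤ k →
      b ≤ condEnt (fun (m : ℕ) (i : Fin n) => Bool.xor (seqOf Y m i) (seqOf Y 0 i)) ℓ := by
    intro ℓ h1 h2
    rw [← mtr_overlapCondEnt_eq_condEnt]
    exact hband ℓ h1 h2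
  set A : ℝ := 2 * (1 - (b - 2 * θ) / (-Real.log θ)) ^ s +
    s * ((b - 2 * θ) / (-Real.log θ)) * (1 - (b - 2 * θ) / (-Real.log θ)) ^ (s - 1) with hA
  -- the per-rung bounds at `ℓ = j + 1`, `j < k`, summed
  have hsum : ∑ j : Fin k, (n : ℝ) ^ s * (1 - A - (((j : ℕ) + 1 : ℕ) : ℝ) * θ) ≤
      ∑ j : Fin k, ((univ.filter fun I : Fin s → Fin n =>
        ∀ ℓ' : Fin (k + 1), ℓ' < j.succ → ¬ ∀ r, Y j.succ (I r) = Y ℓ' (I r)).card : ℝ) := by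
    refine Finset.sum_le_sum fun j _ => ?_
    refine (en_rung (k := s) (fun (m : ℕ) (i : Fin n) => Bool.xor (seqOf Y m i) (seqOf Y 0 i))
      ((j : ℕ) + 1) hn hθ hθ1 hb (hcond _ (by omega) (by omega))).trans ?_
    exact_mod_cast Finset.card_le_card (ben_subset n k s Y j)
  rw [← Finset.mul_sum, en_sum_fin_linear] at hsum
  -- the rung-`0` summand
  have h0 := ben_card_zero n k s Y
  rw [Fin.sum_univ_succ]
  calc (n : ℝ) ^ s * (1 + k * (1 - A) - θ * ((k : ℝ) * (k + 1) / 2))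
      = (n : ℝ) ^ s + (n : ℝ) ^ s * (k * (1 - A) - θ * ((k : ℝ) * (k + 1) / 2)) := by ring
    _ ≤ _ := by linarith

end Literature.Computability.Complexity.HuangSellke2025Chain

end Part8

/-!
## Part 9 — port of `Summits/PneNP/PneNP/Theorems/OverlapGapAlgebraNoStableSectionCount.lean` (8 declarations kept)

# Route OverlapGapAlgebra, crux `NoStableSection` (stmt-PneNP-2462), line `DartGame`: stub C

**Counting by conditional type entropy** (method of types, Cover–Thomas Thm. 11.1.3, as used by
Bresler–Huang, arXiv:2106.02129, §4.6 and Lemma 5.1, with the `o(n)` terms replaced by exact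
inequalities):

1. `card_filter_condEnt_le`: for a fixed prefix `R` of `ℓ` rungs, the candidates `v` of conditional
   type entropy `condEnt (withRung R ℓ v) ℓ ≤ b` number at most `(n+1)^(2^ℓ) · exp(n b)`: classify
   `v` by its refined count vector `c_v ξ = #{i ∈ class ξ | v i = true}`; a fibre has at most
   `Π_ξ C(N_ξ, c_ξ) ≤ exp(Σ_ξ N_ξ h₂(c_ξ/N_ξ)) = exp(n · condEnt)` elements
   (`C(N, j) ≤ exp(N h₂(j/N))`, from `Literature.Probability.LatticeModels.choose_le_exp_spinRate`),
   and there are at most `(n+1)^(2^ℓ)` count vectors.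
2. `card_filter_tuple_condEnt_le`: iterating rung by rung, the tuples `(y⁰, …, y^L)` all of whose
   rungs `ℓ ≥ 1` have conditional type entropy `≤ b` number at most `2^n ((n+1)^(2^L) e^{nb})^L`.

The conjunction `stub_condEntCount` is the body of the skeleton's `CondEntCount`; the vocabulary
(`patCount`, `condEnt`, `withRung`, `seqOf`, …) is that of
`Summits.PneNP.PneNP.Theorems.OverlapGapAlgebraNoStableSectionDefs`.
-/

section Part9

namespace Literature.Computability.Complexity.HuangSellke2025Chain.DartGame

/-! ## Stub C: counting by conditional type entropy -/

section Count

open _root_.Finset _root_.Real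

variable {n : ℕ}

/-- The crude entropy bound for a binomial coefficient in `binEntropy` form:
`C(N, j) ≤ exp(N · h₂(j/N))` for `0 ≤ j ≤ N` (at `N = 0` both sides are `1`).
[cite: HuangSellke2025, §3.3.2, proof of Lemma 3.22 (moat / small-ball / entropy ladder of the resampling chain: counting low-entropy patterns)] -/
theorem cnt_choose_le_exp_binEntropy {N j : ℕ} (hjN : j ≤ N) :
    (N.choose j : ℝ) ≤ Real.exp (N * binEntropy ((j : ℝ) / N)) := by
  rcases Nat.eq_zero_or_pos N with rfl | hN
  · obtain rfl : j = 0 := Nat.le_zero.1 hjN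
    simp
  have hN' : (0 : ℝ) < N := by exact_mod_cast hN
  have h := Literature.Probability.LatticeModels.choose_le_exp_spinRate hjN
  rw [Literature.Probability.LatticeModels.spinRate_eq_log_two_sub_binEntropy] at h
  have e : (1 + (2 * (j : ℝ) - N) / N) / 2 = (j : ℝ) / N := by
    field_simp
    ring
  rw [e] at h
  have h2 : Real.exp ((N : ℝ) * Real.log 2) = 2 ^ N := by
    rw [Real.exp_nat_mul, Real.exp_log two_pos]
  calc (N.choose j : ℝ) ≤ 2 ^ N * Real.exp (-(N * (Real.log 2 - binEntropy ((j : ℝ) / N)))) := h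
    _ = Real.exp (N * binEntropy ((j : ℝ) / N)) := by
      rw [show -((N : ℝ) * (Real.log 2 - binEntropy ((j : ℝ) / N))) =
          N * binEntropy ((j : ℝ) / N) - N * Real.log 2 by ring, Real.exp_sub, h2]
      field_simp

/-- A pattern class has at most `n` positions.
[cite: HuangSellke2025, §3.3.2, proof of Lemma 3.22 (moat / small-ball / entropy ladder of the resampling chain: counting low-entropy patterns)] -/
theorem cnt_patCount_le (Y : ℕ → Fin n → Bool) (ℓ : ℕ) (ξ : Fin ℓ → Bool) : patCount Y ℓ ξ ≤ n := by
  unfold patCount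
  calc (univ.filter fun i : Fin n => (fun j : Fin ℓ => Y j i) = ξ).card
      ≤ (univ : Finset (Fin n)).card := card_filter_le _ _
    _ = n := by rw [card_univ, Fintype.card_fin]

/-- The class sizes `N_ξ` of the prefix do not depend on the inserted candidate.
[cite: HuangSellke2025, §3.3.2, proof of Lemma 3.22 (moat / small-ball / entropy ladder of the resampling chain: counting low-entropy patterns)] -/
theorem cnt_patCount_withRung (R : ℕ → Fin n → Bool) (ℓ : ℕ) (v : Fin n → Bool)
    (ξ : Fin ℓ → Bool) :
    patCount (withRung R ℓ v) ℓ ξ =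
      (univ.filter fun i : Fin n => (fun j : Fin ℓ => R j i) = ξ).card :=
  patCount_congr (fun _ hj => withRung_of_lt R ℓ v hj) ξ

/-- The refined class `ξ·true` of `withRung R ℓ v`: the positions of class `ξ` where `v` is true.
[cite: HuangSellke2025, §3.3.2, proof of Lemma 3.22 (moat / small-ball / entropy ladder of the resampling chain: counting low-entropy patterns)] -/
theorem cnt_patCount_withRung_succ (R : ℕ → Fin n → Bool) (ℓ : ℕ) (v : Fin n → Bool)
    (ξ : Fin ℓ → Bool) :
    patCount (withRung R ℓ v) (ℓ + 1) (Fin.snoc ξ true) =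
      (univ.filter fun i : Fin n => (fun j : Fin ℓ => R j i) = ξ ∧ v i = true).card := by
  unfold patCount
  congr 1
  ext i
  simp only [mem_filter, mem_univ, true_and]
  constructor
  · intro h
    refine ⟨?_, ?_⟩
    · funext j
      have := congrFun h (Fin.castSucc j)
      simp only [Fin.snoc_castSucc, Fin.val_castSucc] at this
      rwa [withRung_of_lt R ℓ v j.isLt] at this
    · have := congrFun h (Fin.last ℓ)
      simp only [Fin.snoc_last, Fin.val_last] at this
      rwa [withRung_self] at this
  · rintro ⟨h1, h2⟩
    funext j
    refine Fin.lastCases ?_ (fun j => ?_) j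
    · simp only [Fin.snoc_last, Fin.val_last, withRung_self]
      exact h2
    · simp only [Fin.snoc_castSucc, Fin.val_castSucc]
      rw [withRung_of_lt R ℓ v j.isLt]
      exact congrFun h1 j

/-- Candidates with a prescribed refined count vector number at most `Π_ξ C(N_ξ, c_ξ)`: a candidate
is determined by its true-sets inside the classes, which form an element of
`Π_ξ powersetCard c_ξ (class ξ)`.
[cite: HuangSellke2025, §3.3.2, proof of Lemma 3.22 (moat / small-ball / entropy ladder of the resampling chain: counting low-entropy patterns)] -/
theorem cnt_card_fiber_le (R : ℕ → Fin n → Bool) (ℓ : ℕ) (v₀ : Fin n → Bool) :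
    (univ.filter fun v : Fin n → Bool => ∀ ξ : Fin ℓ → Bool,
        patCount (withRung R ℓ v) (ℓ + 1) (Fin.snoc ξ true) =
          patCount (withRung R ℓ v₀) (ℓ + 1) (Fin.snoc ξ true)).card ≤
      ∏ ξ : Fin ℓ → Bool, (patCount (withRung R ℓ v₀) ℓ ξ).choose
        (patCount (withRung R ℓ v₀) (ℓ + 1) (Fin.snoc ξ true)) := by
  classical
  calc (univ.filter fun v : Fin n → Bool => ∀ ξ : Fin ℓ → Bool,
        patCount (withRung R ℓ v) (ℓ + 1) (Fin.snoc ξ true) =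
          patCount (withRung R ℓ v₀) (ℓ + 1) (Fin.snoc ξ true)).card
      ≤ (Fintype.piFinset fun ξ : Fin ℓ → Bool =>
          powersetCard (patCount (withRung R ℓ v₀) (ℓ + 1) (Fin.snoc ξ true))
            (univ.filter fun i : Fin n => (fun j : Fin ℓ => R j i) = ξ)).card := by
        refine card_le_card_of_injOn (fun (v : Fin n → Bool) (ξ : Fin ℓ → Bool) =>
          univ.filter fun i : Fin n => (fun j : Fin ℓ => R j i) = ξ ∧ v i = true) ?_ ?_
        · -- maps into the product of the `powersetCard`s
          intro v hv
          rw [mem_coe, mem_filter] at hv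
          rw [mem_coe, Fintype.mem_piFinset]
          intro ξ
          rw [mem_powersetCard]
          refine ⟨?_, ?_⟩
          · intro i hi
            rw [mem_filter] at hi ⊢
            exact ⟨hi.1, hi.2.1⟩
          · rw [← hv.2 ξ, cnt_patCount_withRung_succ]
        · -- injective: `v i` is read off the true-set of the class of `i`
          intro v _ v' _ h
          funext i
          have key : ∀ w : Fin n → Bool,
              (i ∈ univ.filter fun i' : Fin n =>
                (fun j : Fin ℓ => R j i') = (fun j : Fin ℓ => R j i) ∧ w i' = true) ↔ w i = true :=
            fun w => by simp
          have h' := congrFun h (fun j : Fin ℓ => R j i)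
          simp only at h'
          have h1 := key v
          rw [h', key v'] at h1
          exact Bool.eq_iff_iff.2 h1.symm
    _ = ∏ ξ : Fin ℓ → Bool, (patCount (withRung R ℓ v₀) ℓ ξ).choose
          (patCount (withRung R ℓ v₀) (ℓ + 1) (Fin.snoc ξ true)) := by
        rw [Fintype.card_piFinset]
        refine prod_congr rfl fun ξ _ => ?_
        rw [card_powersetCard, cnt_patCount_withRung]

/-- The entropy bound on a fibre: `Π_ξ C(N_ξ, c_ξ) ≤ exp(n · condEnt)` (per class
`C(N, c) ≤ exp(N h₂(c/N))`, and `Σ_ξ N_ξ h₂(c_ξ/N_ξ) = n · condEnt` by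
`condEnt_eq_sum_binEntropy`).
[cite: HuangSellke2025, §3.3.2, proof of Lemma 3.22 (moat / small-ball / entropy ladder of the resampling chain: counting low-entropy patterns)] -/
theorem cnt_prod_choose_le_exp (R : ℕ → Fin n → Bool) (ℓ : ℕ) (v₀ : Fin n → Bool) :
    ((∏ ξ : Fin ℓ → Bool, (patCount (withRung R ℓ v₀) ℓ ξ).choose
        (patCount (withRung R ℓ v₀) (ℓ + 1) (Fin.snoc ξ true)) : ℕ) : ℝ) ≤
      Real.exp (n * condEnt (withRung R ℓ v₀) ℓ) := by
  rw [condEnt_eq_sum_binEntropy, mul_sum, Real.exp_sum, Nat.cast_prod]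
  refine prod_le_prod (fun ξ _ => by positivity) fun ξ _ => ?_
  have hsplit := patCount_succ_eq (withRung R ℓ v₀) ℓ ξ
  have hNn := cnt_patCount_le (withRung R ℓ v₀) ℓ ξ
  set N : ℕ := patCount (withRung R ℓ v₀) ℓ ξ
  set A : ℕ := patCount (withRung R ℓ v₀) (ℓ + 1) (Fin.snoc ξ true)
  have hAN : A ≤ N := by omega
  calc (N.choose A : ℝ)
      ≤ Real.exp (N * binEntropy ((A : ℝ) / N)) := cnt_choose_le_exp_binEntropy hAN
    _ = Real.exp (n * (((N : ℝ) / n) * binEntropy ((A : ℝ) / N))) := by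
      congr 1
      rcases Nat.eq_zero_or_pos n with hn | hn
      · have hN0 : N = 0 := by omega
        simp [hN0, hn]
      · have hn' : (n : ℝ) ≠ 0 := by exact_mod_cast hn.ne'
        field_simp

/-- **Stub C (1)**: for a fixed prefix, the candidates of conditional type entropy `≤ b` number at
most `(n+1)^(2^ℓ) · exp(n b)` (BH §4.6, the count behind `S_indep`, made exact).
[cite: HuangSellke2025, §3.3.2, proof of Lemma 3.22 (moat / small-ball / entropy ladder of the resampling chain: counting low-entropy patterns)] -/
theorem card_filter_condEnt_le (n ℓ : ℕ) (R : ℕ → Fin n → Bool) (b : ℝ) :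
    ((Finset.univ.filter fun v : Fin n → Bool => condEnt (withRung R ℓ v) ℓ ≤ b).card : ℝ) ≤
      ((n : ℝ) + 1) ^ (2 ^ ℓ) * Real.exp (n * b) := by
  classical
  set S := Finset.univ.filter fun v : Fin n → Bool => condEnt (withRung R ℓ v) ℓ ≤ b with hS
  -- the refined count vector of a candidate
  set f : (Fin n → Bool) → (Fin ℓ → Bool) → ℕ :=
    fun v ξ => patCount (withRung R ℓ v) (ℓ + 1) (Fin.snoc ξ true)
  have h1 : S.card = ∑ c ∈ S.image f, (S.filter fun v => f v = c).card :=
    card_eq_sum_card_image f S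
  -- each fibre is small
  have h2 : ∀ c ∈ S.image f, ((S.filter fun v => f v = c).card : ℝ) ≤ Real.exp (n * b) := by
    intro c hc
    obtain ⟨v₀, hv₀, rfl⟩ := mem_image.1 hc
    have hb : condEnt (withRung R ℓ v₀) ℓ ≤ b := by
      rw [hS, mem_filter] at hv₀
      exact hv₀.2
    have hsub : (S.filter fun v => f v = f v₀) ⊆
        (univ.filter fun v : Fin n → Bool => ∀ ξ : Fin ℓ → Bool,
          patCount (withRung R ℓ v) (ℓ + 1) (Fin.snoc ξ true) =
            patCount (withRung R ℓ v₀) (ℓ + 1) (Fin.snoc ξ true)) := by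
      intro v hv
      rw [mem_filter] at hv
      rw [mem_filter]
      exact ⟨mem_univ _, fun ξ => congrFun hv.2 ξ⟩
    calc ((S.filter fun v => f v = f v₀).card : ℝ)
        ≤ ((univ.filter fun v : Fin n → Bool => ∀ ξ : Fin ℓ → Bool,
            patCount (withRung R ℓ v) (ℓ + 1) (Fin.snoc ξ true) =
              patCount (withRung R ℓ v₀) (ℓ + 1) (Fin.snoc ξ true)).card : ℝ) := by
          exact_mod_cast card_le_card hsub
      _ ≤ ((∏ ξ : Fin ℓ → Bool, (patCount (withRung R ℓ v₀) ℓ ξ).choose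
            (patCount (withRung R ℓ v₀) (ℓ + 1) (Fin.snoc ξ true)) : ℕ) : ℝ) := by
          exact_mod_cast cnt_card_fiber_le R ℓ v₀
      _ ≤ Real.exp (n * condEnt (withRung R ℓ v₀) ℓ) := cnt_prod_choose_le_exp R ℓ v₀
      _ ≤ Real.exp (n * b) :=
          Real.exp_le_exp.2 (mul_le_mul_of_nonneg_left hb (Nat.cast_nonneg n))
  -- and there are few count vectors
  have h3 : (S.image f).card ≤ (n + 1) ^ 2 ^ ℓ := by
    calc (S.image f).card
        ≤ (Fintype.piFinset fun _ : Fin ℓ → Bool => range (n + 1)).card := by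
          refine card_le_card fun c hc => ?_
          obtain ⟨v, _, rfl⟩ := mem_image.1 hc
          rw [Fintype.mem_piFinset]
          intro ξ
          rw [mem_range]
          exact Nat.lt_succ_of_le (cnt_patCount_le _ _ _)
      _ = (n + 1) ^ 2 ^ ℓ := by
          rw [Fintype.card_piFinset, prod_const, card_range, card_univ, Fintype.card_fun,
            Fintype.card_fin, Fintype.card_bool]
  calc (S.card : ℝ) = ∑ c ∈ S.image f, ((S.filter fun v => f v = c).card : ℝ) := by
        rw [h1]
        push_cast
        rfl
    _ ≤ ∑ c ∈ S.image f, Real.exp (n * b) := sum_le_sum h2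
    _ = (S.image f).card * Real.exp (n * b) := by rw [sum_const, nsmul_eq_mul]
    _ ≤ ((n : ℝ) + 1) ^ (2 ^ ℓ) * Real.exp (n * b) := by
        gcongr
        exact_mod_cast h3

/-- Dropping the last entry of a tuple does not change the sequence below it.
[cite: HuangSellke2025, §3.3.2, proof of Lemma 3.22 (moat / small-ball / entropy ladder of the resampling chain: counting low-entropy patterns)] -/
theorem cnt_seqOf_init {L : ℕ} (Y : Fin (L + 1) → Fin n → Bool) {j : ℕ} (hj : j < L) :
    seqOf (Fin.init Y) j = seqOf Y j := by
  rw [seqOf_apply_lt _ hj, seqOf_apply_lt _ (Nat.lt_succ_of_lt hj)]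
  rfl

end Count

end Literature.Computability.Complexity.HuangSellke2025Chain.DartGame

end Part9

/-!
## Part 10 — port of `Summits/PneNP/PneNP/Theorems/OverlapGapAlgebraNoStableSectionEntropy.lean` (14 declarations kept)

# Route OverlapGapAlgebra, crux `NoStableSection` (stmt-PneNP-2462), line `DartGame`: entropy

Stub `stub_entropyToolkit` (the body of `EntropyToolkit`) of the skeleton
`Summits/PneNP/PneNP/Cruxes/NoStableSection/Lines/DartGame.lean`: Bresler–Huang
(FOCS 2021 / arXiv:2106.02129) Fact 4.5(iii) and Lemma 4.8, for the ORDERED conditional type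
entropy `condEnt (withRung R ℓ v) ℓ` of a candidate `v : Fin n → Bool` given the rungs
`R 0, …, R (ℓ-1)` (the potential of the ladder extraction):
1. `condEnt_withRung_eq_zero_of_mem`: the potential vanishes on a repeated rung;
2. `abs_condEnt_withRung_sub_le_binEntropy`: it is `h₂(Δ/n)`-continuous in the candidate,
   `|condEnt(v) - condEnt(v')| ≤ h₂(Δ(v,v')/n)` for Hamming distance `Δ(v,v') ≤ n/2`
   (`h₂ = Real.binEntropy`, nats).
Proof: by the conditional form `condEnt_eq_sum_binEntropy`,
`condEnt (withRung R ℓ v) ℓ = Σ_ξ (N_ξ/n) h₂(A_ξ(v)/N_ξ)` where `N_ξ` counts the positions whose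
column over the prefix is `ξ` and `A_ξ(v)` those among them where `v` is `true`. (1): on a repeated
rung `A_ξ ∈ {0, N_ξ}`. (2): `|h₂ a - h₂ b| ≤ h₂ |a - b|` on `[0,1]` (subadditivity of the concave
`h₂`, `h₂ 0 = 0`, and the symmetry `h₂ (1 - x) = h₂ x`), Jensen's inequality for `h₂` with the
weights `N_ξ/n`, `Σ_ξ |A_ξ(v) - A_ξ(v')| ≤ Δ(v,v')` (the classes partition the disagreement set),
and monotonicity of `h₂` on `[0, 1/2]`.
-/

section Part10

namespace Literature.Computability.Complexity.HuangSellke2025Chain.DartGame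

/-! ## Stub B — the entropy toolkit (BH Fact 4.5(iii) and Lemma 4.8) -/

section EntropyToolkit

open _root_.Finset _root_.Real

variable {n : ℕ}

/-! ### Scalar facts about the binary entropy `h₂ = Real.binEntropy` -/

/-- Subadditivity of the binary entropy on `[0,1]`: `h₂ (x + y) ≤ h₂ x + h₂ y` for `x, y ≥ 0` with
`x + y ≤ 1` (concavity of `h₂` on `[0,1]`, Mathlib's `Real.strictConcave_binEntropy`, and
`h₂ 0 = 0`).
[cite: HuangSellke2025, §3.3.2, proof of Lemma 3.22 (moat / small-ball / entropy ladder of the resampling chain: the entropy ladder)] -/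
theorem ent_binEntropy_add_le {x y : ℝ} (hx : 0 ≤ x) (hy : 0 ≤ y) (hxy : x + y ≤ 1) :
    binEntropy (x + y) ≤ binEntropy x + binEntropy y := by
  rcases (add_nonneg hx hy).eq_or_lt with h0 | hpos
  · have hx0 : x = 0 := by linarith
    have hy0 : y = 0 := by linarith
    simp [hx0, hy0]
  · have hc := strictConcave_binEntropy.concaveOn
    have hs : x + y ∈ Set.Icc (0 : ℝ) 1 := ⟨hpos.le, hxy⟩
    have h0 : (0 : ℝ) ∈ Set.Icc (0 : ℝ) 1 := ⟨le_rfl, zero_le_one⟩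
    have hne : x + y ≠ 0 := hpos.ne'
    have hab : x / (x + y) + y / (x + y) = 1 := by rw [← add_div, div_self hne]
    have h1 := hc.2 hs h0 (div_nonneg hx hpos.le) (div_nonneg hy hpos.le) hab
    have h2 := hc.2 hs h0 (div_nonneg hy hpos.le) (div_nonneg hx hpos.le)
      ((add_comm _ _).trans hab)
    simp only [smul_eq_mul, mul_zero, add_zero, binEntropy_zero, div_mul_cancel₀ _ hne] at h1 h2
    -- `h1 : x/(x+y) · h₂(x+y) ≤ h₂ x`, `h2 : y/(x+y) · h₂(x+y) ≤ h₂ y`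
    calc binEntropy (x + y)
        = x / (x + y) * binEntropy (x + y) + y / (x + y) * binEntropy (x + y) := by
          rw [← add_mul, hab, one_mul]
      _ ≤ binEntropy x + binEntropy y := add_le_add h1 h2

/-- `h₂` is `h₂`-continuous on `[0,1]`: `|h₂ a - h₂ b| ≤ h₂ |a - b|` (the scalar inequality behind
BH Lemma 4.8; from subadditivity and the symmetry `h₂ (1 - x) = h₂ x`).
[cite: HuangSellke2025, §3.3.2, proof of Lemma 3.22 (moat / small-ball / entropy ladder of the resampling chain: the entropy ladder)] -/
theorem ent_abs_binEntropy_sub_le {a b : ℝ} (ha : a ∈ Set.Icc (0 : ℝ) 1)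
    (hb : b ∈ Set.Icc (0 : ℝ) 1) : |binEntropy a - binEntropy b| ≤ binEntropy |a - b| := by
  -- it suffices to treat ordered pairs
  suffices key : ∀ a b : ℝ, a ∈ Set.Icc (0 : ℝ) 1 → b ∈ Set.Icc (0 : ℝ) 1 → b ≤ a →
      |binEntropy a - binEntropy b| ≤ binEntropy (a - b) by
    rcases le_total b a with h | h
    · rw [abs_of_nonneg (sub_nonneg.2 h)]
      exact key a b ha hb h
    · rw [abs_sub_comm (binEntropy a), abs_sub_comm a b, abs_of_nonneg (sub_nonneg.2 h)]
      exact key b a hb ha h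
  intro a b ha hb hle
  rw [abs_sub_le_iff]
  constructor
  · -- `h₂ a = h₂ (b + (a - b)) ≤ h₂ b + h₂ (a - b)`
    have := ent_binEntropy_add_le hb.1 (sub_nonneg.2 hle) (by linarith [ha.2])
    rw [show b + (a - b) = a by ring] at this
    linarith
  · -- `h₂ b = h₂ (1 - b) = h₂ ((1 - a) + (a - b)) ≤ h₂ (1 - a) + h₂ (a - b) = h₂ a + h₂ (a - b)`
    have := ent_binEntropy_add_le (sub_nonneg.2 ha.2) (sub_nonneg.2 hle) (by linarith [hb.1])
    rw [show 1 - a + (a - b) = 1 - b by ring, binEntropy_one_sub, binEntropy_one_sub] at this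
    linarith

/-- Abstract form of BH Lemma 4.8: two mixtures of binary entropies with the same weights differ by
at most `h₂ μ` whenever the weighted mean deviation of their arguments is `≤ μ ≤ 1/2` (triangle
inequality, `ent_abs_binEntropy_sub_le`, Jensen's inequality for the concave `h₂`, and
monotonicity of `h₂` on `[0, 1/2]`).
[cite: HuangSellke2025, §3.3.2, proof of Lemma 3.22 (moat / small-ball / entropy ladder of the resampling chain: the entropy ladder)] -/
theorem ent_abs_sum_sub_sum_le {ι : Type*} {s : Finset ι} {w a a' : ι → ℝ} {μ : ℝ}
    (hw0 : ∀ i ∈ s, 0 ≤ w i) (hw1 : ∑ i ∈ s, w i = 1)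
    (ha : ∀ i ∈ s, a i ∈ Set.Icc (0 : ℝ) 1) (ha' : ∀ i ∈ s, a' i ∈ Set.Icc (0 : ℝ) 1)
    (hμ : ∑ i ∈ s, w i * |a i - a' i| ≤ μ) (hμ2 : μ ≤ 2⁻¹) :
    |∑ i ∈ s, w i * binEntropy (a i) - ∑ i ∈ s, w i * binEntropy (a' i)| ≤ binEntropy μ := by
  have hp : ∀ i ∈ s, |a i - a' i| ∈ Set.Icc (0 : ℝ) 1 := fun i hi =>
    ⟨abs_nonneg _, abs_sub_le_iff.2
      ⟨by linarith [(ha i hi).2, (ha' i hi).1], by linarith [(ha i hi).1, (ha' i hi).2]⟩⟩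
  have hs0 : 0 ≤ ∑ i ∈ s, w i * |a i - a' i| :=
    sum_nonneg fun i hi => mul_nonneg (hw0 i hi) (abs_nonneg _)
  have hJ := strictConcave_binEntropy.concaveOn.le_map_sum hw0 hw1 hp
  simp only [smul_eq_mul] at hJ
  calc |∑ i ∈ s, w i * binEntropy (a i) - ∑ i ∈ s, w i * binEntropy (a' i)|
      = |∑ i ∈ s, w i * (binEntropy (a i) - binEntropy (a' i))| := by
        rw [← sum_sub_distrib]
        simp only [mul_sub]
    _ ≤ ∑ i ∈ s, |w i * (binEntropy (a i) - binEntropy (a' i))| := abs_sum_le_sum_abs _ _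
    _ = ∑ i ∈ s, w i * |binEntropy (a i) - binEntropy (a' i)| :=
        sum_congr rfl fun i hi => by rw [abs_mul, abs_of_nonneg (hw0 i hi)]
    _ ≤ ∑ i ∈ s, w i * binEntropy |a i - a' i| :=
        sum_le_sum fun i hi =>
          mul_le_mul_of_nonneg_left (ent_abs_binEntropy_sub_le (ha i hi) (ha' i hi)) (hw0 i hi)
    _ ≤ binEntropy (∑ i ∈ s, w i * |a i - a' i|) := hJ
    _ ≤ binEntropy μ :=
        binEntropy_strictMonoOn.monotoneOn ⟨hs0, hμ.trans hμ2⟩ ⟨hs0.trans hμ, hμ2⟩ hμ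

/-- A ratio of counts `A ≤ N` lies in `[0,1]` (also when `N = 0`, by `x / 0 = 0`).
[cite: HuangSellke2025, §3.3.2, proof of Lemma 3.22 (moat / small-ball / entropy ladder of the resampling chain: the entropy ladder)] -/
theorem ent_div_mem_Icc {A N : ℕ} (h : A ≤ N) : (A : ℝ) / N ∈ Set.Icc (0 : ℝ) 1 :=
  ⟨by positivity, div_le_one_of_le₀ (by exact_mod_cast h) (Nat.cast_nonneg N)⟩

/-- Per-class step of BH Lemma 4.8: `(N/m) · |A/N - A'/N| ≤ |A - A'| / m` (an equality unless
`N = 0`).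
[cite: HuangSellke2025, §3.3.2, proof of Lemma 3.22 (moat / small-ball / entropy ladder of the resampling chain: the entropy ladder)] -/
theorem ent_weight_mul_abs_sub_le {m N : ℝ} (hm : 0 < m) (hN : 0 ≤ N) (A A' : ℝ) :
    N / m * |A / N - A' / N| ≤ |A - A'| / m := by
  rcases hN.eq_or_lt with h0 | hpos
  · rw [← h0, zero_div, zero_mul]
    exact div_nonneg (abs_nonneg _) hm.le
  · rw [← sub_div, abs_div, abs_of_pos hpos]
    apply le_of_eq
    rw [div_mul_div_comm, mul_comm N, mul_div_mul_right _ _ hpos.ne']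

/-! ### Pattern classes of `withRung R ℓ v` -/

/-- Below the inserted rung the pattern classes of `withRung R ℓ v` are those of the prefix `R`.
[cite: HuangSellke2025, §3.3.2, proof of Lemma 3.22 (moat / small-ball / entropy ladder of the resampling chain: the entropy ladder)] -/
theorem ent_patCount_withRung (R : ℕ → Fin n → Bool) (ℓ : ℕ) (v : Fin n → Bool)
    (ξ : Fin ℓ → Bool) : patCount (withRung R ℓ v) ℓ ξ = patCount R ℓ ξ :=
  patCount_congr (fun _ hj => withRung_of_lt R ℓ v hj) ξ

/-- A position has column `ξ·b` over the first `ℓ + 1` rungs of `withRung R ℓ v` iff its column over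
the prefix is `ξ` and `v` gives it the value `b`.
[cite: HuangSellke2025, §3.3.2, proof of Lemma 3.22 (moat / small-ball / entropy ladder of the resampling chain: the entropy ladder)] -/
theorem ent_col_withRung_eq_snoc_iff (R : ℕ → Fin n → Bool) (ℓ : ℕ) (v : Fin n → Bool)
    (ξ : Fin ℓ → Bool) (b : Bool) (i : Fin n) :
    ((fun j : Fin (ℓ + 1) => withRung R ℓ v j i) = Fin.snoc ξ b) ↔
      ((fun j : Fin ℓ => R j i) = ξ ∧ v i = b) := by
  constructor
  · intro h
    refine ⟨funext fun j => ?_, ?_⟩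
    · simpa [withRung_of_lt R ℓ v j.isLt] using congrFun h (Fin.castSucc j)
    · simpa using congrFun h (Fin.last ℓ)
  · rintro ⟨h1, h2⟩
    funext j
    refine Fin.lastCases ?_ (fun j => ?_) j
    · simpa using h2
    · simpa [withRung_of_lt R ℓ v j.isLt] using congrFun h1 j

/-- The refined class counts of `withRung R ℓ v`: positions with prefix column `ξ` and `v i = b`.
[cite: HuangSellke2025, §3.3.2, proof of Lemma 3.22 (moat / small-ball / entropy ladder of the resampling chain: the entropy ladder)] -/
theorem ent_patCount_withRung_succ (R : ℕ → Fin n → Bool) (ℓ : ℕ) (v : Fin n → Bool)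
    (ξ : Fin ℓ → Bool) (b : Bool) :
    patCount (withRung R ℓ v) (ℓ + 1) (Fin.snoc ξ b) =
      #(univ.filter fun i : Fin n => (fun j : Fin ℓ => R j i) = ξ ∧ v i = b) := by
  unfold patCount
  congr 1
  ext i
  simp only [mem_filter, mem_univ, true_and, ent_col_withRung_eq_snoc_iff]

/-- The refined class is contained in the class: `N_{ℓ+1}(ξ·true) ≤ N_ℓ(ξ)`.
[cite: HuangSellke2025, §3.3.2, proof of Lemma 3.22 (moat / small-ball / entropy ladder of the resampling chain: the entropy ladder)] -/
theorem ent_patCount_snoc_le (R : ℕ → Fin n → Bool) (ℓ : ℕ) (v : Fin n → Bool)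
    (ξ : Fin ℓ → Bool) : patCount (withRung R ℓ v) (ℓ + 1) (Fin.snoc ξ true) ≤ patCount R ℓ ξ := by
  rw [← ent_patCount_withRung R ℓ v ξ, patCount_succ_eq (withRung R ℓ v) ℓ ξ]
  exact Nat.le_add_right _ _

/-- One-sided count comparison: the positions of a class where `v` is `true` are among those where
`v` and `v'` disagree or `v'` is `true`.
[cite: HuangSellke2025, §3.3.2, proof of Lemma 3.22 (moat / small-ball / entropy ladder of the resampling chain: the entropy ladder)] -/
theorem ent_card_filter_and_le {α : Type*} [DecidableEq α] (s : Finset α) (p : α → Prop)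
    [DecidablePred p] (v v' : α → Bool) :
    #(s.filter fun i => p i ∧ v i = true) ≤
      #(s.filter fun i => p i ∧ v i ≠ v' i) + #(s.filter fun i => p i ∧ v' i = true) := by
  calc #(s.filter fun i => p i ∧ v i = true)
      ≤ #((s.filter fun i => p i ∧ v i ≠ v' i) ∪ (s.filter fun i => p i ∧ v' i = true)) := by
        refine card_le_card fun i => ?_
        simp only [mem_filter, mem_union]
        rintro ⟨hs, hp, hv⟩
        by_cases h' : v' i = true
        · exact Or.inr ⟨hs, hp, h'⟩
        · exact Or.inl ⟨hs, hp, fun h => h' (by rw [← h]; exact hv)⟩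
    _ ≤ _ := card_union_le _ _

/-- Class by class, the refined counts of two candidates differ by at most the number of
disagreements of the candidates inside the class.
[cite: HuangSellke2025, §3.3.2, proof of Lemma 3.22 (moat / small-ball / entropy ladder of the resampling chain: the entropy ladder)] -/
theorem ent_abs_patCount_sub_le (R : ℕ → Fin n → Bool) (ℓ : ℕ) (v v' : Fin n → Bool)
    (ξ : Fin ℓ → Bool) :
    |(patCount (withRung R ℓ v) (ℓ + 1) (Fin.snoc ξ true) : ℝ) -
        patCount (withRung R ℓ v') (ℓ + 1) (Fin.snoc ξ true)| ≤
      #(univ.filter fun i : Fin n => (fun j : Fin ℓ => R j i) = ξ ∧ v i ≠ v' i) := by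
  rw [ent_patCount_withRung_succ, ent_patCount_withRung_succ]
  have h1 := ent_card_filter_and_le univ (fun i : Fin n => (fun j : Fin ℓ => R j i) = ξ) v v'
  have h2 := ent_card_filter_and_le univ (fun i : Fin n => (fun j : Fin ℓ => R j i) = ξ) v' v
  have h3 : #(univ.filter fun i : Fin n => (fun j : Fin ℓ => R j i) = ξ ∧ v' i ≠ v i) =
      #(univ.filter fun i : Fin n => (fun j : Fin ℓ => R j i) = ξ ∧ v i ≠ v' i) := by
    congr 1
    exact filter_congr fun i _ => by rw [ne_comm]
  rw [h3] at h2
  rw [abs_sub_le_iff]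
  constructor
  · have := (Nat.cast_le (α := ℝ)).2 h1
    push_cast at this
    linarith
  · have := (Nat.cast_le (α := ℝ)).2 h2
    push_cast at this
    linarith

/-- The classes partition the disagreement set: `Σ_ξ #{i ∈ class ξ : v i ≠ v' i} = Δ(v, v')`.
[cite: HuangSellke2025, §3.3.2, proof of Lemma 3.22 (moat / small-ball / entropy ladder of the resampling chain: the entropy ladder)] -/
theorem ent_sum_card_disagree (R : ℕ → Fin n → Bool) (ℓ : ℕ) (v v' : Fin n → Bool) :
    ∑ ξ : Fin ℓ → Bool, #(univ.filter fun i : Fin n => (fun j : Fin ℓ => R j i) = ξ ∧ v i ≠ v' i) =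
      hammingDist v v' := by
  unfold hammingDist
  rw [card_eq_sum_card_fiberwise (f := fun i : Fin n => fun j : Fin ℓ => R j i) (t := univ)
    fun i _ => mem_univ _]
  refine sum_congr rfl fun ξ _ => ?_
  congr 1
  ext i
  simp only [mem_filter, mem_univ, true_and]
  exact ⟨fun h => ⟨h.2, h.1⟩, fun h => ⟨h.2, h.1⟩⟩

/-! ### The two conjuncts -/

/-- **BH Fact 4.5(iii)** (ordered form): the conditional type entropy of a candidate that repeats
an earlier rung vanishes, `condEnt (withRung R ℓ (R j₀)) ℓ = 0` for `j₀ < ℓ` (every refined class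
is the whole class or empty).
[cite: HuangSellke2025, §3.3.2, proof of Lemma 3.22 (moat / small-ball / entropy ladder of the resampling chain: the entropy ladder)] -/
theorem condEnt_withRung_eq_zero_of_mem (n ℓ : ℕ) (R : ℕ → Fin n → Bool) (v : Fin n → Bool)
    (hv : ∃ j < ℓ, R j = v) : condEnt (withRung R ℓ v) ℓ = 0 := by
  obtain ⟨j₀, hj₀, rfl⟩ := hv
  rw [condEnt_eq_sum_binEntropy]
  refine sum_eq_zero fun ξ _ => ?_
  rw [ent_patCount_withRung, ent_patCount_withRung_succ]
  cases hξ : ξ ⟨j₀, hj₀⟩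
  · -- `ξ j₀ = false`: no position of the class has `R j₀ i = true`
    have h0 : (univ.filter fun i : Fin n => (fun j : Fin ℓ => R j i) = ξ ∧ R j₀ i = true) = ∅ := by
      refine filter_eq_empty_iff.2 fun i _ h => ?_
      have h1 := congrFun h.1 ⟨j₀, hj₀⟩
      simp [hξ, h.2] at h1
    rw [h0, card_empty, Nat.cast_zero, zero_div, binEntropy_zero, mul_zero]
  · -- `ξ j₀ = true`: the refined class is the whole class
    have h0 : (univ.filter fun i : Fin n => (fun j : Fin ℓ => R j i) = ξ ∧ R j₀ i = true) =
        univ.filter fun i : Fin n => (fun j : Fin ℓ => R j i) = ξ := by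
      refine filter_congr fun i _ => ⟨fun h => h.1, fun h => ⟨h, ?_⟩⟩
      simpa [hξ] using congrFun h ⟨j₀, hj₀⟩
    have h2 : #(univ.filter fun i : Fin n => (fun j : Fin ℓ => R j i) = ξ) = patCount R ℓ ξ := rfl
    rw [h0, h2]
    rcases Nat.eq_zero_or_pos (patCount R ℓ ξ) with hN | hN
    · rw [hN, Nat.cast_zero, zero_div, zero_mul]
    · rw [div_self (Nat.cast_ne_zero.2 hN.ne'), binEntropy_one, mul_zero]

/-- **BH Lemma 4.8** (ordered form): the conditional type entropy is `h₂(Δ/n)`-continuous in the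
candidate, `|condEnt (withRung R ℓ v) ℓ - condEnt (withRung R ℓ v') ℓ| ≤ h₂ (Δ(v,v') / n)`
whenever the Hamming distance `Δ(v,v')` is at most `n / 2`.
[cite: HuangSellke2025, §3.3.2, proof of Lemma 3.22 (moat / small-ball / entropy ladder of the resampling chain: the entropy ladder)] -/
theorem abs_condEnt_withRung_sub_le_binEntropy (n ℓ : ℕ) (R : ℕ → Fin n → Bool)
    (v v' : Fin n → Bool) (hd : (hammingDist v v' : ℝ) ≤ n / 2) :
    |condEnt (withRung R ℓ v) ℓ - condEnt (withRung R ℓ v') ℓ| ≤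
      binEntropy ((hammingDist v v' : ℝ) / n) := by
  rcases Nat.eq_zero_or_pos n with rfl | hn
  · -- no positions: both candidates coincide
    have h : v = v' := funext fun i => i.elim0
    subst h
    simp
  have hnr : (0 : ℝ) < n := by exact_mod_cast hn
  rw [condEnt_eq_sum_binEntropy, condEnt_eq_sum_binEntropy]
  simp only [ent_patCount_withRung]
  refine ent_abs_sum_sub_sum_le (fun ξ _ => by positivity) ?_ (fun ξ _ => ?_) (fun ξ _ => ?_)
    ?_ ?_
  · -- the weights `N_ξ / n` sum to one
    rw [← sum_div, div_eq_one_iff_eq hnr.ne']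
    exact_mod_cast sum_patCount R ℓ
  · exact ent_div_mem_Icc (ent_patCount_snoc_le R ℓ v ξ)
  · exact ent_div_mem_Icc (ent_patCount_snoc_le R ℓ v' ξ)
  · -- the weighted mean deviation is at most `Δ / n`
    calc ∑ ξ : Fin ℓ → Bool, (patCount R ℓ ξ : ℝ) / n *
          |(patCount (withRung R ℓ v) (ℓ + 1) (Fin.snoc ξ true) : ℝ) / patCount R ℓ ξ -
            (patCount (withRung R ℓ v') (ℓ + 1) (Fin.snoc ξ true) : ℝ) / patCount R ℓ ξ|
        ≤ ∑ ξ : Fin ℓ → Bool, |(patCount (withRung R ℓ v) (ℓ + 1) (Fin.snoc ξ true) : ℝ) -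
            patCount (withRung R ℓ v') (ℓ + 1) (Fin.snoc ξ true)| / n :=
          sum_le_sum fun ξ _ => ent_weight_mul_abs_sub_le hnr (Nat.cast_nonneg _) _ _
      _ ≤ ∑ ξ : Fin ℓ → Bool,
            (#(univ.filter fun i : Fin n => (fun j : Fin ℓ => R j i) = ξ ∧ v i ≠ v' i) : ℝ) / n :=
          sum_le_sum fun ξ _ =>
            div_le_div_of_nonneg_right (ent_abs_patCount_sub_le R ℓ v v' ξ) hnr.le
      _ = (hammingDist v v' : ℝ) / n := by
          rw [← sum_div, ← ent_sum_card_disagree R ℓ v v', Nat.cast_sum]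
  · -- `Δ / n ≤ 1/2`
    rw [div_le_iff₀ hnr]
    linarith

end EntropyToolkit

end Literature.Computability.Complexity.HuangSellke2025Chain.DartGame

end Part10

/-!
## Part 11 — port of `Summits/PneNP/PneNP/Theorems/OverlapGapAlgebraSearchHardWindowMoat.lean` (9 declarations kept)

# Route OverlapGapAlgebra, crux `SearchHardWindow` (stmt-PneNP-2460), line `Sketch`: the moat
# (ladder extraction along a chain of outputs)

Stub `stub_moat` of the skeleton `Summits/PneNP/PneNP/Cruxes/SearchHardWindow/Lines/Sketch.lean`
(section `HS25`): the deterministic moat / ladder extraction of Huang–Sellke 2025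
(arXiv:2501.06427, Lemma 3.25 with the continuity Lemma 3.24), which is Bresler–Huang's
Proposition 4.6 / Lemma 4.8 (arXiv:2106.02129) run along a chain of outputs `x 0, x 1, …`.

The potential of a candidate `v : Fin n → Bool` given the rungs `R 0, …, R (ℓ-1)` is the
Bresler–Huang (unordered) conditional overlap entropy, i.e. the DartGame ordered conditional type
entropy `condEnt` of the rung-`0`-NORMALISED sequence:
`h R ℓ v = condEnt (fun j i => withRung R ℓ v j i ⊕ R 0 i) ℓ`.
Since normalisation commutes with `withRung` (`moat_norm_withRung`), the DartGame entropy toolkit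
(`condEnt_withRung_eq_zero_of_mem`, `abs_condEnt_withRung_sub_le_binEntropy`) transfers to `h`:
it vanishes on a repeated rung (`moat_pot_rep`), is local in the prefix for `ℓ ≥ 1`
(`moat_pot_loc`), and is `h₂(Δ/n)`-continuous in the candidate (`moat_pot_lip`, using that xor by a
fixed vector preserves Hamming distances, `moat_hammingDist_xor`).  The abstract ladder extraction
of `OverlapGapAlgebraNoStableSectionLadder` is then re-run (`moat_ladder_step`,
`moat_ladderExtraction`) with the chaos-freeness hypothesis restricted to increasing rung times
starting at `0` (the only ones the recursion ever produces) and the Lipschitz hypothesis restricted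
to times `< T`, `k W ≤ T`: by the discrete intermediate value theorem `ladder_ivt`, the next rung
time is the first time after `ts ℓ` at which the potential reaches `β - η`; it is at most
`ts ℓ + W` because one window later the potential already exceeds `β`.
-/

section Part11

namespace Literature.Computability.Complexity.HuangSellke2025Chain

open _root_.Finset
open Literature.Computability.Complexity.HuangSellke2025Chain.DartGame (condEnt withRung withRung_of_lt
  withRung_of_le withRung_self condEnt_congr condEnt_withRung_congr condEnt_withRung_eq_zero_of_mem
  abs_condEnt_withRung_sub_le_binEntropy ladder_ivt ladder_le_mul ladder_mono)

/-! ## The abstract ladder with chaos-freeness for increasing rung times only -/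

/-- The inductive step of the ladder extraction (cf. `ladder_step`), with the lower bound `hind`
only assumed for rung times `ts` with `ts 0 = 0` that increase strictly below `ℓ`, and the one-step
bound `hlip` only below the horizon `T ≥ k W`: given rung times `ts 0 = 0 < ⋯ < ts ℓ` with gaps
`≤ W` and `ℓ + 1 ≤ k`, some `s ∈ (ts ℓ, ts ℓ + W]` has potential in `[bm, bp]` given the first
`ℓ + 1` rungs. [cite: HuangSellke2025, §3.3.2, Lemma 3.22 (the moat of the resampling chain)] -/
theorem moat_ladder_step {V : Type} {k W T : ℕ} {x : ℕ → V} {h : (ℕ → V) → ℕ → V → ℝ}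
    {δ bm bp : ℝ} (hW : 0 < W) (hbm : 0 ≤ bm) (hδ : δ ≤ bp - bm) (hT : k * W ≤ T)
    (hrep : ∀ (R : ℕ → V) (ℓ : ℕ) (v : V), (∃ j < ℓ, R j = v) → h R ℓ v = 0)
    (hlip : ∀ (R : ℕ → V) (ℓ t : ℕ), t < T → |h R ℓ (x (t + 1)) - h R ℓ (x t)| ≤ δ)
    (hind : ∀ (ℓ : ℕ) (ts : ℕ → ℕ) (t : ℕ), 1 ≤ ℓ → ℓ ≤ k → ts 0 = 0 →
      (∀ j, j + 1 < ℓ → ts j < ts (j + 1)) → (∀ j < ℓ, ts j + W ≤ t) → t ≤ T →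
      bp < h (fun j => x (ts j)) ℓ (x t))
    {ℓ : ℕ} {ts : ℕ → ℕ} (hℓk : ℓ + 1 ≤ k) (h0 : ts 0 = 0)
    (hgap : ∀ i < ℓ, ts i < ts (i + 1) ∧ ts (i + 1) ≤ ts i + W) :
    ∃ s, ts ℓ < s ∧ s ≤ ts ℓ + W ∧ h (fun j => x (ts j)) (ℓ + 1) (x s) ∈ Set.Icc bm bp := by
  -- adapted from `ladder_step` of `OverlapGapAlgebraNoStableSectionLadder`
  have hts_le : ts ℓ ≤ ℓ * W := ladder_le_mul h0 hgap ℓ le_rfl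
  have ht' : ts ℓ + W ≤ T := by
    calc ts ℓ + W ≤ ℓ * W + W := by omega
      _ = (ℓ + 1) * W := by ring
      _ ≤ k * W := Nat.mul_le_mul_right _ hℓk
      _ ≤ T := hT
  -- the potential of the candidate `x s` given the first `ℓ + 1` rungs
  set f : ℕ → ℝ := fun s => h (fun j => x (ts j)) (ℓ + 1) (x s) with hf
  -- it vanishes at the last rung time
  have hf0 : f (ts ℓ) = 0 := hrep _ _ _ ⟨ℓ, Nat.lt_succ_self ℓ, rfl⟩
  -- and exceeds `bp` one window later
  have hft' : bp < f (ts ℓ + W) := by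
    refine hind (ℓ + 1) ts (ts ℓ + W) (by omega) hℓk h0 (fun j hj => (hgap j (by omega)).1) ?_ ht'
    intro j hj
    have := ladder_mono hgap ℓ le_rfl j (by omega)
    omega
  -- one-step increments are at most `δ` up to time `ts ℓ + W ≤ T`
  have hlip' : ∀ t ≤ ts ℓ + (W - 1), f (t + 1) ≤ f t + δ := by
    intro t ht
    have habs : |f (t + 1) - f t| ≤ δ := hlip (fun j => x (ts j)) (ℓ + 1) t (by omega)
    have := (abs_le.mp habs).2
    linarith
  have hδ0 : 0 ≤ δ := by
    have habs : |f (ts ℓ + 1) - f (ts ℓ)| ≤ δ :=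
      hlip (fun j => x (ts j)) (ℓ + 1) (ts ℓ) (by omega)
    exact (abs_nonneg _).trans habs
  have hb : bm ≤ f (ts ℓ + 1 + (W - 1)) := by
    have h1 : ts ℓ + 1 + (W - 1) = ts ℓ + W := by omega
    rw [h1]
    linarith
  obtain ⟨s, hs1, hs2, hs3, hs4⟩ := ladder_ivt (hf0.le.trans hbm) hb hlip'
  exact ⟨s, hs1, by omega, hs3, show f s ≤ bp by linarith⟩

/-- Ladder extraction (cf. `stub_ladderExtraction`, abstract form of Bresler–Huang Prop. 4.6) with
the lower bound `hind` only for increasing rung times starting at `0`, the one-step bound only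
below the horizon `T ≥ k W`, and locality only for `ℓ ≥ 1`: there are rung times
`ts 0 = 0 < ts 1 < ⋯ < ts k` with consecutive gaps `≤ W` such that every rung `ℓ ≥ 1` has
potential in `[bm, bp]` given its predecessors.
[cite: HuangSellke2025, §3.3.2, Lemma 3.22 (the moat of the resampling chain)] -/
theorem moat_ladderExtraction {V : Type} {k W T : ℕ} {x : ℕ → V} {h : (ℕ → V) → ℕ → V → ℝ}
    {δ bm bp : ℝ} (hW : 0 < W) (hbm : 0 ≤ bm) (hδ : δ ≤ bp - bm) (hT : k * W ≤ T)
    (hloc : ∀ (R R' : ℕ → V) (ℓ : ℕ) (v : V), 1 ≤ ℓ → (∀ j < ℓ, R j = R' j) →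
      h R ℓ v = h R' ℓ v)
    (hrep : ∀ (R : ℕ → V) (ℓ : ℕ) (v : V), (∃ j < ℓ, R j = v) → h R ℓ v = 0)
    (hlip : ∀ (R : ℕ → V) (ℓ t : ℕ), t < T → |h R ℓ (x (t + 1)) - h R ℓ (x t)| ≤ δ)
    (hind : ∀ (ℓ : ℕ) (ts : ℕ → ℕ) (t : ℕ), 1 ≤ ℓ → ℓ ≤ k → ts 0 = 0 →
      (∀ j, j + 1 < ℓ → ts j < ts (j + 1)) → (∀ j < ℓ, ts j + W ≤ t) → t ≤ T →
      bp < h (fun j => x (ts j)) ℓ (x t)) :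
    ∃ ts : ℕ → ℕ, ts 0 = 0 ∧ (∀ ℓ < k, ts ℓ < ts (ℓ + 1) ∧ ts (ℓ + 1) ≤ ts ℓ + W) ∧
      ∀ ℓ, 1 ≤ ℓ → ℓ ≤ k → h (fun j => x (ts j)) ℓ (x (ts ℓ)) ∈ Set.Icc bm bp := by
  -- adapted from `stub_ladderExtraction` of `OverlapGapAlgebraNoStableSectionLadder`
  suffices H : ∀ ℓ ≤ k, ∃ ts : ℕ → ℕ, ts 0 = 0 ∧
      (∀ i < ℓ, ts i < ts (i + 1) ∧ ts (i + 1) ≤ ts i + W) ∧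
      ∀ i, 1 ≤ i → i ≤ ℓ → h (fun j => x (ts j)) i (x (ts i)) ∈ Set.Icc bm bp from
    H k le_rfl
  intro ℓ
  induction ℓ with
  | zero =>
    intro _
    exact ⟨fun _ => 0, rfl, fun i hi => absurd hi (Nat.not_lt_zero _),
      fun i h1 h2 => absurd (h1.trans h2) (by norm_num)⟩
  | succ ℓ ih =>
    intro hℓk
    obtain ⟨ts, h0, hgap, hval⟩ := ih (by omega)
    obtain ⟨s₀, hs₀lt, hs₀le, hs₀val⟩ :=
      moat_ladder_step hW hbm hδ hT hrep hlip hind hℓk h0 hgap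
    refine ⟨Function.update ts (ℓ + 1) s₀, ?_, ?_, ?_⟩
    · rw [Function.update_of_ne (by omega : (0 : ℕ) ≠ ℓ + 1)]
      exact h0
    · intro i hi
      rcases Nat.lt_or_ge i ℓ with hil | hil
      · rw [Function.update_of_ne (by omega : i ≠ ℓ + 1),
          Function.update_of_ne (by omega : i + 1 ≠ ℓ + 1)]
        exact hgap i hil
      · obtain rfl : i = ℓ := by omega
        rw [Function.update_self, Function.update_of_ne (by omega : i ≠ i + 1)]
        exact ⟨hs₀lt, hs₀le⟩
    · intro i h1i hi
      have key : h (fun j => x (Function.update ts (ℓ + 1) s₀ j)) i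
          = h (fun j => x (ts j)) i := by
        funext v
        refine hloc _ _ i v h1i ?_
        intro j hj
        rw [Function.update_of_ne (by omega : j ≠ ℓ + 1)]
      rw [key]
      rcases Nat.lt_or_ge i (ℓ + 1) with hil | hil
      · rw [Function.update_of_ne (by omega : i ≠ ℓ + 1)]
        exact hval i h1i (by omega)
      · rw [le_antisymm hi hil, Function.update_self]
        exact hs₀val

/-! ## The normalised potential -/

/-- Xor by a fixed vector preserves Hamming distances.
[cite: HuangSellke2025, §3.3.2, Lemma 3.22 (the moat of the resampling chain)] -/
theorem moat_hammingDist_xor {n : ℕ} (v v' c : Fin n → Bool) :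
    hammingDist (fun i => Bool.xor (v i) (c i)) (fun i => Bool.xor (v' i) (c i)) =
      hammingDist v v' :=
  hammingDist_comp (fun i b => Bool.xor b (c i)) fun _ _ _ hab => Bool.xor_left_inj.1 hab

/-- Normalisation by rung `0` commutes with the insertion of a candidate: the normalised sequence of
`withRung R ℓ v` is `withRung` of the normalised prefix and the normalised candidate.
[cite: HuangSellke2025, §3.3.2, Lemma 3.22 (the moat of the resampling chain)] -/
theorem moat_norm_withRung {n : ℕ} (R : ℕ → Fin n → Bool) (ℓ : ℕ) (v : Fin n → Bool) :
    (fun j i => Bool.xor (withRung R ℓ v j i) (R 0 i)) =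
      withRung (fun j i => Bool.xor (R j i) (R 0 i)) ℓ (fun i => Bool.xor (v i) (R 0 i)) := by
  funext j i
  by_cases hj : j < ℓ
  · rw [withRung_of_lt R ℓ v hj, withRung_of_lt _ ℓ _ hj]
  · rw [withRung_of_le R ℓ v (Nat.not_lt.1 hj), withRung_of_le _ ℓ _ (Nat.not_lt.1 hj)]

/-- The normalised potential vanishes on a candidate repeating an earlier rung
(Bresler–Huang Fact 4.5(iii), via `condEnt_withRung_eq_zero_of_mem`).
[cite: HuangSellke2025, §3.3.2, Lemma 3.22 (the moat of the resampling chain)] -/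
theorem moat_pot_rep {n : ℕ} (R : ℕ → Fin n → Bool) (ℓ : ℕ) (v : Fin n → Bool)
    (hv : ∃ j < ℓ, R j = v) :
    condEnt (fun j i => Bool.xor (withRung R ℓ v j i) (R 0 i)) ℓ = 0 := by
  rw [moat_norm_withRung]
  obtain ⟨j₀, hj₀, rfl⟩ := hv
  exact condEnt_withRung_eq_zero_of_mem n ℓ _ _ ⟨j₀, hj₀, rfl⟩

/-- The normalised potential given the first `ℓ ≥ 1` rungs only reads those rungs.
[cite: HuangSellke2025, §3.3.2, Lemma 3.22 (the moat of the resampling chain)] -/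
theorem moat_pot_loc {n : ℕ} {R R' : ℕ → Fin n → Bool} {ℓ : ℕ} (hℓ : 1 ≤ ℓ)
    (hRR' : ∀ j < ℓ, R j = R' j) (v : Fin n → Bool) :
    condEnt (fun j i => Bool.xor (withRung R ℓ v j i) (R 0 i)) ℓ =
      condEnt (fun j i => Bool.xor (withRung R' ℓ v j i) (R' 0 i)) ℓ := by
  rw [moat_norm_withRung, moat_norm_withRung, hRR' 0 (by omega)]
  refine condEnt_withRung_congr (fun j hj => ?_) _
  funext i
  rw [hRR' j hj]

/-- The normalised potential is `h₂(Δ/n)`-continuous in the candidate for Hamming distance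
`Δ ≤ n/2` (Bresler–Huang Lemma 4.8 / Huang–Sellke Lemma 3.24, via
`abs_condEnt_withRung_sub_le_binEntropy` and `moat_hammingDist_xor`).
[cite: HuangSellke2025, §3.3.2, Lemma 3.22 (the moat of the resampling chain)] -/
theorem moat_pot_lip {n : ℕ} (R : ℕ → Fin n → Bool) (ℓ : ℕ) (v v' : Fin n → Bool)
    (hd : (hammingDist v v' : ℝ) ≤ n / 2) :
    |condEnt (fun j i => Bool.xor (withRung R ℓ v j i) (R 0 i)) ℓ -
        condEnt (fun j i => Bool.xor (withRung R ℓ v' j i) (R 0 i)) ℓ| ≤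
      Real.binEntropy ((hammingDist v v' : ℝ) / n) := by
  have key := abs_condEnt_withRung_sub_le_binEntropy n ℓ (fun j i => Bool.xor (R j i) (R 0 i))
    (fun i => Bool.xor (v i) (R 0 i)) (fun i => Bool.xor (v' i) (R 0 i))
  rw [moat_hammingDist_xor] at key
  rw [moat_norm_withRung, moat_norm_withRung]
  exact key hd

/-- On the rung itself the normalised potential is the conditional type entropy of the normalised
sequence (the form of the conclusion of `stub_moat`).
[cite: HuangSellke2025, §3.3.2, Lemma 3.22 (the moat of the resampling chain)] -/
theorem moat_pot_self {n : ℕ} (R : ℕ → Fin n → Bool) (ℓ : ℕ) :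
    condEnt (fun j i => Bool.xor (withRung R ℓ (R ℓ) j i) (R 0 i)) ℓ =
      condEnt (fun j i => Bool.xor (R j i) (R 0 i)) ℓ := by
  refine condEnt_congr fun j hj => ?_
  funext i
  rcases hj.lt_or_eq with h | rfl
  · rw [withRung_of_lt R ℓ _ h]
  · rw [withRung_self]

/-! ## The moat -/

/-- **The moat / ladder extraction along a chain** (Huang–Sellke 2025 Lemma 3.25 with the
continuity Lemma 3.24 = Bresler–Huang Prop. 4.6 / Lemma 4.8), over the DartGame toolkit of crux
`NoStableSection`; the Bresler–Huang conditional overlap entropy of a candidate `v` given rungs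
`R 0 … R (ℓ-1)` is `condEnt` of the rung-`0`-normalised sequence. Along outputs `x 0, x 1, …`
whose consecutive Hamming distances `Δ ≤ n/2` have `h₂(Δ/n) ≤ η` before the horizon `T`, if every
candidate at a time at least `W` after all earlier rung times has conditional overlap entropy
`> β` (chaos-freeness, for increasing rung times starting at `0`), and `k W ≤ T`, then there are
rung times `0 = ts 0 < ts 1 < ⋯ < ts k`, consecutive gaps `≤ W`, whose outputs have every
conditional overlap entropy in `[β − η, β]` (the forbidden OGP structure).
[cite: HuangSellke2025, §3.3.2, Lemma 3.22 (the moat of the resampling chain)] -/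
theorem stub_moat (n k W T : ℕ) (x : ℕ → (Fin n → Bool)) (β η : ℝ)
    (hW : 0 < W) (hη : 0 < η) (hηβ : η < β) (hT : k * W ≤ T)
    (hstab : ∀ t < T, (hammingDist (x t) (x (t + 1)) : ℝ) ≤ n / 2 ∧
      Real.binEntropy ((hammingDist (x t) (x (t + 1)) : ℝ) / n) ≤ η)
    (hchaos : ∀ (ℓ : ℕ) (ts : ℕ → ℕ) (t : ℕ), 1 ≤ ℓ → ℓ ≤ k → ts 0 = 0 →
      (∀ j, j + 1 < ℓ → ts j < ts (j + 1)) → (∀ j < ℓ, ts j + W ≤ t) → t ≤ T →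
      β < condEnt (fun j i => Bool.xor (withRung (fun j => x (ts j)) ℓ (x t) j i) (x (ts 0) i)) ℓ) :
    ∃ ts : ℕ → ℕ, ts 0 = 0 ∧ (∀ ℓ < k, ts ℓ < ts (ℓ + 1) ∧ ts (ℓ + 1) ≤ ts ℓ + W) ∧
      ∀ ℓ, 1 ≤ ℓ → ℓ ≤ k →
        condEnt (fun j i => Bool.xor (x (ts j) i) (x (ts 0) i)) ℓ ∈ Set.Icc (β - η) β := by
  -- the band `[β - η, β]` is nonempty and lies in `[0, ∞)`
  have hbm : 0 ≤ β - η := by linarith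
  have hδ : η ≤ β - (β - η) := by linarith
  obtain ⟨ts, h0, hgap, hval⟩ := moat_ladderExtraction (V := Fin n → Bool) (x := x)
    (h := fun R ℓ v => condEnt (fun j i => Bool.xor (withRung R ℓ v j i) (R 0 i)) ℓ)
    hW hbm hδ hT
    (fun R R' ℓ v hℓ hRR' => moat_pot_loc hℓ hRR' v)
    (fun R ℓ v hv => moat_pot_rep R ℓ v hv)
    (fun R ℓ t ht => by
      obtain ⟨h1, h2⟩ := hstab t ht
      rw [hammingDist_comm] at h1 h2
      exact (moat_pot_lip R ℓ (x (t + 1)) (x t) h1).trans h2)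
    (fun ℓ ts t h1 h2 h3 h4 h5 h6 => hchaos ℓ ts t h1 h2 h3 h4 h5 h6)
  refine ⟨ts, h0, hgap, fun ℓ h1 h2 => ?_⟩
  have key := hval ℓ h1 h2
  -- `hη` is implied by the one-step bounds whenever `T > 0`; it is not needed otherwise
  have _hη := hη
  simpa only [moat_pot_self] using key

end Literature.Computability.Complexity.HuangSellke2025Chain

end Part11

/-!
## Part 12 — port of `Summits/PneNP/PneNP/Theorems/OverlapGapAlgebraSearchHardWindowLowEntropyCount.lean` (2 declarations kept)

# Route OverlapGapAlgebra, crux `SearchHardWindow` (stmt-PneNP-2460), line `Sketch`: few candidates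
# of low conditional overlap entropy

Stub `stub_lowEntropyCount` of the skeleton
`Summits/PneNP/PneNP/Cruxes/SearchHardWindow/Lines/Sketch.lean` (section `Chaos`), the counting
input of the first moment behind the CHAOS lemma (Huang–Sellke 2025, arXiv:2501.06427, Lemma 3.23;
Bresler–Huang 2021, arXiv:2106.02129, §4.6, the count behind `S_indep`, method of types): for
`j ≥ 1` and any earlier rungs `prev 0, …, prev (j-1)`, the candidates `x` whose (unordered,
Bresler–Huang) conditional overlap entropy given the earlier rungs is `≤ β` number at most
`(n+1)^(2^j) · exp(n β)`.

Proof: the sequence `(prev 0, …, prev (j-1), x, x, …)` is `withRung prev j x`; by the bridge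
`mtr_overlapCondEnt_eq_condEnt` its conditional overlap entropy is the DartGame ordered conditional
type entropy `condEnt` of the rung-`0`-normalised sequence, and normalisation by the FIXED vector
`prev 0` (`j ≥ 1`) commutes with `withRung` (`moat_norm_withRung`). So the set to count is the
preimage, under the injection `x ↦ x ⊕ prev 0`, of the set counted by the DartGame theorem
`card_filter_condEnt_le` for the normalised prefix.
-/

section Part12

namespace Literature.Computability.Complexity.HuangSellke2025Chain

open _root_.Finset
open Literature.Computability.Complexity
open Literature.Computability.Complexity.HuangSellke2025Chain.DartGame (condEnt withRung withRung_of_lt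
  card_filter_condEnt_le)
open scoped _root_.Classical

/-- Pointwise: for `j ≥ 1`, the conditional overlap entropy of the candidate `x` given the rungs
`prev 0, …, prev (j-1)` is the DartGame conditional type entropy of the normalised candidate
`x ⊕ prev 0` given the normalised prefix `(prev ℓ ⊕ prev 0)_ℓ`.
[cite: HuangSellke2025, §3.3.2, Lemma 3.22 (low-entropy count)] -/
theorem lec_overlapCondEnt_eq (n j : ℕ) (hj : 1 ≤ j) (prev : ℕ → Fin n → Bool)
    (x : Fin n → Bool) :
    overlapCondEnt (fun ℓ => if ℓ < j then prev ℓ else x) j =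
      condEnt (withRung (fun ℓ i => Bool.xor (prev ℓ i) (prev 0 i)) j
        (fun i => Bool.xor (x i) (prev 0 i))) j := by
  have h1 : (fun ℓ => if ℓ < j then prev ℓ else x) = withRung prev j x := rfl
  rw [h1, mtr_overlapCondEnt_eq_condEnt, withRung_of_lt prev j x hj, moat_norm_withRung]

/-- **Few candidates of low conditional overlap entropy** (stub `stub_lowEntropyCount` of line
`Sketch`, section `Chaos`; Bresler–Huang 2021 §4.6, the count behind `S_indep`, = DartGame
`card_filter_condEnt_le` transported through the normalisation `x ↦ x ⊕ prev 0`): for `j ≥ 1` and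
any earlier rungs `prev 0, …, prev (j-1)`,
`#{x : H(x | prev 0 … prev (j-1)) ≤ β} ≤ (n+1)^{2^j} e^{nβ}`.
[cite: HuangSellke2025, §3.3.2, Lemma 3.22 (low-entropy count)] -/
theorem stub_lowEntropyCount (n j : ℕ) (hj : 1 ≤ j) (prev : ℕ → Fin n → Bool) (β : ℝ) :
    ((univ.filter fun x : Fin n → Bool =>
        overlapCondEnt (fun ℓ => if ℓ < j then prev ℓ else x) j ≤ β).card : ℝ)
      ≤ ((n : ℝ) + 1) ^ (2 ^ j) * Real.exp (n * β) := by
  -- the normalised prefix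
  set R' : ℕ → Fin n → Bool := fun ℓ i => Bool.xor (prev ℓ i) (prev 0 i) with hR'
  -- the set to count injects, by `x ↦ x ⊕ prev 0`, into the set counted by the DartGame theorem
  have hle : (univ.filter fun x : Fin n → Bool =>
        overlapCondEnt (fun ℓ => if ℓ < j then prev ℓ else x) j ≤ β).card ≤
      (univ.filter fun v : Fin n → Bool => condEnt (withRung R' j v) j ≤ β).card := by
    refine card_le_card_of_injOn (fun x i => Bool.xor (x i) (prev 0 i)) (fun x hx => ?_)
      (fun x _ y _ hxy => ?_)
    · rw [mem_coe, mem_filter] at hx ⊢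
      refine ⟨mem_univ _, ?_⟩
      rw [← lec_overlapCondEnt_eq n j hj prev x]
      exact hx.2
    · funext i
      exact Bool.xor_left_inj.1 (congrFun hxy i)
  calc ((univ.filter fun x : Fin n → Bool =>
          overlapCondEnt (fun ℓ => if ℓ < j then prev ℓ else x) j ≤ β).card : ℝ)
      ≤ ((univ.filter fun v : Fin n → Bool => condEnt (withRung R' j v) j ≤ β).card : ℝ) := by
        exact_mod_cast hle
    _ ≤ ((n : ℝ) + 1) ^ (2 ^ j) * Real.exp (n * β) := card_filter_condEnt_le n j R' β

end Literature.Computability.Complexity.HuangSellke2025Chain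

end Part12

/-!
## Part 13 — port of `Summits/PneNP/PneNP/Theorems/OverlapGapAlgebraSearchHardWindowBandCount.lean` (4 declarations kept)

# Route OverlapGapAlgebra, crux `SearchHardWindow` (stmt-PneNP-2460), line `Sketch`: few banded
# tuples

Stub `stub_bandCount` of the skeleton
`Summits/PneNP/PneNP/Cruxes/SearchHardWindow/Lines/Sketch.lean` (section `EnsembleOGP`), the
counting half of the first moment behind the ensemble OGP (Huang–Sellke 2025, arXiv:2501.06427,
Lemma 3.22; Bresler–Huang 2021, arXiv:2106.02129, §4.6 and Lemma 5.1, method of types): the tuples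
`Y 0, …, Y k : Fin n → Bool` all of whose (Bresler–Huang) conditional overlap entropies
`overlapCondEnt (seqOf Y) ℓ`, `1 ≤ ℓ ≤ k`, are `≤ β` number at most `2^n ((n+1)^{2^k} e^{nβ})^k`.

Proof: induction on `k`, peeling the LAST rung `Y ↦ (Fin.init Y, Y (Fin.last _))`, exactly as in
the DartGame count `card_filter_tuple_condEnt_le`
(`Summits/PneNP/PneNP/Theorems/OverlapGapAlgebraNoStableSectionCount.lean`), with the one-rung count
`stub_lowEntropyCount` (`≤ (n+1)^{2^j} e^{nβ}` candidates of conditional overlap entropy `≤ β` over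
any prefix of `j ≥ 1` rungs) in place of `card_filter_condEnt_le`. The only new ingredient is the
congruence `bct_overlapCondEnt_congr`: `overlapCondEnt Z ℓ` reads only the rungs `Z 0, …, Z ℓ` (it
is the DartGame `condEnt` of the rung-`0`-normalised sequence, `mtr_overlapCondEnt_eq_condEnt`, and
`condEnt_congr` applies), whence the band conditions at the rungs `ℓ ≤ k` of `Y` are those of
`Fin.init Y` (`bct_overlapCondEnt_seqOf_init`) and the condition at the last rung is that of the
last entry as a candidate over the truncated tuple (`bct_overlapCondEnt_seqOf_last`). Finally
`T(k) · (n+1)^{2^{k+1}} e^{nβ} ≤ 2^n ((n+1)^{2^{k+1}} e^{nβ})^{k+1}` by monotonicity in the exponent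
`2^k ≤ 2^{k+1}` (`n + 1 ≥ 1`).
-/

section Part13

namespace Literature.Computability.Complexity.HuangSellke2025Chain

open _root_.Finset
open Literature.Computability.Complexity
open Literature.Computability.Complexity.HuangSellke2025Chain.DartGame (seqOf seqOf_apply_lt condEnt
  condEnt_congr cnt_seqOf_init)
open scoped _root_.Classical

/-- `overlapCondEnt Z ℓ` only reads the rungs `Z 0, …, Z ℓ`.
[cite: HuangSellke2025, §3.3.2, Lemma 3.22 (the band count (binomial entropy))] -/
theorem bct_overlapCondEnt_congr {n : ℕ} {Z Z' : ℕ → Fin n → Bool} {ℓ : ℕ}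
    (h : ∀ j ≤ ℓ, Z j = Z' j) : overlapCondEnt Z ℓ = overlapCondEnt Z' ℓ := by
  rw [mtr_overlapCondEnt_eq_condEnt, mtr_overlapCondEnt_eq_condEnt]
  refine condEnt_congr fun j hj => ?_
  funext i
  rw [h j hj, h 0 (Nat.zero_le ℓ)]

/-- The conditional overlap entropies of the rungs below the last one are those of the truncated
tuple. [cite: HuangSellke2025, §3.3.2, Lemma 3.22 (the band count (binomial entropy))] -/
theorem bct_overlapCondEnt_seqOf_init {n L : ℕ} (Y : Fin (L + 1) → Fin n → Bool) {ℓ : ℕ}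
    (hℓ : ℓ < L) : overlapCondEnt (seqOf (Fin.init Y)) ℓ = overlapCondEnt (seqOf Y) ℓ :=
  bct_overlapCondEnt_congr fun _ hj => cnt_seqOf_init Y (by omega)

/-- The conditional overlap entropy of the last rung is that of the last entry as a candidate over
the truncated tuple (the prefix-and-candidate sequence in the `if`-form of `stub_lowEntropyCount`).
[cite: HuangSellke2025, §3.3.2, Lemma 3.22 (the band count (binomial entropy))] -/
theorem bct_overlapCondEnt_seqOf_last {n L : ℕ} (Y : Fin (L + 1) → Fin n → Bool) :
    overlapCondEnt (seqOf Y) L =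
      overlapCondEnt (fun ℓ => if ℓ < L then seqOf (Fin.init Y) ℓ else Y (Fin.last L)) L := by
  refine bct_overlapCondEnt_congr fun j hj => ?_
  show seqOf Y j = if j < L then seqOf (Fin.init Y) j else Y (Fin.last L)
  rcases Nat.lt_or_ge j L with h | h
  · rw [if_pos h, cnt_seqOf_init Y h]
  · have hjL : j = L := le_antisymm hj h
    subst hjL
    rw [if_neg (lt_irrefl j), seqOf_apply_lt Y (Nat.lt_succ_self j)]
    rfl

/-- **Few banded tuples** (stub `stub_bandCount` of line `Sketch`, section `EnsembleOGP`; method of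
types, Bresler–Huang 2021 §4.6 / Lemma 5.1 made exact): the tuples `Y 0, …, Y k : Fin n → Bool` all
of whose conditional overlap entropies at the rungs `1, …, k` are `≤ β` number at most
`2^n ((n+1)^{2^k} e^{nβ})^k` — by induction on `k`, peeling the last rung and applying
`stub_lowEntropyCount` over the truncated tuple.
[cite: HuangSellke2025, §3.3.2, Lemma 3.22 (the band count (binomial entropy))] -/
theorem stub_bandCount (n k : ℕ) (β : ℝ) (hβ : 0 ≤ β) :
    ((univ.filter fun Y : Fin (k + 1) → Fin n → Bool =>
        ∀ ℓ : ℕ, 1 ≤ ℓ → ℓ ≤ k → overlapCondEnt (seqOf Y) ℓ ≤ β).card : ℝ) ≤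
      (2 : ℝ) ^ n * (((n : ℝ) + 1) ^ (2 ^ k) * Real.exp (n * β)) ^ k := by
  have _ := hβ
  induction k with
  | zero =>
    -- the band condition is vacuous: all `2^n` one-entry tuples
    rw [pow_zero, mul_one]
    have h := card_le_univ (univ.filter fun Y : Fin (0 + 1) → Fin n → Bool =>
        ∀ ℓ : ℕ, 1 ≤ ℓ → ℓ ≤ 0 → overlapCondEnt (seqOf Y) ℓ ≤ β)
    rw [Fintype.card_fun, Fintype.card_fun, Fintype.card_bool, Fintype.card_fin,
      Fintype.card_fin, pow_one] at h
    exact_mod_cast h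
  | succ k ih =>
    set T' := univ.filter fun Y : Fin (k + 1 + 1) → Fin n → Bool =>
        ∀ ℓ : ℕ, 1 ≤ ℓ → ℓ ≤ k + 1 → overlapCondEnt (seqOf Y) ℓ ≤ β with hT'
    set T := univ.filter fun Y : Fin (k + 1) → Fin n → Bool =>
        ∀ ℓ : ℕ, 1 ≤ ℓ → ℓ ≤ k → overlapCondEnt (seqOf Y) ℓ ≤ β with hT
    -- (a) truncation maps banded tuples to banded tuples
    have hmaps : (T' : Set (Fin (k + 1 + 1) → Fin n → Bool)).MapsTo (fun Y => Fin.init Y) T := by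
      intro Y hY
      rw [mem_coe, hT', mem_filter] at hY
      rw [mem_coe, hT, mem_filter]
      refine ⟨mem_univ _, fun ℓ h1 hk => ?_⟩
      rw [bct_overlapCondEnt_seqOf_init Y (Nat.lt_succ_of_le hk)]
      exact hY.2 ℓ h1 (Nat.le_succ_of_le hk)
    -- (b) count fibrewise over the truncation
    have hsum : T'.card = ∑ Y' ∈ T, (T'.filter fun Y => Fin.init Y = Y').card :=
      card_eq_sum_card_fiberwise hmaps
    -- (c) a fibre injects (by the last entry) into the candidates of low conditional overlap
    -- entropy over the prefix, which `stub_lowEntropyCount` counts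
    have hfib : ∀ Y' ∈ T, ((T'.filter fun Y => Fin.init Y = Y').card : ℝ) ≤
        ((n : ℝ) + 1) ^ (2 ^ (k + 1)) * Real.exp (n * β) := by
      intro Y' _
      calc ((T'.filter fun Y => Fin.init Y = Y').card : ℝ)
          ≤ ((univ.filter fun x : Fin n → Bool =>
              overlapCondEnt (fun ℓ => if ℓ < k + 1 then seqOf Y' ℓ else x) (k + 1) ≤ β).card :
                ℝ) := by
            have h := card_le_card_of_injOn (s := T'.filter fun Y => Fin.init Y = Y')
              (t := univ.filter fun x : Fin n → Bool =>
                overlapCondEnt (fun ℓ => if ℓ < k + 1 then seqOf Y' ℓ else x) (k + 1) ≤ β)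
              (fun Y => Y (Fin.last (k + 1))) ?_ ?_
            · exact_mod_cast h
            · intro Y hY
              rw [mem_coe, mem_filter] at hY
              obtain ⟨hY, hYi⟩ := hY
              rw [hT', mem_filter] at hY
              rw [mem_coe, mem_filter]
              refine ⟨mem_univ _, ?_⟩
              have := hY.2 (k + 1) (Nat.le_add_left 1 k) le_rfl
              rw [bct_overlapCondEnt_seqOf_last Y, hYi] at this
              exact this
            · intro Y₁ h₁ Y₂ h₂ h
              rw [mem_coe, mem_filter] at h₁ h₂
              have h' : Y₁ (Fin.last (k + 1)) = Y₂ (Fin.last (k + 1)) := h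
              rw [← Fin.snoc_init_self Y₁, ← Fin.snoc_init_self Y₂, h₁.2, h₂.2, h']
        _ ≤ ((n : ℝ) + 1) ^ (2 ^ (k + 1)) * Real.exp (n * β) :=
            stub_lowEntropyCount n (k + 1) (Nat.le_add_left 1 k) (seqOf Y') β
    -- (d) assemble with the induction hypothesis
    have hmono : ((n : ℝ) + 1) ^ (2 ^ k) * Real.exp (n * β) ≤
        ((n : ℝ) + 1) ^ (2 ^ (k + 1)) * Real.exp (n * β) := by
      have h2k : 2 ^ k ≤ 2 ^ (k + 1) := Nat.pow_le_pow_right (by norm_num) (Nat.le_succ k)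
      have hn1 : (1 : ℝ) ≤ (n : ℝ) + 1 := by linarith [(Nat.cast_nonneg n : (0 : ℝ) ≤ n)]
      exact mul_le_mul_of_nonneg_right (pow_le_pow_right₀ hn1 h2k) (Real.exp_pos _).le
    calc (T'.card : ℝ) = ∑ Y' ∈ T, ((T'.filter fun Y => Fin.init Y = Y').card : ℝ) := by
          rw [hsum]
          push_cast
          rfl
      _ ≤ ∑ Y' ∈ T, ((n : ℝ) + 1) ^ (2 ^ (k + 1)) * Real.exp (n * β) := sum_le_sum hfib
      _ = T.card * (((n : ℝ) + 1) ^ (2 ^ (k + 1)) * Real.exp (n * β)) := by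
          rw [sum_const, nsmul_eq_mul]
      _ ≤ (2 : ℝ) ^ n * (((n : ℝ) + 1) ^ (2 ^ k) * Real.exp (n * β)) ^ k *
            (((n : ℝ) + 1) ^ (2 ^ (k + 1)) * Real.exp (n * β)) := by
          gcongr
      _ ≤ (2 : ℝ) ^ n * (((n : ℝ) + 1) ^ (2 ^ (k + 1)) * Real.exp (n * β)) ^ k *
            (((n : ℝ) + 1) ^ (2 ^ (k + 1)) * Real.exp (n * β)) := by
          gcongr
      _ = (2 : ℝ) ^ n * (((n : ℝ) + 1) ^ (2 ^ (k + 1)) * Real.exp (n * β)) ^ (k + 1) := by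
          ring

end Literature.Computability.Complexity.HuangSellke2025Chain

end Part13

/-!
## Part 14 — port of `Summits/PneNP/PneNP/Theorems/OverlapGapAlgebraSearchHardWindowOgpCore.lean` (3 declarations kept)

# Route OverlapGapAlgebra, crux `SearchHardWindow` (stmt-PneNP-2460), line `Sketch`: the ensemble-OGP
# first moment at one instance size (stub `stub_ogpCore`, lead c2)

Stub `stub_ogpCore` of the skeleton `Summits/PneNP/PneNP/Cruxes/SearchHardWindow/Lines/Sketch.lean`
(section `EnsembleOGP`, v12): the mirror, for Huang–Sellke 2025 Lemma 3.22 (ensemble OGP on the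
`ε`-resampling chain of literal arrays, arXiv:2501.06427 §3.3.2), of `cas_core` for Lemma 3.23.
At one instance size `n` (clause count `m`, chain length `K`), the mass of the OGP event — times
`t 0 ≤ ⋯ ≤ t k ≤ K` and assignments `x 0, …, x k`, `x ℓ` satisfying the instance at time `t ℓ`,
every conditional overlap entropy in the band `[β − η, β]` — is at most
`(K+1)^{k+1} · 2^n ((n+1)^{2^k} e^{nβ})^k · base^m`:
* reindex the event by the finitely many pairs (time tuple `Fin (k+1) → Fin (K+1)`, assignment
  tuple `Fin (k+1) → Fin n → Bool`) (`ogc_incl`; the band transfers to `seqOf Y` by the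
  congruence `bct_overlapCondEnt_congr`), and union-bound (`hMono`, `hUnion`);
* the event of one pair is empty unless its times are monotone and its tuple is in the band, and
  then its mass is `≤ base^m` by the per-tuple first moment `hTuple` (lower band, `b = β − η`)
  (`ogc_pair_bound`);
* sum: `(K+1)^{k+1}` time tuples and, by `hCount` (upper band), at most
  `2^n ((n+1)^{2^k} e^{nβ})^k` banded assignment tuples.
The four inputs `hMono`, `hUnion`, `hTuple`, `hCount` are hypotheses (discharged in the skeleton by
`stub_chainMassBasic`.1, `stub_chainMassUnion`, the lead's `ogp_tupleBound`, `stub_bandCount`).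
-/

section Part14

namespace Literature.Computability.Complexity.HuangSellke2025Chain

open _root_.Finset _root_.Filter
open Literature.Computability.Complexity
open Literature.Computability.Complexity.HuangSellke2025Chain.DartGame (seqOf seqOf_apply_lt)
open scoped _root_.Classical

/-! ## Reindexing -/

/-- **The OGP event of ONE pair** (time tuple `τ'`, assignment tuple `Y`): monotone times, the band for
`seqOf Y`, and every `Y ℓ` satisfying the instance at time `τ' ℓ`. A path carrying an OGP structure
carries the event of the pair (`τ' ℓ := t ℓ`, `Y ℓ := x ℓ`).
[cite: HuangSellke2025, §3.3.2, Lemma 3.22 (the OGP first moment at one n)] -/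
theorem ogc_incl (n m k K : ℕ) (β η : ℝ) (z : ℕ → (Fin m × Fin k → Fin n × Bool))
    (hz : ∃ (t : ℕ → ℕ) (x : ℕ → Fin n → Bool), (∀ ℓ < k, t ℓ ≤ t (ℓ + 1)) ∧ t k ≤ K ∧
        (∀ ℓ ≤ k, ∀ i : Fin m, ∃ j : Fin k, x ℓ (z (t ℓ) (i, j)).1 = (z (t ℓ) (i, j)).2) ∧
        ∀ ℓ, 1 ≤ ℓ → ℓ ≤ k → overlapCondEnt x ℓ ∈ Set.Icc (β - η) β) :
    ∃ τ' : Fin (k + 1) → Fin (K + 1), ∃ Y : Fin (k + 1) → Fin n → Bool,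
      Monotone τ' ∧
      (∀ ℓ : ℕ, 1 ≤ ℓ → ℓ ≤ k → overlapCondEnt (seqOf Y) ℓ ∈ Set.Icc (β - η) β) ∧
      ∀ i : Fin m, ∀ ℓ : Fin (k + 1), ∃ j : Fin k,
        Y ℓ (z (τ' ℓ : ℕ) (i, j)).1 = (z (τ' ℓ : ℕ) (i, j)).2 := by
  obtain ⟨t, x, hmono, htK, hsat, hband⟩ := hz
  have hpre : ∀ ℓ ≤ k, t ℓ ≤ t k := cas_mono_prefix t k hmono
  have hbd : ∀ ℓ : Fin (k + 1), t ℓ < K + 1 := fun ℓ =>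
    Nat.lt_succ_of_le ((hpre ℓ (Nat.le_of_lt_succ ℓ.isLt)).trans htK)
  refine ⟨fun ℓ => ⟨t ℓ, hbd ℓ⟩, fun ℓ => x ℓ, ?_, ?_, ?_⟩
  · -- monotone times
    intro ℓ₁ ℓ₂ hle
    show (⟨t ℓ₁, hbd ℓ₁⟩ : Fin (K + 1)) ≤ ⟨t ℓ₂, hbd ℓ₂⟩
    rw [Fin.mk_le_mk]
    have h2 : (ℓ₂ : ℕ) ≤ k := Nat.le_of_lt_succ ℓ₂.isLt
    exact cas_mono_prefix t ℓ₂ (fun ℓ' hℓ' => hmono ℓ' (lt_of_lt_of_le hℓ' h2)) ℓ₁ hle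
  · -- the band transfers to `seqOf Y` (congruence at indices `≤ ℓ ≤ k`)
    intro ℓ h1 hℓk
    have hce : overlapCondEnt (seqOf fun ℓ' : Fin (k + 1) => x ℓ') ℓ = overlapCondEnt x ℓ :=
      bct_overlapCondEnt_congr fun j hj => by
        rw [seqOf_apply_lt _ (show j < k + 1 by omega)]
    rw [hce]
    exact hband ℓ h1 hℓk
  · -- satisfaction at every rung
    intro i ℓ
    exact hsat ℓ (Nat.le_of_lt_succ ℓ.isLt) i

/-! ## The bound for one pair, and the sum over pairs -/

/-- **Mass of the event of one pair** `≤ [upper band] · base^m`: empty unless the times are monotone and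
the tuple is in the band; then drop the side conditions (`hMono`) and apply the per-tuple first moment
`hTuple` with the lower band (`b = β − η`).
[cite: HuangSellke2025, §3.3.2, Lemma 3.22 (the OGP first moment at one n)] -/
theorem ogc_pair_bound
    (hMono : ∀ {ι Γ : Type} [Fintype ι] [DecidableEq ι] [Fintype Γ] [DecidableEq Γ] [Nonempty Γ]
      (ε : ℝ), 0 ≤ ε → ε ≤ 1 → ∀ (K : ℕ) (E E' : (ℕ → ι → Γ) → Prop), (∀ z, E z → E' z) →
      resampleChainMass ε K E ≤ resampleChainMass ε K E')
    (hTuple : ∀ (n m k s F : ℕ), 1 ≤ n → s + F ≤ k → ∀ (θ b : ℝ), 0 < θ → θ < 1 → 2 * θ ≤ b →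
      ∀ (ε : ℝ), 0 ≤ ε → ε ≤ 1 → ∀ (K : ℕ) (τ : Fin (k + 1) → ℕ), Monotone τ → τ (Fin.last k) ≤ K →
      ∀ (Y : Fin (k + 1) → Fin n → Bool),
      (∀ ℓ : ℕ, 1 ≤ ℓ → ℓ ≤ k → b ≤ overlapCondEnt (seqOf Y) ℓ) →
      resampleChainMass ε K (fun z : ℕ → (Fin m × Fin k → Fin n × Bool) =>
        ∀ i : Fin m, ∀ ℓ : Fin (k + 1), ∃ j : Fin k, Y ℓ (z (τ ℓ) (i, j)).1 = (z (τ ℓ) (i, j)).2) ≤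
      (1 - (1 / 2 : ℝ) ^ k * (((1 : ℝ) + k * (1 - (2 * (1 - (b - 2 * θ) / (-Real.log θ)) ^ s + s * ((b - 2 * θ) / (-Real.log θ)) * (1 - (b - 2 * θ) / (-Real.log θ)) ^ (s - 1))) - θ * ((k : ℝ) * (k + 1) / 2)) - (k : ℝ) * (k + 1) / 2 * (1 / 2 : ℝ) ^ F)) ^ m)
    (n m k K s F : ℕ) (hn : 1 ≤ n) (hsF : s + F ≤ k) (ε : ℝ) (hε0 : 0 ≤ ε) (hε1 : ε ≤ 1)
    (β η θ : ℝ) (hθ : 0 < θ) (hθ1 : θ < 1) (hb : 2 * θ ≤ β - η)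
    (hbase : 0 ≤ (1 - (1 / 2 : ℝ) ^ k * (((1 : ℝ) + k * (1 - (2 * (1 - (β - η - 2 * θ) / (-Real.log θ)) ^ s + s * ((β - η - 2 * θ) / (-Real.log θ)) * (1 - (β - η - 2 * θ) / (-Real.log θ)) ^ (s - 1))) - θ * ((k : ℝ) * (k + 1) / 2)) - (k : ℝ) * (k + 1) / 2 * (1 / 2 : ℝ) ^ F)))
    (τ' : Fin (k + 1) → Fin (K + 1)) (Y : Fin (k + 1) → Fin n → Bool) :
    resampleChainMass ε K (fun z : ℕ → (Fin m × Fin k → Fin n × Bool) =>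
        Monotone τ' ∧
        (∀ ℓ : ℕ, 1 ≤ ℓ → ℓ ≤ k → overlapCondEnt (seqOf Y) ℓ ∈ Set.Icc (β - η) β) ∧
        ∀ i : Fin m, ∀ ℓ : Fin (k + 1), ∃ j : Fin k,
          Y ℓ (z (τ' ℓ : ℕ) (i, j)).1 = (z (τ' ℓ : ℕ) (i, j)).2) ≤
      (if (∀ ℓ : ℕ, 1 ≤ ℓ → ℓ ≤ k → overlapCondEnt (seqOf Y) ℓ ≤ β) then (1 : ℝ) else 0) *
        (1 - (1 / 2 : ℝ) ^ k * (((1 : ℝ) + k * (1 - (2 * (1 - (β - η - 2 * θ) / (-Real.log θ)) ^ s + s * ((β - η - 2 * θ) / (-Real.log θ)) * (1 - (β - η - 2 * θ) / (-Real.log θ)) ^ (s - 1))) - θ * ((k : ℝ) * (k + 1) / 2)) - (k : ℝ) * (k + 1) / 2 * (1 / 2 : ℝ) ^ F)) ^ m := by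
  haveI : Nonempty (Fin n × Bool) := ⟨(⟨0, hn⟩, true)⟩
  have hBm : 0 ≤ (1 - (1 / 2 : ℝ) ^ k * (((1 : ℝ) + k * (1 - (2 * (1 - (β - η - 2 * θ) / (-Real.log θ)) ^ s + s * ((β - η - 2 * θ) / (-Real.log θ)) * (1 - (β - η - 2 * θ) / (-Real.log θ)) ^ (s - 1))) - θ * ((k : ℝ) * (k + 1) / 2)) - (k : ℝ) * (k + 1) / 2 * (1 / 2 : ℝ) ^ F)) ^ m := pow_nonneg hbase m
  by_cases hside : Monotone τ' ∧
      ∀ ℓ : ℕ, 1 ≤ ℓ → ℓ ≤ k → overlapCondEnt (seqOf Y) ℓ ∈ Set.Icc (β - η) β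
  · obtain ⟨hmn, hband⟩ := hside
    have hup : ∀ ℓ : ℕ, 1 ≤ ℓ → ℓ ≤ k → overlapCondEnt (seqOf Y) ℓ ≤ β :=
      fun ℓ h1 h2 => (hband ℓ h1 h2).2
    rw [if_pos hup, one_mul]
    have hτmono : Monotone fun ℓ : Fin (k + 1) => (τ' ℓ : ℕ) :=
      fun a b hab => by exact_mod_cast hmn hab
    have hτK : ((fun ℓ : Fin (k + 1) => (τ' ℓ : ℕ)) (Fin.last k)) ≤ K :=
      Nat.le_of_lt_succ (τ' (Fin.last k)).isLt
    have h1 := hTuple n m k s F hn hsF θ (β - η) hθ hθ1 hb ε hε0 hε1 K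
      (fun ℓ => (τ' ℓ : ℕ)) hτmono hτK Y (fun ℓ h1 h2 => (hband ℓ h1 h2).1)
    refine le_trans (hMono ε hε0 hε1 K _ _ fun z hz => ?_) h1
    exact hz.2.2
  · -- the side conditions fail: the event is empty
    refine le_trans (hMono ε hε0 hε1 K _
      (fun _ : ℕ → (Fin m × Fin k → Fin n × Bool) => False) fun z hz => ?_) ?_
    · exact hside ⟨hz.1, hz.2.1⟩
    · rw [cas_mass_false]
      positivity

/-- **The OGP first moment at one instance size** (stub `stub_ogpCore` of line `Sketch`, section
`EnsembleOGP`): `mass(OGP) ≤ (K+1)^{k+1} · 2^n ((n+1)^{2^k} e^{nβ})^k · base^m` — reindex by the pairs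
(`ogc_incl`, `hMono`), union bound (`hUnion`), bound each pair (`ogc_pair_bound` with `hTuple`), count
the time tuples and, with `hCount`, the banded assignment tuples.
[cite: HuangSellke2025, §3.3.2, Lemma 3.22 (the OGP first moment at one n)] -/
theorem stub_ogpCore
    (hMono : ∀ {ι Γ : Type} [Fintype ι] [DecidableEq ι] [Fintype Γ] [DecidableEq Γ] [Nonempty Γ]
      (ε : ℝ), 0 ≤ ε → ε ≤ 1 → ∀ (K : ℕ) (E E' : (ℕ → ι → Γ) → Prop), (∀ z, E z → E' z) →
      resampleChainMass ε K E ≤ resampleChainMass ε K E')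
    (hUnion : ∀ {ι Γ X : Type} [Fintype ι] [DecidableEq ι] [Fintype Γ] [DecidableEq Γ] [Nonempty Γ]
      [Fintype X] (ε : ℝ), 0 ≤ ε → ε ≤ 1 → ∀ (K : ℕ) (E : X → (ℕ → ι → Γ) → Prop),
      resampleChainMass ε K (fun z => ∃ x, E x z) ≤ ∑ x, resampleChainMass ε K (E x))
    (hTuple : ∀ (n m k s F : ℕ), 1 ≤ n → s + F ≤ k → ∀ (θ b : ℝ), 0 < θ → θ < 1 → 2 * θ ≤ b →
      ∀ (ε : ℝ), 0 ≤ ε → ε ≤ 1 → ∀ (K : ℕ) (τ : Fin (k + 1) → ℕ), Monotone τ → τ (Fin.last k) ≤ K →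
      ∀ (Y : Fin (k + 1) → Fin n → Bool),
      (∀ ℓ : ℕ, 1 ≤ ℓ → ℓ ≤ k → b ≤ overlapCondEnt (seqOf Y) ℓ) →
      resampleChainMass ε K (fun z : ℕ → (Fin m × Fin k → Fin n × Bool) =>
        ∀ i : Fin m, ∀ ℓ : Fin (k + 1), ∃ j : Fin k, Y ℓ (z (τ ℓ) (i, j)).1 = (z (τ ℓ) (i, j)).2) ≤
      (1 - (1 / 2 : ℝ) ^ k * (((1 : ℝ) + k * (1 - (2 * (1 - (b - 2 * θ) / (-Real.log θ)) ^ s + s * ((b - 2 * θ) / (-Real.log θ)) * (1 - (b - 2 * θ) / (-Real.log θ)) ^ (s - 1))) - θ * ((k : ℝ) * (k + 1) / 2)) - (k : ℝ) * (k + 1) / 2 * (1 / 2 : ℝ) ^ F)) ^ m)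
    (hCount : ∀ (n k : ℕ) (β : ℝ), 0 ≤ β →
      ((univ.filter fun Y : Fin (k + 1) → Fin n → Bool =>
          ∀ ℓ : ℕ, 1 ≤ ℓ → ℓ ≤ k → overlapCondEnt (seqOf Y) ℓ ≤ β).card : ℝ) ≤
        (2 : ℝ) ^ n * (((n : ℝ) + 1) ^ (2 ^ k) * Real.exp (n * β)) ^ k)
    (n m k K s F : ℕ) (hn : 1 ≤ n) (hk : 1 ≤ k) (hsF : s + F ≤ k) (ε : ℝ) (hε0 : 0 ≤ ε) (hε1 : ε ≤ 1)
    (β η θ : ℝ) (hβ : 0 ≤ β) (hθ : 0 < θ) (hθ1 : θ < 1) (hb : 2 * θ ≤ β - η)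
    (hbase : 0 ≤ (1 - (1 / 2 : ℝ) ^ k * (((1 : ℝ) + k * (1 - (2 * (1 - (β - η - 2 * θ) / (-Real.log θ)) ^ s + s * ((β - η - 2 * θ) / (-Real.log θ)) * (1 - (β - η - 2 * θ) / (-Real.log θ)) ^ (s - 1))) - θ * ((k : ℝ) * (k + 1) / 2)) - (k : ℝ) * (k + 1) / 2 * (1 / 2 : ℝ) ^ F))) :
    resampleChainMass ε K (fun y : ℕ → (Fin m × Fin k → Fin n × Bool) =>
        ∃ (t : ℕ → ℕ) (x : ℕ → Fin n → Bool), (∀ ℓ < k, t ℓ ≤ t (ℓ + 1)) ∧ t k ≤ K ∧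
          (∀ ℓ ≤ k, ∀ i : Fin m, ∃ j : Fin k, x ℓ (y (t ℓ) (i, j)).1 = (y (t ℓ) (i, j)).2) ∧
          ∀ ℓ, 1 ≤ ℓ → ℓ ≤ k → overlapCondEnt x ℓ ∈ Set.Icc (β - η) β) ≤
      ((K : ℝ) + 1) ^ (k + 1) * ((2 : ℝ) ^ n * (((n : ℝ) + 1) ^ (2 ^ k) * Real.exp (n * β)) ^ k) *
          (1 - (1 / 2 : ℝ) ^ k * (((1 : ℝ) + k * (1 - (2 * (1 - (β - η - 2 * θ) / (-Real.log θ)) ^ s + s * ((β - η - 2 * θ) / (-Real.log θ)) * (1 - (β - η - 2 * θ) / (-Real.log θ)) ^ (s - 1))) - θ * ((k : ℝ) * (k + 1) / 2)) - (k : ℝ) * (k + 1) / 2 * (1 / 2 : ℝ) ^ F)) ^ m := by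
  haveI : Nonempty (Fin n × Bool) := ⟨(⟨0, hn⟩, true)⟩
  have _hk := hk
  have hBm : 0 ≤ (1 - (1 / 2 : ℝ) ^ k * (((1 : ℝ) + k * (1 - (2 * (1 - (β - η - 2 * θ) / (-Real.log θ)) ^ s + s * ((β - η - 2 * θ) / (-Real.log θ)) * (1 - (β - η - 2 * θ) / (-Real.log θ)) ^ (s - 1))) - θ * ((k : ℝ) * (k + 1) / 2)) - (k : ℝ) * (k + 1) / 2 * (1 / 2 : ℝ) ^ F)) ^ m := pow_nonneg hbase m
  -- reindex by (time tuple, assignment tuple) and union-bound twice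
  have h1 := hMono ε hε0 hε1 K _ _ fun z hz => ogc_incl n m k K β η z hz
  have h2 := hUnion (X := Fin (k + 1) → Fin (K + 1)) ε hε0 hε1 K
    (fun τ' (z : ℕ → (Fin m × Fin k → Fin n × Bool)) => ∃ Y : Fin (k + 1) → Fin n → Bool,
      Monotone τ' ∧
      (∀ ℓ : ℕ, 1 ≤ ℓ → ℓ ≤ k → overlapCondEnt (seqOf Y) ℓ ∈ Set.Icc (β - η) β) ∧
      ∀ i : Fin m, ∀ ℓ : Fin (k + 1), ∃ j : Fin k,
        Y ℓ (z (τ' ℓ : ℕ) (i, j)).1 = (z (τ' ℓ : ℕ) (i, j)).2)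
  have h3 : ∀ τ' : Fin (k + 1) → Fin (K + 1),
      resampleChainMass ε K (fun z : ℕ → (Fin m × Fin k → Fin n × Bool) =>
        ∃ Y : Fin (k + 1) → Fin n → Bool, Monotone τ' ∧
          (∀ ℓ : ℕ, 1 ≤ ℓ → ℓ ≤ k → overlapCondEnt (seqOf Y) ℓ ∈ Set.Icc (β - η) β) ∧
          ∀ i : Fin m, ∀ ℓ : Fin (k + 1), ∃ j : Fin k,
            Y ℓ (z (τ' ℓ : ℕ) (i, j)).1 = (z (τ' ℓ : ℕ) (i, j)).2) ≤
      ∑ Y : Fin (k + 1) → Fin n → Bool,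
        (if (∀ ℓ : ℕ, 1 ≤ ℓ → ℓ ≤ k → overlapCondEnt (seqOf Y) ℓ ≤ β) then (1 : ℝ) else 0) *
          (1 - (1 / 2 : ℝ) ^ k * (((1 : ℝ) + k * (1 - (2 * (1 - (β - η - 2 * θ) / (-Real.log θ)) ^ s + s * ((β - η - 2 * θ) / (-Real.log θ)) * (1 - (β - η - 2 * θ) / (-Real.log θ)) ^ (s - 1))) - θ * ((k : ℝ) * (k + 1) / 2)) - (k : ℝ) * (k + 1) / 2 * (1 / 2 : ℝ) ^ F)) ^ m :=
    fun τ' => (hUnion (X := Fin (k + 1) → Fin n → Bool) ε hε0 hε1 K _).trans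
      (Finset.sum_le_sum fun Y _ =>
        ogc_pair_bound hMono hTuple n m k K s F hn hsF ε hε0 hε1 β η θ hθ hθ1 hb hbase τ' Y)
  refine h1.trans (h2.trans ((Finset.sum_le_sum fun τ' _ => h3 τ').trans ?_))
  -- count: `(K+1)^(k+1)` time tuples, `hCount` banded assignment tuples
  rw [Finset.sum_const, Finset.card_univ, nsmul_eq_mul, ← Finset.sum_mul, Finset.sum_boole]
  have hcardT : (Fintype.card (Fin (k + 1) → Fin (K + 1)) : ℝ) = ((K : ℝ) + 1) ^ (k + 1) := by
    rw [Fintype.card_fun, Fintype.card_fin, Fintype.card_fin]; push_cast; ring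
  rw [hcardT]
  have hC := hCount n k β hβ
  have hT : (0 : ℝ) ≤ ((K : ℝ) + 1) ^ (k + 1) := by positivity
  calc ((K : ℝ) + 1) ^ (k + 1) *
        (((univ.filter fun Y : Fin (k + 1) → Fin n → Bool =>
            ∀ ℓ : ℕ, 1 ≤ ℓ → ℓ ≤ k → overlapCondEnt (seqOf Y) ℓ ≤ β).card : ℝ) *
          (1 - (1 / 2 : ℝ) ^ k * (((1 : ℝ) + k * (1 - (2 * (1 - (β - η - 2 * θ) / (-Real.log θ)) ^ s + s * ((β - η - 2 * θ) / (-Real.log θ)) * (1 - (β - η - 2 * θ) / (-Real.log θ)) ^ (s - 1))) - θ * ((k : ℝ) * (k + 1) / 2)) - (k : ℝ) * (k + 1) / 2 * (1 / 2 : ℝ) ^ F)) ^ m)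
      ≤ ((K : ℝ) + 1) ^ (k + 1) *
        (((2 : ℝ) ^ n * (((n : ℝ) + 1) ^ (2 ^ k) * Real.exp (n * β)) ^ k) *
          (1 - (1 / 2 : ℝ) ^ k * (((1 : ℝ) + k * (1 - (2 * (1 - (β - η - 2 * θ) / (-Real.log θ)) ^ s + s * ((β - η - 2 * θ) / (-Real.log θ)) * (1 - (β - η - 2 * θ) / (-Real.log θ)) ^ (s - 1))) - θ * ((k : ℝ) * (k + 1) / 2)) - (k : ℝ) * (k + 1) / 2 * (1 / 2 : ℝ) ^ F)) ^ m) :=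
        mul_le_mul_of_nonneg_left (mul_le_mul_of_nonneg_right hC hBm) hT
    _ = _ := by ring

end Literature.Computability.Complexity.HuangSellke2025Chain

end Part14

/-!
## Part 15 — port of `Summits/PneNP/PneNP/Theorems/OverlapGapAlgebraNoStableSectionGlue2.lean` (1 declarations kept)

# Crux `NoStableSection` (stmt-PneNP-2462), line `DartGame` — glue 2: fixed `k`, `n → ∞`

For a fixed `k` and parameters satisfying the `k`-dependent inequalities (hypotheses), the
crux's count is `≤ e^{-(L/2) n} · #paths` for all large `n` (polynomial prefactors absorbed by
`isLittleO_pow_exp_pos_mul_atTop`; binomial sums by van Lint's bound; `m = ⌊α n⌋₊`).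
Registered sub-goal `stub_gluePolyExp`. Lead prover-line-stmt-PneNP-2462-0.
-/

section Part15

namespace Literature.Computability.Complexity.HuangSellke2025Chain.DartGame

open _root_.Finset _root_.Real

/-! ## Glue, part 3a: fixed `k`, `n → ∞` -/

section FixedK

open _root_.Finset _root_.Filter _root_.Real
open scoped _root_.Classical _root_.Topology

variable {k m n : ℕ}

/-- `(1 - x)^N ≤ e^{-xN}` for `0 ≤ x ≤ 1`.
[cite: HuangSellke2025, §3.3.2, proof of Lemma 3.22 (moat / small-ball / entropy ladder of the resampling chain: glue)] -/
theorem glue_one_sub_pow_le {x : ℝ} (_hx0 : 0 ≤ x) (hx1 : x ≤ 1) (N : ℕ) :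
    (1 - x) ^ N ≤ Real.exp (-(x * N)) := by
  have h : 1 - x ≤ Real.exp (-x) := by linarith [Real.add_one_le_exp (-x)]
  calc (1 - x) ^ N ≤ (Real.exp (-x)) ^ N := pow_le_pow_left₀ (by linarith) h N
    _ = Real.exp (-(x * N)) := by rw [← Real.exp_nat_mul]; ring_nf

end FixedK

/-! ## Registered sub-goal of this file -/

end Literature.Computability.Complexity.HuangSellke2025Chain.DartGame

end Part15

/-!
## Part 16 — port of `Summits/PneNP/PneNP/Theorems/OverlapGapAlgebraNoStableSectionGlue3.lean` (2 declarations kept)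

# Crux `NoStableSection` (stmt-PneNP-2462), line `DartGame` — glue 3: `k`-asymptotics, the crux
`KACond k` holds for every large `k` (window `[2.6, 2.7]·log k/k`, `η = 1/k²`, `ν = 4^{-k}`,
`θ = 1/(k log² k)`: small ball `≤ 0.39`, slack terms vanish); the six stubs imply
`Summit.PneNP.PneNP.Theses.OverlapGapAlgebra.NoStableSection` BY NAME (`glue_noStableSection`,
`stub_glue : Glue`). Lead prover-line-stmt-PneNP-2462-0. 
-/

section Part16

namespace Literature.Computability.Complexity.HuangSellke2025Chain.DartGame

open _root_.Finset _root_.Real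

section KAsymptotics

open _root_.Filter _root_.Real _root_.Finset
open scoped _root_.Topology

/-- `log k ≥ 7` for `k ≥ 1200`.
[cite: HuangSellke2025, §3.3.2, proof of Lemma 3.22 (moat / small-ball / entropy ladder of the resampling chain: glue)] -/
theorem glue_log_ge_seven {k : ℕ} (hk : 1200 ≤ k) : (7 : ℝ) ≤ Real.log k := by
  have hk' : (1200 : ℝ) ≤ k := by exact_mod_cast hk
  have he : Real.exp 7 ≤ 1200 := by
    have h1 : Real.exp 1 < 2.7182818286 := Real.exp_one_lt_d9
    have h7 : Real.exp 7 = (Real.exp 1) ^ 7 := by rw [← Real.exp_nat_mul]; norm_num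
    rw [h7]
    calc (Real.exp 1) ^ 7 ≤ (2.7182818286 : ℝ) ^ 7 :=
          pow_le_pow_left₀ (Real.exp_nonneg 1) h1.le 7
      _ ≤ 1200 := by norm_num
  rw [Real.le_log_iff_exp_le (by linarith)]
  exact he.trans hk'

/-- The window parameter `s = k p₀ ∈ [2.5, 2.6]`.
[cite: HuangSellke2025, §3.3.2, proof of Lemma 3.22 (moat / small-ball / entropy ladder of the resampling chain: glue)] -/
theorem glue_KA_s {lg : ℝ} (hlg7 : 7 ≤ lg) (hL3 : 5 * Real.log lg ≤ 0.05 * lg) :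
    2.5 ≤ (2.6 * lg - 2 * (1 / lg ^ 2)) / (lg + 2 * Real.log lg) ∧
    (2.6 * lg - 2 * (1 / lg ^ 2)) / (lg + 2 * Real.log lg) ≤ 2.6 := by
  have hloglg : 0 ≤ Real.log lg := Real.log_nonneg (by linarith)
  have htpos : 0 < lg + 2 * Real.log lg := by linarith
  have hlg2 : (49 : ℝ) ≤ lg ^ 2 := by nlinarith
  have hθK : 1 / lg ^ 2 ≤ 1 / 49 := div_le_div_of_nonneg_left zero_le_one (by norm_num) hlg2
  have hθ0 : 0 ≤ 1 / lg ^ 2 := by positivity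
  constructor
  · rw [le_div_iff₀ htpos]; nlinarith
  · rw [div_le_iff₀ htpos]; nlinarith

end KAsymptotics
section Assembly

open _root_.Filter _root_.Real _root_.Finset
open scoped _root_.Classical _root_.Topology

end Assembly

end Literature.Computability.Complexity.HuangSellke2025Chain.DartGame

end Part16

/-!
## Part 17 — port of `Summits/PneNP/PneNP/Theorems/OverlapGapAlgebraSearchHardWindowChaosAsymptotics.lean` (2 declarations kept)

# Route OverlapGapAlgebra, crux `SearchHardWindow` (stmt-PneNP-2460), line `Sketch`: the
# exponent asymptotics of the chaos lemma (Huang–Sellke 2025, Lemma 3.23)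

Stub `stub_chaosAsymptotics` of the skeleton
`Summits/PneNP/PneNP/Cruxes/SearchHardWindow/Lines/Sketch.lean` (section `CHAOS`): the pure
real-analysis half of the chaos lemma for random `k`-SAT. The first moment bounds the mass of the
chaos event by `(k+1) (K+1)^{k+1} (n+1)^{2^k} e^{nβ} (1 - (E/2)^k)^m` with `m = ⌊α n⌋`,
`α = 5 · 2^k log k / k`, chain length `K ≤ n^A` and resampling rate `E ≥ 1 - e^{-1/(bk)}`.

Write `L := 5 log k / k > 0` (as `k ≥ 2`), `r := max (β / L) 0 ∈ [0, 1)` (as `β < L`),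
`δ := (1 - r) / (2k) ∈ (0, 1)` and `b₁ := 1 / (k · (-log δ)) > 0`. For `0 < b ≤ b₁` one has
`e^{-1/(bk)} ≤ δ`, so every admissible `E` satisfies `1 - δ ≤ E ≤ 1`, whence by Bernoulli
`E^k ≥ 1 + k (E - 1) ≥ 1 - k δ = (1 + r)/2`. Since `α (E/2)^k = L E^k ≥ L (1 + r)/2` and
`m ≥ α n - 1`, `(1 - (E/2)^k)^m ≤ exp (-(E/2)^k m) ≤ e · exp (-(L (1+r)/2) n)`, and the gap
`g := L (1 + r)/2 - β ≥ L (1 - r)/2 > 0`. The remaining factor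
`(k+1) (K+1)^{k+1} (n+1)^{2^k} e ≤ (k+1) 2^{k+1} e (n+1)^{A(k+1) + 2^k}` is a polynomial in `n`,
eventually `≤ exp ((g/2) n)` (`isLittleO_pow_exp_pos_mul_atTop`), giving the bound
`exp (-(g/2) n)`, i.e. `c := g / 2`.
-/

section Part17

namespace Literature.Computability.Complexity.HuangSellke2025Chain

open _root_.Finset _root_.Filter _root_.Asymptotics _root_.Topology

/-- A polynomial in `n` is eventually dominated by any growing exponential:
`C (n+1)^N ≤ exp (a n)` for all large `n : ℕ`, whenever `0 < a`.
[cite: HuangSellke2025, §3.3.2, Lemma 3.22 (chaos-leg asymptotics)] -/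
theorem cha_poly_le_exp (C : ℝ) (N : ℕ) {a : ℝ} (ha : 0 < a) :
    ∀ᶠ n : ℕ in atTop, C * ((n : ℝ) + 1) ^ N ≤ Real.exp (a * n) := by
  have hlo := (isLittleO_pow_exp_pos_mul_atTop N ha).comp_tendsto
    (tendsto_atTop_add_const_right _ _ tendsto_natCast_atTop_atTop :
      Tendsto (fun n : ℕ => (n : ℝ) + 1) atTop atTop)
  have hD : 0 < (|C| + 1) * Real.exp a := by positivity
  filter_upwards [hlo.bound (inv_pos.2 hD)] with n hn
  have h0 : (0 : ℝ) ≤ (n : ℝ) + 1 := by positivity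
  simp only [Function.comp_def, Real.norm_eq_abs, abs_pow, abs_of_nonneg h0, abs_mul,
    Real.abs_exp, mul_add, mul_one, Real.exp_add] at hn
  calc C * ((n : ℝ) + 1) ^ N ≤ (|C| + 1) * ((n : ℝ) + 1) ^ N := by
        gcongr
        exact (le_abs_self C).trans (le_add_of_nonneg_right zero_le_one)
    _ ≤ (|C| + 1) * (((|C| + 1) * Real.exp a)⁻¹ * (Real.exp (a * n) * Real.exp a)) := by gcongr
    _ = Real.exp (a * n) * (((|C| + 1) * Real.exp a) * ((|C| + 1) * Real.exp a)⁻¹) := by ring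
    _ = Real.exp (a * n) := by rw [mul_inv_cancel₀ hD.ne', mul_one]

/-- **The exponent asymptotics of the chaos lemma** (Huang–Sellke 2025, arXiv:2501.06427,
Lemma 3.23; real analysis only): for `k ≥ 2` and `β < 5 log k / k` there is `b₁ > 0` such that
for every `0 < b ≤ b₁` and every polynomial degree `A` there is `c > 0` with, eventually in
`n`, for all `K ≤ n^A` and all resampling rates `E ∈ [1 − e^{−1/(bk)}, 1]`:
`(k+1)(K+1)^{k+1} (n+1)^{2^k} e^{nβ} (1 − (E/2)^k)^{⌊α_k n⌋} ≤ e^{−cn}`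
(`α_k (E/2)^k = 5 E^k log k / k > β` once `(1 − e^{−1/(b₁ k)})^k · 5 log k/k > β`).
[cite: HuangSellke2025, §3.3.2, Lemma 3.22 (chaos-leg asymptotics)] -/
theorem stub_chaosAsymptotics (k : ℕ) (hk : 2 ≤ k) (β : ℝ) (hβ : β < 5 * Real.log k / k) :
    ∃ b₁ : ℝ, 0 < b₁ ∧ ∀ b : ℝ, 0 < b → b ≤ b₁ → ∀ A : ℕ, ∃ c : ℝ, 0 < c ∧
      ∀ᶠ n : ℕ in atTop, ∀ K : ℕ, K ≤ n ^ A → ∀ E : ℝ, 1 - Real.exp (-(1 / (b * k))) ≤ E → E ≤ 1 →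
        ((k : ℝ) + 1) * ((K : ℝ) + 1) ^ (k + 1) *
            ((((n : ℝ) + 1) ^ (2 ^ k)) * Real.exp (n * β)) *
            (1 - (E / 2) ^ k) ^ ⌊5 * 2 ^ k * Real.log k / k * n⌋₊
          ≤ Real.exp (-(c * n)) := by
  -- the constants `L = 5 log k / k`, `r = max (β / L) 0`, `δ = (1 - r) / (2k)`
  have hk1 : (1 : ℝ) < k := by exact_mod_cast hk
  have hk2 : (2 : ℝ) ≤ k := by exact_mod_cast hk
  have hk0 : (0 : ℝ) < k := one_pos.trans hk1
  have hkne : (k : ℝ) ≠ 0 := hk0.ne'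
  have hlogk : 0 < Real.log k := Real.log_pos hk1
  obtain ⟨L, hL⟩ : ∃ L : ℝ, L = 5 * Real.log k / k := ⟨_, rfl⟩
  have hLpos : 0 < L := hL ▸ div_pos (mul_pos (by norm_num) hlogk) hk0
  have hLne : L ≠ 0 := hLpos.ne'
  rw [← hL] at hβ
  obtain ⟨r, hr⟩ : ∃ r : ℝ, r = max (β / L) 0 := ⟨_, rfl⟩
  have hr0 : 0 ≤ r := hr ▸ le_max_right _ _
  have hr1 : r < 1 := hr ▸ max_lt ((div_lt_one hLpos).2 hβ) one_pos
  have hβr : β ≤ r * L := by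
    rw [hr]
    calc β = β / L * L := by field_simp
      _ ≤ max (β / L) 0 * L := by gcongr; exact le_max_left _ _
  obtain ⟨δ, hδ⟩ : ∃ δ : ℝ, δ = (1 - r) / (2 * k) := ⟨_, rfl⟩
  have hδpos : 0 < δ := hδ ▸ div_pos (by linarith) (by positivity)
  have hδ1 : δ < 1 := by
    rw [hδ, div_lt_one (by positivity)]
    linarith
  have hkδ : (k : ℝ) * δ = (1 - r) / 2 := by
    rw [hδ]
    field_simp
  have hlogδ' : Real.log δ < 0 := Real.log_neg hδpos hδ1
  have hlogδne : Real.log δ ≠ 0 := hlogδ'.ne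
  have hlogδ : 0 < -Real.log δ := neg_pos.2 hlogδ'
  -- the choice of `b₁`
  refine ⟨1 / (k * -Real.log δ), by positivity, ?_⟩
  intro b hb hb₁ A
  -- the gap `g = L (1 + r) / 2 - β ≥ L (1 - r) / 2 > 0`
  obtain ⟨g, hg⟩ : ∃ g : ℝ, g = L * (1 + r) / 2 - β := ⟨_, rfl⟩
  have hgpos : 0 < g := by
    rw [hg]
    nlinarith [mul_pos hLpos (sub_pos.2 hr1)]
  refine ⟨g / 2, half_pos hgpos, ?_⟩
  -- for `0 < b ≤ b₁`: `exp (-1/(bk)) ≤ δ`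
  have hexpδ : Real.exp (-(1 / (b * k))) ≤ δ := by
    have h1 : b * (k * -Real.log δ) ≤ 1 := by
      calc b * (k * -Real.log δ) ≤ 1 / (k * -Real.log δ) * (k * -Real.log δ) := by gcongr
        _ = 1 := by field_simp
    have h2 : -Real.log δ ≤ 1 / (b * k) := by
      rw [le_div_iff₀ (by positivity)]
      calc -Real.log δ * (b * k) = b * (k * -Real.log δ) := by ring
        _ ≤ 1 := h1
    calc Real.exp (-(1 / (b * k))) ≤ Real.exp (Real.log δ) := Real.exp_le_exp.2 (by linarith)
      _ = δ := Real.exp_log hδpos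
  -- the main estimate, eventually in `n`
  filter_upwards [cha_poly_le_exp (((k : ℝ) + 1) * 2 ^ (k + 1) * Real.exp 1)
    (A * (k + 1) + 2 ^ k) (half_pos hgpos)] with n hn K hK E hE₁ hE₂
  have hn0 : (0 : ℝ) ≤ n := Nat.cast_nonneg n
  have hE₀ : 1 - δ ≤ E := by linarith
  have hEnn : 0 ≤ E := by linarith
  -- Bernoulli: `E ^ k ≥ 1 + k (E - 1) ≥ 1 - k δ = (1 + r) / 2`
  have hEk : (1 + r) / 2 ≤ E ^ k := by
    have h1 := one_add_mul_sub_le_pow (show (-1 : ℝ) ≤ E by linarith) k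
    have h2 : (k : ℝ) * -δ ≤ k * (E - 1) := mul_le_mul_of_nonneg_left (by linarith) hk0.le
    linarith
  have hq0 : 0 ≤ (E / 2) ^ k := by positivity
  have hq1 : (E / 2) ^ k ≤ 1 := pow_le_one₀ (by positivity) (by linarith)
  -- `(1 - (E/2)^k)^m ≤ e · exp (-(L (1+r)/2) n)`
  have hA : (1 - (E / 2) ^ k) ^ ⌊5 * 2 ^ k * Real.log k / k * n⌋₊ ≤
      Real.exp 1 * Real.exp (-(L * (1 + r) / 2 * n)) := by
    set m := ⌊5 * 2 ^ k * Real.log k / k * n⌋₊ with hm_def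
    have hm : 5 * 2 ^ k * Real.log k / k * n - 1 < (m : ℝ) := Nat.sub_one_lt_floor _
    have hαq : (E / 2) ^ k * (5 * 2 ^ k * Real.log k / k) = E ^ k * L := by
      rw [hL, div_pow]
      field_simp
    have h1 : (E / 2) ^ k * (5 * 2 ^ k * Real.log k / k * n - 1) ≤ (E / 2) ^ k * m :=
      mul_le_mul_of_nonneg_left hm.le hq0
    have h2 : (E / 2) ^ k * (5 * 2 ^ k * Real.log k / k * n - 1) =
        E ^ k * L * n - (E / 2) ^ k := by
      rw [← hαq]
      ring
    have h12 : E ^ k * L * n - (E / 2) ^ k ≤ (E / 2) ^ k * m := h2.symm.trans_le h1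
    have h3 : (1 + r) / 2 * L * n ≤ E ^ k * L * n := by gcongr
    have hkey : -((E / 2) ^ k * m) ≤ 1 - L * (1 + r) / 2 * n := by linarith
    calc (1 - (E / 2) ^ k) ^ m ≤ (Real.exp (-((E / 2) ^ k))) ^ m := by
          apply pow_le_pow_left₀ (sub_nonneg.2 hq1)
          linarith [Real.add_one_le_exp (-((E / 2) ^ k))]
      _ = Real.exp ((m : ℝ) * -((E / 2) ^ k)) := (Real.exp_nat_mul _ _).symm
      _ ≤ Real.exp (1 + -(L * (1 + r) / 2 * n)) := Real.exp_le_exp.2 (by linarith)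
      _ = Real.exp 1 * Real.exp (-(L * (1 + r) / 2 * n)) := Real.exp_add _ _
  -- `K + 1 ≤ 2 (n + 1) ^ A`
  have hKb : (K : ℝ) + 1 ≤ 2 * ((n : ℝ) + 1) ^ A := by
    have h1 : (K : ℝ) ≤ (n : ℝ) ^ A := by exact_mod_cast hK
    have h2 : (n : ℝ) ^ A ≤ ((n : ℝ) + 1) ^ A := pow_le_pow_left₀ hn0 (by linarith) A
    have h3 : (1 : ℝ) ≤ ((n : ℝ) + 1) ^ A := one_le_pow₀ (by linarith)
    linarith
  -- assemble
  calc ((k : ℝ) + 1) * ((K : ℝ) + 1) ^ (k + 1) * ((((n : ℝ) + 1) ^ (2 ^ k)) * Real.exp (n * β)) *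
        (1 - (E / 2) ^ k) ^ ⌊5 * 2 ^ k * Real.log k / k * n⌋₊
      ≤ ((k : ℝ) + 1) * ((K : ℝ) + 1) ^ (k + 1) * ((((n : ℝ) + 1) ^ (2 ^ k)) * Real.exp (n * β)) *
        (Real.exp 1 * Real.exp (-(L * (1 + r) / 2 * n))) :=
        mul_le_mul_of_nonneg_left hA (by positivity)
    _ ≤ ((k : ℝ) + 1) * (2 * ((n : ℝ) + 1) ^ A) ^ (k + 1) *
        ((((n : ℝ) + 1) ^ (2 ^ k)) * Real.exp (n * β)) *
        (Real.exp 1 * Real.exp (-(L * (1 + r) / 2 * n))) := by gcongr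
    _ = ((k : ℝ) + 1) * 2 ^ (k + 1) * Real.exp 1 * ((n : ℝ) + 1) ^ (A * (k + 1) + 2 ^ k) *
        (Real.exp (n * β) * Real.exp (-(L * (1 + r) / 2 * n))) := by ring
    _ ≤ Real.exp (g / 2 * n) * (Real.exp (n * β) * Real.exp (-(L * (1 + r) / 2 * n))) := by
        gcongr
    _ = Real.exp (-(g / 2 * n)) := by
        rw [← Real.exp_add, ← Real.exp_add, hg]
        congr 1
        ring

end Literature.Computability.Complexity.HuangSellke2025Chain

end Part17

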